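import Mathlib
import HarnessLib
import HarnessLib.Audit
import Summits.Langlands.Statement
import Summits.Langlands.Langlands.Theses.TriangularRankLadder
import Literature.NumberTheory.GaloisRepresentations.GaloisRep
import Literature.NumberTheory.GaloisRepresentations.AbsGaloisGroup
import Literature.NumberTheory.GaloisRepresentations.AbsGaloisOuterConj
import Literature.NumberTheory.GaloisRepresentations.ContinuousRep
import Literature.NumberTheory.PAdicHodge.FontaineDpst
import Literature.FieldTheory.AlgClosed.PadicAlgClEquivComplex
import Literature.NumberTheory.GaloisRepresentations.InducedGaloisRep
import HarnessLib.Audit.Status.Attr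

/-!
Route: PolarisationCarving

# Route PolarisationCarving — open (B)-residual of GL(n) reciprocity carved along the Taylor–Wiles
numerical-coincidence barrier — totally-odd-polarisable type | TR/CM type, unpolarised (positive
defect) | not of TR/CM type

X = the born lineage route TriangularRankLadder (gen 2, route-Langlands-TriangularRankLadder, rev
83841bb99b12:
Langlands ⟸ RankOne ∧ RankTwoPrimitive ∧ HigherRankPrimitive ∧ CyclicInductionTransport ∧ W_geo ∧
JS(2.2) ∧ JS(2.3) ∧ CrossPrimeClass ∧ L∤R ∧ CRD)
with its two OPEN (B)-binders RankTwoPrimitiveAutomorphy (stmt-Langlands-24803) and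
HigherRankPrimitiveAutomorphy (stmt-Langlands-24804, the
lineage residual) REPLACED by the three cells obtained by carving the twist-primitive box (all ranks
n ≥ 2 merged) along the SCOPE PREDICATE of
the catalogued, tree-proved barrier
`Literature.Barriers.Langlands.TaylorWilesNumericalCoincidenceNarrow` (defect-zero patching is
blocked for
GL_n-valued r EXACTLY when r has no totally odd polarisation — clauses (α) «F neither totally real
nor CM» and (β) «TR/CM but no character χ with
r^(c) ≅ r^∨ ⊗ χ, ε_v = 1 at all v ∣ ∞», BLGGT §2.1): POL PolarisedTypeAutomorphy (ρ of
TOTALLY-ODD-POLARISABLE TYPE — the CHT/BLGGT/unitary-Shimura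
world; NEW, rank 4, attackable by engine), UNP UnpolarisedTRCMTypeAutomorphy (ρ of TR/CM type but
NOT of polarisable type — clause (β), the
positive-defect world of Calegari–Geraghty / ACC+ / Caraiani–Newton; NEW, rank 3), NTC
NonTRCMTypeAutomorphy (ρ NOT of TR/CM type — clause (α),
no evasion in print; NEW, rank 2, DECLARED RESIDUAL). «Of polarisable type» = some solvable-Galois
sandwich K₀ ⊆ L ⊇ K, a pinned-geometric ρ₀ over
K₀ and a character χ of Γ_L with tr ρ|L = tr χ · tr ρ₀|L, where ρ₀ is totally odd polarisable in
BLGGT's sense typed in matrices (K₀ totally real: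
ᵗρ₀ A ρ₀ = μ·A with ᵗA = μ(c)·A at every complex conjugation; K₀ CM over a totally real F of index
2: ᵗρ₀(σ) B ρ₀(θ_c σ) = μ|(σ)·B with B symmetric and
μ(c) = −1); «of TR/CM type» = the same sandwich with K₀ merely totally real or CM — both saturated
under the print groupoid (⊗χ, solvable base
change, solvable descent) so that every cell is orbit-closed. The split is EXACT with no transport
item: POL ∧ UNP ∧ NTC ⟺ R2 ∧ R3p (node
`primitive_iff_polarisationCells`, two excluded middles; the inclusion polarisable ⊆ TR/CM type is a
node theorem, `isOfTRCMType_of_isOfPolarisedType`),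
and each cell is Langlands restricted to a sub-box (`Cert.polarisedType_of_langlands` &c.).
decomp-langlands lens-6 «barrier-complement carving»,
gen 8, RESIDUAL MODE; OR-sibling of ParityLadder (lens-1 g6) and ResidualAvatarLadder (gen 3) under
TriangularRankLadder; no idea card realised (cell output).
Lean: `PolarisedTypeAutomorphy ∧ UnpolarisedTRCMTypeAutomorphy ∧ NonTRCMTypeAutomorphy ∧
RankOneAutomorphy ∧ CyclicInductionTransport ∧ GeometricAvatarExistence ∧ PairLBoundary ∧ PairLPole
∧ CrossPrimeClass ∧ CompatibilityAwayFromLR ∧ CanonicalReciprocityData`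

## Assembly
Level 3 (NEW, this node): for an irreducible pinned-geometric twist-primitive ρ of rank n ≥ 2, case
on «of polarisable type?» and then on «of TR/CM
type?» — POL / UNP / NTC — giving the whole twist-primitive box for every n ≥ 2 (`hP` in glue.lean,
a `by_contra` chain that reads the two dials off
the three cells by unification, restating nothing), hence RankTwoPrimitiveAutomorphy (n = 2) and
HigherRankPrimitiveAutomorphy (n ≥ 3). Levels 2 and
1 = the born parent TriangularRankLadder's `closes` verbatim (RankOne + strong induction on the rank
with cyclic automorphic induction; triangular
(A)-coupling; N0 assembly), called BY NAME in glue.lean (the shared items are byte-identical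
re-declarations, definitionally the parent's).
`closes` certified by `ledger route check --native`; all 11 binders used, 6 of them open cruxes
(NTC, UNP, POL, W_geo, CrossPrimeClass,
CompatibilityAwayFromLR), 5 supports (R1 24805, AI 24806, JS(2.2), JS(2.3), CRD 17930).

Rationale: WHY THIS LINE. Every automorphy-lifting theorem in print for GL_n in a single cohomological degree
runs on a group where the Greenberg–Wiles count balances, and the
tree PROVES (`TaylorWilesNumericalCoincidenceNarrow_holds`: `chtCoincidenceGL_iff`,
`chtCoincidenceGn_iff`) that for a GL_n-valued r this happens exactly
when r admits a TOTALLY ODD POLARISATION — Clozel–Harris–Taylor 2008 §1/§2.1/Cor. 2.3.6 (the group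
𝒢_n, «χ(c_v) = −1 for all v ∣ ∞»), Booher §1, and the
definition of «totally odd, essentially (conjugate) self-dual» in Barnet-Lamb–Gee–Geraghty–Taylor,
Ann. of Math. 179 (2014) §2.1 [corpus:
paper:arxiv-1010.2561 p. 17 L18–52: TR ⇒ r factors through GSp_n (μ(c_v) = −ε_v) or GO_n (μ(c_v) =
ε_v); CM ⇒ extension to 𝒢_n; totally odd ⇔ ε_v = 1
∀ v ∣ ∞] [galaxy: panama:350795748868160 c324032, the 𝒢_n-extension of an essentially conjugate
self-dual ρ]. So the barrier's `blocks:` line is a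
DECIDED predicate on ρ, and carving the lineage's open (B)-box along it separates, by construction
rather than by taste, (i) the exact domain of the
defect-zero engines (POL: CHT, BLGGT Thm 4.2.1/4.5.1, Thorne's adequacy improvements, the
unitary-Shimura-variety constructions — and, by the node
theorem `Cert.isOfPolarisedType_of_isOdd_two` = «GL₂ = GSp₂» via the tree lemma
`Endoscopy.transpose_mul_J₂_mul`, the ENTIRE classical odd GL₂ world over
totally real fields), (ii) the positive-defect world where patching must be derived (UNP: l₀ > 0 —
Calegari–Geraghty [corpus: paper:arxiv-1209.5309 p. 4],
the ten-author theorem's potential automorphy over CM fields (ACCGHLNSTT2023), Caraiani–Newton's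
modularity of elliptic curves over imaginary quadratic F
with X₀(15)(F) finite [corpus: paper:arxiv-2301.10509 p. 2, Thm 1.1], and ONE proved rank-3
non-polarisable instance over ℚ: the van Geemen–Top motive of
level Γ₀(128) [corpus: paper:arxiv-1811.11544 pp. 2–3, «not geometrically polarizable, not odd in
the sense of Johansson–Thorne»]), and (iii) the dark
complement where no Shimura variety, no eigenvariety, no patching count and no Ihara avatar exists
(NTC: base fields not solvably of TR/CM type —
`ShimuraVarietyRealizationBarrier` on the automorphic side, clause (α) on the Galois side). The
dials are typed over existing vocabulary only
(`FramedRep.trace`, `FramedGaloisRep.restrictField`, `absGaloisOuterConj` for r^c,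
`IsComplexConjugation`, Mathlib `Matrix.transpose`/`IsUnit`/
`NumberField.IsTotallyReal`/`IsTotallyComplex`/`IsCMField`/`IsSolvable`/`IsGalois`); the sandwich is
ParityLadder's, so lens-1 g6's alternating-closure
lemma (memo §3 there) makes all three cells orbit-closed under twist / solvable base change /
solvable descent, and automorphic induction leaves the
twist-primitive box. What no prior route or cell does: every route of this summit that mentions
polarisability uses it as a HYPOTHESIS of a single
lifting fact (BLGGT ports, EssentialSelfDualGO4 refuted item 16951 on the (A)-side) — never as a
partition of the open residual; the six decomp lenses
cut by rank, parity, descent type of the FIELD, Hodge–Tate regularity, residual image, level,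
monodromy places, purity and p-adic Hodge components (census
v10 / TREE v4.4), none by the self-duality structure of ρ. Imported area: the arithmetic of
similitude groups / Bellaïche–Chenevier signs (bilinear forms
with Galois-equivariant multiplier) as a grading of reciprocity; nothing else new.

RANKED CRUXES. #2 NonTRCMTypeAutomorphy (crux) — NTC (NOT OF TR/CM TYPE — clause (α) of the barrier,
saturated; NEW, DECLARED RESIDUAL of this node): every irreducible pinned-geometric twist-primitive
ρ : Γ_K → GL_n(ℚ̄_ℓ), n ≥ 2, over any number field K, for which there is NO solvable-Galois sandwich
K₀ ⊆ L ⊇ K (L Galois with solvable group over K and over K₀), pinned-geometric ρ₀ over a TOTALLY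
REAL OR CM field K₀ and character χ of Γ_L with tr ρ|L = tr χ · tr ρ₀|L, is weakly automorphic (some
L-algebraic cuspidal π on GL_n/K, Satake–Frobenius compatible a.e.). Members: generic elliptic
curves and motives over fields of mixed signature (census AT3 E/ℚ(⁴√2), AT15 E₈₉/ℚ(a)) and over
non-CM totally imaginary fields, in every rank; solvable-image Artin types are NOT members (they
trivialise into POL). [difficulty: open-problem] (why it might fail: asserts reciprocity for generic
motives over mixed-signature fields in every rank, where neither direction has a single non-solvable
instance in print (no Shimura variety, l₀ > 0 AND no polarisation); one non-automorphic
E/ℚ(⁴√2)-type ρ refutes it.) [arXiv:1010.2561, ClozelHarrisTaylor2008, CalegariGeraghty2017,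
Literature.Barriers.Langlands.TaylorWilesNumericalCoincidenceNarrow,
Literature.Barriers.Langlands.ShimuraVarietyRealizationBarrier]
#3 UnpolarisedTRCMTypeAutomorphy (crux) — UNP (OF TR/CM TYPE BUT NOT OF POLARISABLE TYPE — clause
(β), the positive-defect world; NEW): the same conclusion for those twist-primitive ρ of rank n ≥ 2
that DO admit a solvable-Galois sandwich down to a pinned-geometric ρ₀ over a totally real or CM K₀
(up to a character on Γ_L) but admit NONE in which ρ₀ is totally odd polarisable (K₀ totally real
with ᵗρ₀ A ρ₀ = μ·A, ᵗA = μ(c)·A at every complex conjugation; or K₀ CM with ᵗρ₀(σ) B ρ₀(θ_c σ) =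
μ|(σ)·B, B symmetric, μ(c) = −1). Members: non-CM elliptic curves over imaginary quadratic F that
are not twists of base changes (PROVED when X₀(15)(F) is finite — Caraiani–Newton Thm 1.1; open
otherwise), regular non-conjugate-self-dual ρ over CM fields in rank ≥ 3 (potentially automorphic by
ACC+, automorphy open), non-self-dual rank-3 motives over ℚ (van Geemen–Top's level-128 motive
PROVED automorphic, arXiv:1811.11544; all others open), every irregular non-polarisable ρ.
[difficulty: open-problem] (why it might fail: (B) for GL_n over CM/TR fields minus the polarisable
sliver: automorphy (not potential) of regular non-self-dual ρ in rank ≥ 3 and of all irregular ones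
needs derived patching beyond print (l₀ > 0); one non-automorphic regular ρ over an imaginary
quadratic F refutes it.) [CalegariGeraghty2017, ACCGHLNSTT2023, arXiv:2301.10509, arXiv:1811.11544,
arXiv:1209.5309, Literature.Barriers.Langlands.TaylorWilesNumericalCoincidenceNarrow]
#4 PolarisedTypeAutomorphy (crux) — POL (OF TOTALLY-ODD-POLARISABLE TYPE — outside the barrier, the
defect-zero patching world; NEW, the ATTACKABLE cell): the same conclusion for those twist-primitive
ρ of rank n ≥ 2 that admit a solvable-Galois sandwich K₀ ⊆ L ⊇ K, a pinned-geometric ρ₀ over K₀ and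
a character χ of Γ_L with tr ρ|L = tr χ · tr ρ₀|L, where EITHER K₀ is totally real and ᵗρ₀(σ) A
ρ₀(σ) = μ(σ)·A for an invertible A, an ℓ-adic character μ and all σ, with ᵗA = μ(c)·A at every
complex conjugation c (GSp with μ(c_v) = −1 or GO with μ(c_v) = +1: ε_v = 1), OR K₀ is totally
complex with a totally real subfield F of index 2 and a character μ of Γ_F with μ(c) = −1 and a
symmetric invertible B with ᵗρ₀(σ) B ρ₀(θ_c σ) = μ|(σ)·B for every complex conjugation c ∈ Γ_F (r^c
≅ r^∨ ⊗ μ, ε_v = 1). Contains every odd rank-2 ρ over a totally real field (node theorem: A = J₂, μ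
= det), every RAESDC/RAECSDC-type ρ, symplectic ρ of abelian varieties over totally real fields, and
their solvable base changes and twists; engines: CHT, BLGGT Thm 4.2.1 / 4.5.1, Thorne, 10-author §6
(polarisable case), unitary Shimura varieties; open members: irregular polarisable ρ (weight-one
type in rank ≥ 3, abelian surfaces beyond BCGP's potential modularity), residually inadequate
images, small ℓ. [difficulty: open-problem] (why it might fail: irregular polarisable ρ (partial
weight one, abelian surfaces over TR fields, weight-one type in rank ≥ 3) have nothing beyond
potential modularity (NonRegularWeightBarrier); regular ones with inadequate residue or small ℓ
open; one non-modular abelian surface over a real quadratic field refutes it.) [arXiv:1010.2561,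
ClozelHarrisTaylor2008, arXiv:1812.09269, PilloniStroh2016, Thorne2012Adequate,
Literature.Barriers.Langlands.NonRegularWeightBarrier]
#5 GeometricAvatarExistence (crux) — W_geo — every L-algebraic cuspidal π on GL_n over any number
field has, for every ℓ and ι, SOME ℓ-adic ρ unramified almost everywhere, de Rham above ℓ for
Fontaine's pinned datum, and Satake–Frobenius compatible with (π, ι) almost everywhere (no
irreducibility asked). Verbatim the registered stub_weakExistence of crux stmt-Langlands-14328 (line
Sketch); implied by Langlands (landed weakExistence_of_langlands). [difficulty: open-problem] (why
it might fail: non-cohomological π (Maass forms, limits of discrete series beyond weight one) and π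
over mixed-signature K: no construction of any ℓ-adic avatar is known; every known one passes
through Shimura varieties (NonRegularWeightBarrier, ShimuraVarietyRealizationBarrier).)
[BuzzardGeeLMS2014, HarrisLanTaylorThorneRMS2016, Scholze2015, arXiv:2607.11763]
#6 CrossPrimeClass (crux) — Cross-prime transfer of local–global compatibility at v ∣ ℓ (clause (ii)
of sibling item stmt-Langlands-17534, writer frame piece verbatim): for an irreducible ℓ-adic avatar
ρ of an L-algebraic cuspidal π and a place v above ℓ, local–global compatibility at v for Rec
follows from that of any irreducible ℓ'-adic avatar ρ' of π with ℓ' not below v. [difficulty: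
open-problem] (why it might fail: for avatars built by congruences (torsion classes, non-polarizable
RA π over CM fields) compatibility at v ∣ ℓ is known only up to semisimplification / monodromy
(MonodromyNotClosedUnderPadicLimits); the framed statement needs Fontaine's C_WD for the compatible
system.) [Caraiani2014, BLGGT2014, arXiv:2607.11763]
#7 CompatibilityAwayFromLR (crux) — N0/sibling item stmt-Langlands-18084 verbatim (local–global
compatibility at the places v not above ℓ, for every Rec) — cited by id, attached by signature
dedup, not re-typed. [difficulty: open-problem] (why it might fail: full (monodromy included)
local–global compatibility at ramified v ∤ ℓ is known only for Shimura-type / polarizable π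
(Caraiani 2012) and up to monodromy in general (Varma); a torsion-class avatar with wrong monodromy
refutes it.) [Caraiani2012, Varma2014, HarrisLanTaylorThorneRMS2016]
#9 RankOneAutomorphy (support) — Sibling item stmt-Langlands-24805 verbatim (rank one: class field
theory + Weil + Serre); grade 1 of (B), the only (B)-input of grade 2 of (A). [difficulty: M]
[Weil1956, SerreAbelianLadic1968]
#9 CyclicInductionTransport (support) — Sibling item stmt-Langlands-24806 verbatim (automorphic
induction along cyclic layers, given all lower grades). [difficulty: L] [ArthurClozelAMS120,
Henniart2012]
#9 PairLBoundary (support) — Arthur–Clozel Ch. 3 (2.2) for Borel–Jacquet data: finite non-zero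
boundary values of the partial Rankin–Selberg L-function on Re s = 1 off the polar set — the
Literature named fact itself (no _holds yet; = stmt-Langlands-13622 unfolded). [difficulty: L]
[ArthurClozelAMS120, JacquetShalikaAJM1981II]
#9 PairLPole (support) — Arthur–Clozel Ch. 3 (2.3): the simple pole of the partial Rankin–Selberg
L-function of a cuspidal pair on the polar set — the Literature named fact itself (no _holds yet).
[difficulty: L] [ArthurClozelAMS120, JacquetShalikaAJM1981II]
#9 CanonicalReciprocityData (support) — N0/sibling item stmt-Langlands-17930 verbatim (a reciprocity
datum exists for every number field) — cited by id. [difficulty: M] [HarrisTaylor2001, Fontaine1994]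

TWO-LAYER PLAN. POL ⇐ (regular, residually adequate, ℓ large: PRINT — CHT / BLGGT Thm 4.2.1
(potentially diagonalizable) / Thorne; cited not re-filed) ∧ (n = 2 odd over
totally real K₀: PRINT in the paritious regular case (Hilbert modular lifting) and for elliptic
curves over real quadratic fields (Freitas–Le Hung–Siksek),
partial weight one / icosahedral over TR F ≠ ℚ open — shelf routes cited) ∧ (irregular polarisable
in rank ≥ 3, abelian surfaces: residual with an
INSTRUMENTABLE handle — BCGP potential modularity, the 2025 mod-3-generic theorem over ℚ (tree fact
bcgp2025_modThreeSurjective_modular_abelianSurface)).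
UNP ⇐ (E/F, F imaginary quadratic, X₀(15)(F) finite: PRINT, Caraiani–Newton) ∧ (X₀(15)(F) infinite:
open, COMPUTABLE handle = the census x015 tables
H40/H44/H47) ∧ (regular rank ≥ 3 over CM: potential automorphy PRINT (ACC+), automorphy open) ∧
(irregular: residual). NTC ⇐ nothing in print beyond
solvable-image Artin (which is not a member: it trivialises into POL) — residual, barrier-certified;
the one door recorded on the bus is lens-3 g7's Weil
restriction to a totally real core (route WeilRestrictionSplit), which moves the
conjugation-SOLVABLE part of clause (α) to TR fields MODULO its own
strong compatibility crux W⁺ 17415 — a different groupoid, acknowledged by name, not used here.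
Nothing below the cells is filed now (two-layer rule:
the cells are layer 2 under R2/R3p).

KILL CRITERIA. A cheap proof of any cell from another, or of any drop-one / pair implication toward
R2 or R3p or the root, makes the carving decorative — the
probes file certifies all such batteries FAIL today. A theorem transporting weak automorphy of a
LONE twist-primitive ρ across the polarisation dial by
something other than twist / solvable base change / solvable descent (e.g. an unconditional
insoluble descent, or «ρ automorphic ⇔ ρ ⊕ ρ^{c,∨}
automorphic on a unitary group» WITH descent back to GL_n for non-polarisable ρ) would merge UNP
into POL — the doubling trick gives potential automorphy
only and is exactly ACC+'s method, recorded. A refutation of any cell refutes 24803/24804 and hence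
Langlands (each cell is a consequence of the root:
`Cert.polarisedType_of_langlands`, `Cert.unpolarisedTRCMType_of_langlands`,
`Cert.nonTRCMType_of_langlands`). The route is CLOSED as exhausted if POL's
regular sub-box is landed as print facts and nothing in UNP/NTC moves within the tenure window —
then the node has done its job (POL banked, the
residual named by a theorem-line).

NOT DECOMPOSED YET. Inside POL: regular vs irregular, TR-disjunct (GSp/GO) vs CM-disjunct (unitary),
n = 2 vs n ≥ 3, sign μ(c) = ∓1; inside UNP: CM vs totally real K₀
(GL_n/TR, n ≥ 3, non-self-dual), elliptic curves over imaginary quadratic fields vs rank ≥ 3,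
regular vs irregular; inside NTC: conjugation-solvable
fields (lens-3's B_CS ∩ clause (α): Weil-restrictable to a TR core modulo W⁺) vs
conjugation-insoluble fields (lens-3's B_CI). Ranks are MERGED (n ≥ 2)
to keep the cone at 6 open binders; the rank-2 / rank-≥3 reading is recovered by
`primitive_iff_lineagePieces`. A fourth cell «polarisable but NOT
totally odd» (ε_v = −1 somewhere: e.g. GO_n-valued ρ with μ(c_v) = −1, the sign-(−1) unitary case of
Bellaïche–Chenevier) was considered and NOT filed
separately: it lies in UNP (TR/CM type, no TOTALLY ODD polarisation) where CHT's count misses by n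
generators per bad place
(`Cert.cht_fails_off_POL`), and isolating it costs a 7th open crux.

CHEAPEST FALSIFIER. `lean check` of HOME/nodes/lens-6-g8-PolarisationCarving.probesA.lean: the
batteries cell ↛ Langlands (each, each pair, all three cheaply), cell ↛ R2 /
↛ R3p, cell ↛ cell′ (six ordered pairs), «no cell / no negation of a cell provable by
trivial|tauto|simp|aesop», «TOP / SAT neither always true nor
always false cheaply» must all FAIL, the identities cell ↔ filed one-liner (`Iff.rfl` ×3) must
elaborate, and `#h21_crux_probe` must return CLEAN on all
three cells. Second: `ledger negatives --problem Langlands` — stmt-Langlands-16951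
(EssentialSelfDualGO4, refuted: «essentially self-dual similitude
character need not be a square») is the one polarisation-flavoured negative; no cell asserts or
needs a square root of μ (the dial quantifies ∃ μ, any
character), so the recorded witness does not bite. Third (print, one lookup): is there a regular
algebraic cuspidal π on GL_n over a CM field whose ρ_π is
conjugate self-dual up to a character with ε_v = −1 at some v (a «not totally odd» automorphic
polarised ρ)? Bellaïche–Chenevier's sign theorem says no
for the Galois representations in the cohomology of unitary Shimura varieties; a yes moves a sliver
of UNP into print, not a kill.

NUMBERS. Defect: l₀(Res_{F/ℚ} GL_n) = r₁⌊(n−1)/2⌋ + r₂(n−1) (`defectGL`, Khare–Thorne (6.2)); = 0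
iff n = 1 or (n = 2, F totally real) (`defectGL_eq_zero_iff`). CHT
count for 𝒢_n: balances iff every real place is odd, any n, d (`chtCoincidenceGn_iff`; sanity
`chtCoincidenceGn_three_realQuadratic`: LHS = RHS = 6; one
alternating place in 𝒢_4/ℚ: LHS 6 vs RHS 10, deficit 4 = n, `chtGn_four_alternating`). Print inside
POL: RAESDC/RAECSDC potential automorphy (BLGGT Thm
4.5.1, any n), automorphy with adequate residual image (Thorne 2012), all E over real quadratic
fields (FLHS 2015), abelian surfaces over TR fields
potentially modular (BCGP 2018, arXiv:1812.09269). Print inside UNP: E/F for the imaginary quadratic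
F with #X₀(15)(F) < ∞ (Caraiani–Newton 2023 Thm 1.1;
X₀(15) = 15a has rank 0 over ℚ; census x015 table: 60 794 imaginary quadratic discriminants scanned,
ONE undecided row d = −98795 under KIT L441),
potential automorphy of regular ρ over CM fields (ACC+ 2023), 1 proved non-polarisable rank-3 motive
over ℚ (van Geemen–Top level 128, arXiv:1811.11544).
Print inside NTC: the rank-2 solvable-image Artin members over solvably UNANCHORED K (e.g. K = ℚ(x⁵
− x − 1): restrictions of tetrahedral/octahedral Artin representations stay irreducible with soluble
image and are members of DNT, reached by Langlands–Tunnell — tree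
`Literature.NumberTheory.Automorphic.strongArtin_of_isSolvable`; lens-6-g14 memo §3 Lemma U, XS
erratum of record, DNT 33475 informal rev 7); 0 instances otherwise (over solvably anchored K the
solvable-image Artin representations are not members). Cone: 11 binders, 6 open cruxes, 3 open
supports (R1 24805, AI 24806, CRD 17930),
2 print facts (JS).

DEFINITION REQUESTS. None: IsTotallyOddPolarisable / IsOfPolarisedType / IsOfTRCMType /
IsPinnedGeometric / HasSelfTwist are inlined in the filed one-liners over existing tree
vocabulary (`Literature.NumberTheory.GaloisRepresentations.FramedRep.trace`,
`FramedGaloisRep.restrictField`, `absGaloisOuterConj`, `IsComplexConjugation`,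
`fontainePstAdicCompletion`, Mathlib `Matrix.transpose`, `IsUnit`, `Module.finrank`,
`NumberField.IsTotallyReal`, `NumberField.IsTotallyComplex`,
`NumberField.IsCMField`, `IsSolvable`, `IsGalois`); a named `def IsTotallyOddPolarisable` under
Literature/NumberTheory/GaloisRepresentations (BLGGT §2.1) would
shorten the cells ×3 and serve the BLGGT ports too — requested only if the writer files the node.

Novelty: Searches (2026-08-30): lit search --hybrid «totally odd essentially conjugate self-dual polarizable
automorphy lifting unitary group» → [corpus: book:arthur1989-simple-algebras-base-change p. 173],
[corpus: book:getz2024 p. 301], [corpus: book:emerton2022-moduli-stacks p. 223], [corpus: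
paper:arxiv-2312.01551 p. 10] — polarisation as a HYPOTHESIS of lifting theorems, never a partition;
lit search «van Geemen Top non-selfdual» → [corpus: paper:arxiv-1811.11544 pp. 2–3] (the proved UNP
instance); lit search «Caraiani Newton imaginary quadratic» → [corpus: paper:arxiv-2301.10509 p. 2];
lit search «Calegari Geraghty» → [corpus: paper:arxiv-1209.5309 pp. 4, 10], [corpus:
paper:arxiv-2109.14145 pp. 30–32]; lit galaxy search «essentially conjugate self-dual|totally odd
polariz» --star all → [galaxy: panama:350795748868160 c324032] only; «conjugate
self-dual|polarizable Galois» --star panama → [galaxy: panama:311204740333602], [galaxy: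
panama:513111152918550]; «neither totally real nor CM|not totally real or CM» --star all → 0 hits;
«Calegari-Geraghty» --star panama → [galaxy: panama:252509717266446] (AWS 2017). Bus: rg
«polari|self-dual|conjugate self» over HOME/STATUS.md NODE lines L1–L443 → prose only (lens-1 g6
barrier placement «TwistedEndoscopySelfDual: non-polarizable ρ inside PO», lens-3 g7
«BLGGT/10-author boxes» inside REG_TR) — no node uses polarisability as a dial.
Nearest prior art found: in tree — the BLGGT single-theorem ports
(`BLGGT2014_thm421_GL2_totallyReal`, `BLGG  [refs: 2109.14145, book:arthur1989-simple-algebras-base-change, book:getz2024, book:emerton2022-moduli-stacks, paper:arxiv-2312.01551, paper:arxiv-1811.11544, paper:arxiv-2301.10509, paper:arxiv-1209.5309, paper:arxiv-2109.14145]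

Barriers (technique_class: barrier-carving, polarisation, taylor-wiles defect): - technique_class: barrier-carving, polarisation, taylor-wiles defect
- Literature.Barriers.Langlands.TaylorWilesNumericalCoincidenceNarrow: THE DIAL. POL is OUTSIDE by
definition (evasion (i) of the barrier's `evasions_known`: change the group to 𝒢_n / GSp / GO —
`Cert.cht_balances_on_POL` re-exports `chtCoincidenceGn_totallyOdd`); UNP is INSIDE clause (β) (bet
= positive-defect patching: Calegari–Geraghty, ACC+, Caraiani–Newton — evasions (ii)/(iii), print up
to «potential» in the regular case; `Cert.cht_fails_off_POL`); NTC is INSIDE clause (α) with NO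
evasion in print — it is the declared residual, and the barrier is exactly what certifies the cut
UNP | NTC | POL as a theorem-line rather than a taste-line.
- Literature.Barriers.Langlands.TaylorWilesNumericalCoincidence: THE DIAL, same placement as the
Narrow decl above — POL is the sub-box where the CHT/BLGGT numerical coincidence HOLDS by definition
(totally-odd-polarisable type, tree `chtCoincidenceGn_totallyOdd` re-exported as
Cert.cht_balances_on_POL), so patching engines apply INSIDE POL and are never invoked on UNP/NTC;
UNP (positive defect, Calegari–Geraghty l₀ > 0) and NTC (no TR/CM sandwich) are exactly the cells
where the coincidence FAILS (Cert.cht_fails_off_POL) — they are carried as OPEN / DECLARED RESIDUAL,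
not attacked by defect-zero patching: the barrier is MET HONESTLY as the carving dial, not claimed
beaten.
- Literature.Barriers.Langlands.ShimuraVarietyRealizationBarrier: NTC is INSIDE head-on (mixed-si

History (route lifecycle, newest last):
- 2026-08-30T13:37:22Z · rev 2: restated UnpolarisedTRCMTypeAutomorphy_of_split (stmt-Langlands-32661 proved) — render-order workaround step 1/2 (writer-1-g4 under tenure) before the lens-6-g10 OrdinaryCompanionCarving --resplit of UnpolarisedTRCMTypeAutomorphy (NODE L562 (planner-decomp-langlands-writer-1-g4-0)
- 2026-08-30T21:00:23Z · rev 7: informal re-worded for DeepNonTRCMTypeAutomorphy (planner-decomp-langlands-writer-1-g5-0)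

sub-problem: Langlands · status: draft · opened planner-decomp-langlands-writer-1-g3-0 2026-08-30T10:12:10Z · rev 8 · ledger route-Langlands-PolarisationCarving
GENERATED by the gate from the ledger (D-0016/17). Provers cite these decls: `theorem foo : Summit.Langlands.Langlands.Theses.PolarisationCarving.<Decl> := …` in Summits/Langlands/Langlands/Theorems/<Name>.lean.
-/

namespace Summit.Langlands.Langlands.Theses.PolarisationCarving

open scoped BigOperators Topology Manifold Classical MeasureTheory ProbabilityTheory Matrix InnerProductSpace ComplexConjugate ContinuousMap
open Filter Set Function TopologicalSpace MeasureTheory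

attribute [summit_statement] _root_.Langlands

/-- item stmt-Langlands-32054 · crux · rank 2 · SPLIT (gen 1) into InducedRegularTypeAutomorphy, AbelianSurfaceTypeAutomorphy, DeepNonTRCMTypeAutomorphy + glue NonTRCMTypeAutomorphy_of_split · direct attempts still welcome (low priority) · by planner
why it might fail: asserts reciprocity for generic motives over mixed-signature fields in every rank, where neither direction has a single non-solvable instance in print (no Shimura variety, l₀ > 0 AND no polarisation); one non-automorphic E/ℚ(⁴√2)-type ρ refutes it.
sources: arXiv:1010.2561, ClozelHarrisTaylor2008, CalegariGeraghty2017, Literature.Barriers.Langlands.TaylorWilesNumericalCoincidenceNarrow, Literature.Barriers.Langlands.ShimuraVarietyRealizationBarrier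
[crux] NTC (NOT OF TR/CM TYPE — clause (α) of the barrier, saturated; NEW, DECLARED RESIDUAL of this
node): every irreducible pinned-geometric twist-primitive ρ : Γ_K → GL_n(ℚ̄_ℓ), n ≥ 2, over any
number field K, for which there is NO solvable-Galois sandwich K₀ ⊆ L ⊇ K (L Galois with solvable
group over K and over K₀), pinned-geometric ρ₀ over a TOTALLY REAL OR CM field K₀ and character χ of
Γ_L with tr ρ|L = tr χ · tr ρ₀|L, is weakly automorphic (some L-algebraic cuspidal π on GL_n/K,
Satake–Frobenius compatible a.e.). Members: generic elliptic curves and motives over fields of mixed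
signature (census AT3 E/ℚ(⁴√2), AT15 E₈₉/ℚ(a)) and over non-CM totally imaginary fields, in every
rank; solvable-image Artin types are NOT members (they trivialise into POL). [difficulty:
open-problem] [TAGS: RESIDUAL MODE node lens-6-g8 PolarisationCarving (bus L482; CHILD route of
route-Langlands-TriangularRankLadder refining its declared residual R3p =
HigherRankPrimitiveAutomorphy stmt-Langlands-24804 together with R2 24803 through the ONE EQUIV R2 ∧
R3p ⟺ PrimitiveAutomorphy), crit-1 g3 CLEARED 2026-08-30T10:11:44Z STATUS L488 (CRITIC-LEDGER row
104); census of record HOME/census/COSTUME-CENSUS- -/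
@[route_item "route-Langlands-PolarisationCarving", crux]
def NonTRCMTypeAutomorphy : Prop :=
  ∀ (K : Type) [Field K] [NumberField K] (n : ℕ) (hcpt : Literature.NumberTheory.Automorphic.isCompact_glFiniteIntegralLevel n K), 2 ≤ n → ∀ (ℓ : ℕ) [Fact ℓ.Prime] (ι : PadicAlgCl ℓ ≃+* ℂ) (ρ : Literature.NumberTheory.GaloisRepresentations.FramedGaloisRep K (PadicAlgCl ℓ) n), ρ.toGaloisRep.IsIrreducible → ((∀ᶠ v : IsDedekindDomain.HeightOneSpectrum (NumberField.RingOfIntegers K) in Filter.cofinite, ρ.IsUnramifiedAt v) ∧ ∀ (v : IsDedekindDomain.HeightOneSpectrum (NumberField.RingOfIntegers K)) (hv : ((ℓ : ℕ) : NumberField.RingOfIntegers K) ∈ v.asIdeal), (Literature.NumberTheory.PAdicHodge.fontainePstAdicCompletion v ℓ hv).IsDeRhamFramed (ρ.toLocal v)) → ¬ (∃ η : Literature.NumberTheory.GaloisRepresentations.FramedGaloisRep K (PadicAlgCl ℓ) 1, (∃ᶠ v : IsDedekindDomain.HeightOneSpectrum (NumberField.RingOfIntegers K) in Filter.cofinite,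 ∃ a : PadicAlgCl ℓ, a ≠ 1 ∧ η.HasFrobCharpolyAt v (Polynomial.X - Polynomial.C a)) ∧ ∀ᶠ v : IsDedekindDomain.HeightOneSpectrum (NumberField.RingOfIntegers K) in Filter.cofinite, ∃ (P : Polynomial (PadicAlgCl ℓ)) (a : PadicAlgCl ℓ), ρ.HasFrobCharpolyAt v P ∧ η.HasFrobCharpolyAt v (Polynomial.X - Polynomial.C a) ∧ P.scaleRoots a = P) → ¬ (∃ (L : Type) (_ : Field L) (_ : NumberField L) (_ : Algebra K L), IsGalois K L ∧ IsSolvable (L ≃ₐ[K] L) ∧ ∃ (K₀ : Type) (_ : Field K₀) (_ : NumberField K₀) (_ : Algebra K₀ L), IsGalois K₀ L ∧ IsSolvable (L ≃ₐ[K₀] L) ∧ ∃ (ρ₀ : Literature.NumberTheory.GaloisRepresentations.FramedGaloisRep K₀ (PadicAlgCl ℓ) n) (χ : Literature.NumberTheory.GaloisRepresentations.FramedGaloisRep L (PadicAlgCl ℓ) 1), ((∀ᶠ v : IsDedekindDomain.HeightOneSpectrum (NumberField.RingOfIntegers K₀) in Filter.cofinite, ρ₀.IsUnramifiedAt v) ∧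 ∀ (v : IsDedekindDomain.HeightOneSpectrum (NumberField.RingOfIntegers K₀)) (hv : ((ℓ : ℕ) : NumberField.RingOfIntegers K₀) ∈ v.asIdeal), (Literature.NumberTheory.PAdicHodge.fontainePstAdicCompletion v ℓ hv).IsDeRhamFramed (ρ₀.toLocal v)) ∧ (NumberField.IsTotallyReal K₀ ∨ NumberField.IsCMField K₀) ∧ ∀ g : Field.absoluteGaloisGroup L, Literature.NumberTheory.GaloisRepresentations.FramedRep.trace (ρ.restrictField L) g = Literature.NumberTheory.GaloisRepresentations.FramedRep.trace χ g * Literature.NumberTheory.GaloisRepresentations.FramedRep.trace (ρ₀.restrictField L) g) → ∃ π : Literature.NumberTheory.Automorphic.CuspidalAutomorphicRepData n K hcpt, π.1.IsLAlgebraic ∧ ∀ᶠ v : IsDedekindDomain.HeightOneSpectrum (NumberField.RingOfIntegers K) in Filter.cofinite, SatakeFrobCompatibleAt ι π.1 ρ v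

-- parent: NonTRCMTypeAutomorphy · child (gen 1)
/--     item stmt-Langlands-33473 · crux · rank 201 · open
    parent: NonTRCMTypeAutomorphy · by planner
    why it might fail: S-implied (false only with ¬Langlands); as a TARGET: print reaches only POTENTIAL automorphy of Ind ρ₀ over a TR F′ (BLGGT 4.5.1: pot. diagonalisable, r̄ irreducible over F₀(ζ_ℓ)); descent F′ → F₀ → K₀ (w1) and the AI-fibre matching for n > 2 (w4) not in print; rank-2 slice a ghost.
    sources: arXiv:1010.2561, arXiv:1812.09269, doi:10.1515/9781400882403, arXiv:1207.6724, Literature/Barriers/Langlands/ShimuraVarietyRealizationBarrier.lean, Literature/Barriers/Langlands/TaylorWilesNumericalCoincidence.lean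
[crux] [NEW · WEAKER than S and than NTC (sub-box of NTC 32054) · the barrier's OWN accessible side
d = [K₀ : K₀⁺] = 2 (ShimuraVarietyRealizationBarrier §Narrowing, `mixedQuadratic_profile`) ·
ATTACKABLE-BY-ENGINE up to «potential» and the named warts] IRT = weak automorphy (cuspidal
L-algebraic π on GL_n/K with Satake = Frobenius at almost all v) of every irreducible,
pinned-geometric, twist-primitive ρ : Γ_K → GL_n(ℚ̄_ℓ), n ≥ 2, that is NOT of TR/CM type (no
solvable-Galois sandwich K₀ ⊆ L ⊇ K with a pinned-geometric avatar ρ₀ over a totally real or CM K₀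
and tr ρ|L = tr χ · tr ρ₀|L — NTC's box verbatim) but IS OF INDUCED-REGULAR TYPE: some
solvable-Galois sandwich avatar ρ₀ : Γ_{K₀} → GL_n(ℚ̄_ℓ) of ρ (same grammar: L Galois-solvable over
K and over K₀, ρ₀ pinned-geometric, character χ of Γ_L, trace identity on Γ_L) lives over a field K₀
with a TOTALLY REAL subfield F₀ of index 2 such that r := Ind_{Γ_{K₀}}^{Γ_{F₀}} ρ₀ : Γ_{F₀} →
GL_{2n}(ℚ̄_ℓ) (tree `FramedGaloisRep.induce`) is ODD ESSENTIALLY SELF-DUAL (∃ character μ,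
invertible Gram matrix A: ᵗr(σ)·A·r(σ) = μ(σ)A ∀σ, ᵗA = μ(c)A at every complex conjugation c — the
totally-real branch of g8's IsTotallyOddPolarisable VERBATIM) an -/
@[route_item "route-Langlands-PolarisationCarving"]
def InducedRegularTypeAutomorphy : Prop :=
  ∀ (K : Type) [Field K] [NumberField K] (n : ℕ) (hcpt : Literature.NumberTheory.Automorphic.isCompact_glFiniteIntegralLevel n K), 2 ≤ n → ∀ (ℓ : ℕ) [Fact ℓ.Prime] (ι : PadicAlgCl ℓ ≃+* ℂ) (ρ : Literature.NumberTheory.GaloisRepresentations.FramedGaloisRep K (PadicAlgCl ℓ) n), ρ.toGaloisRep.IsIrreducible → ((∀ᶠ v : IsDedekindDomain.HeightOneSpectrum (NumberField.RingOfIntegers K) in Filter.cofinite, ρ.IsUnramifiedAt v) ∧ ∀ (v : IsDedekindDomain.HeightOneSpectrum (NumberField.RingOfIntegers K)) (hv : ((ℓ : ℕ) : NumberField.RingOfIntegers K) ∈ v.asIdeal), (Literature.NumberTheory.PAdicHodge.fontainePstAdicCompletion v ℓ hv).IsDeRhamFramed (ρ.toLocal v)) → ¬ (∃ η : Literature.NumberTheory.GaloisRepresentations.FramedGaloisRep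 K (PadicAlgCl ℓ) 1, (∃ᶠ v : IsDedekindDomain.HeightOneSpectrum (NumberField.RingOfIntegers K) in Filter.cofinite, ∃ a : PadicAlgCl ℓ, a ≠ 1 ∧ η.HasFrobCharpolyAt v (Polynomial.X - Polynomial.C a)) ∧ ∀ᶠ v : IsDedekindDomain.HeightOneSpectrum (NumberField.RingOfIntegers K) in Filter.cofinite, ∃ (P : Polynomial (PadicAlgCl ℓ)) (a : PadicAlgCl ℓ), ρ.HasFrobCharpolyAt v P ∧ η.HasFrobCharpolyAt v (Polynomial.X - Polynomial.C a) ∧ P.scaleRoots a = P) → (¬ (∃ (L : Type) (_ : Field L) (_ : NumberField L) (_ : Algebra K L), IsGalois K L ∧ IsSolvable (L ≃ₐ[K] L) ∧ ∃ (K₀ : Type) (_ : Field K₀) (_ : NumberField K₀) (_ : Algebra K₀ L), IsGalois K₀ L ∧ IsSolvable (L ≃ₐ[K₀] L) ∧ ∃ (ρ₀ : Literature.NumberTheory.GaloisRepresentations.FramedGaloisRep K₀ (PadicAlgCl ℓ) n) (χ : Literature.NumberTheory.GaloisRepresentations.FramedGaloisRep L (PadicAlgCl ℓ) 1), ((∀ᶠ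 v : IsDedekindDomain.HeightOneSpectrum (NumberField.RingOfIntegers K₀) in Filter.cofinite, ρ₀.IsUnramifiedAt v) ∧ ∀ (v : IsDedekindDomain.HeightOneSpectrum (NumberField.RingOfIntegers K₀)) (hv : ((ℓ : ℕ) : NumberField.RingOfIntegers K₀) ∈ v.asIdeal), (Literature.NumberTheory.PAdicHodge.fontainePstAdicCompletion v ℓ hv).IsDeRhamFramed (ρ₀.toLocal v)) ∧ (NumberField.IsTotallyReal K₀ ∨ NumberField.IsCMField K₀) ∧ ∀ g : Field.absoluteGaloisGroup L, Literature.NumberTheory.GaloisRepresentations.FramedRep.trace (ρ.restrictField L) g = Literature.NumberTheory.GaloisRepresentations.FramedRep.trace χ g * Literature.NumberTheory.GaloisRepresentations.FramedRep.trace (ρ₀.restrictField L) g) ∧ (∃ (L : Type) (_ : Field L) (_ : NumberField L) (_ : Algebra K L), IsGalois K L ∧ IsSolvable (L ≃ₐ[K] L) ∧ ∃ (K₀ : Type) (_ : Field K₀) (_ : NumberField K₀) (_ : Algebra K₀ L), IsGalois K₀ L ∧ IsSolvable (L ≃ₐ[K₀] L) ∧ ∃ (ρ₀ : Literature.NumberTheory.GaloisRepresentations.FramedGaloisRep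 K₀ (PadicAlgCl ℓ) n) (χ : Literature.NumberTheory.GaloisRepresentations.FramedGaloisRep L (PadicAlgCl ℓ) 1), ((∀ᶠ v : IsDedekindDomain.HeightOneSpectrum (NumberField.RingOfIntegers K₀) in Filter.cofinite, ρ₀.IsUnramifiedAt v) ∧ ∀ (v : IsDedekindDomain.HeightOneSpectrum (NumberField.RingOfIntegers K₀)) (hv : ((ℓ : ℕ) : NumberField.RingOfIntegers K₀) ∈ v.asIdeal), (Literature.NumberTheory.PAdicHodge.fontainePstAdicCompletion v ℓ hv).IsDeRhamFramed (ρ₀.toLocal v)) ∧ (∃ (F₀ : Type) (_ : Field F₀) (_ : NumberField F₀) (_ : Algebra F₀ K₀) (_ : FiniteDimensional F₀ K₀) (hF : Module.finrank F₀ K₀ = 2), NumberField.IsTotallyReal F₀ ∧ (∃ (μ : Literature.NumberTheory.GaloisRepresentations.FramedGaloisRep F₀ (PadicAlgCl ℓ) 1) (A : Matrix (Fin (2 * n)) (Fin (2 * n)) (PadicAlgCl ℓ)), IsUnit A.det ∧ (∀ σ : Field.absoluteGaloisGroup F₀, ((ρ₀.induce F₀ hF) σ).val.transpose * A * ((ρ₀.induce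 F₀ hF) σ).val = Literature.NumberTheory.GaloisRepresentations.FramedRep.trace μ σ • A) ∧ ∀ (φ : F₀ →+* ℝ) (c : Field.absoluteGaloisGroup F₀), Literature.NumberTheory.GaloisRepresentations.IsComplexConjugation φ c → A.transpose = Literature.NumberTheory.GaloisRepresentations.FramedRep.trace μ c • A) ∧ (∀ (v : IsDedekindDomain.HeightOneSpectrum (NumberField.RingOfIntegers F₀)) (hv : ((ℓ : ℕ) : NumberField.RingOfIntegers F₀) ∈ v.asIdeal) (τ : v.adicCompletion F₀ →+* PadicAlgCl ℓ), Continuous τ → ((ρ₀.induce F₀ hF).labelledHodgeTateWeightsAt v (Literature.NumberTheory.PAdicHodge.fontainePstAdicCompletion v ℓ hv).algebra (Literature.NumberTheory.PAdicHodge.fontainePstAdicCompletion v ℓ hv).𝔅 τ).Nodup)) ∧ ∀ g : Field.absoluteGaloisGroup L, Literature.NumberTheory.GaloisRepresentations.FramedRep.trace (ρ.restrictField L) g = Literature.NumberTheory.GaloisRepresentations.FramedRep.trace χ g * Literature.NumberTheory.GaloisRepresentations.FramedRep.trace (ρ₀.restrictField L) g)) → ∃ π : Literature.NumberTheory.Automorphic.CuspidalAutomorphicRepData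 n K hcpt, π.1.IsLAlgebraic ∧ ∀ᶠ v : IsDedekindDomain.HeightOneSpectrum (NumberField.RingOfIntegers K) in Filter.cofinite, SatakeFrobCompatibleAt ι π.1 ρ v

-- parent: NonTRCMTypeAutomorphy · child (gen 1)
/--     item stmt-Langlands-33474 · crux · rank 202 · open
    parent: NonTRCMTypeAutomorphy · by planner
    why it might fail: S-implied; as a TARGET print (BCGP 2018) gives only POTENTIAL modularity of E/K₀, K₀ quadratic over TR: modularity of the abelian surface Res E over F₀ off the p-distinguished ordinary locus, descent F′ → F₀, and motivicity of lone weight-{0,1} ρ₀ over mixed K₀ are all open.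
    sources: arXiv:1812.09269, doi:10.1515/9781400882403, arXiv:1010.2561, Literature/Barriers/Langlands/ShimuraVarietyRealizationBarrier.lean, Literature/Barriers/Langlands/NonRegularWeightBarrier.lean, Literature/Barriers/Langlands/TaylorWilesNumericalCoincidence.lean
[crux] [NEW · WEAKER than S and than NTC · d = 2 accessible side, IRREGULAR abelian-surface weight ·
UNDECIDED-with-test · INSTRUMENTABLE] AST = weak automorphy of every ρ in NTC's box that is NOT of
induced-regular type but IS OF ABELIAN-SURFACE TYPE: n = 2 and some solvable-Galois sandwich avatar
ρ₀ : Γ_{K₀} → GL₂(ℚ̄_ℓ) of ρ (NTC's grammar verbatim) has (i) a totally real subfield F₀ ⊆ K₀ of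
index 2 with Ind_{K₀}^{F₀} ρ₀ : Γ_{F₀} → GL₄(ℚ̄_ℓ) odd essentially self-dual (GSp₄-type, g8's TR
branch verbatim) and (ii) labelled Hodge–Tate weights exactly {0, 1} at EVERY place v ∣ ℓ of K₀ and
every continuous label (so Ind ρ₀ has weights {0,0,1,1}: the irregular «weight 2» type).  MEMBERS: ρ
≃ ρ_{E,ℓ} (up to the pinned normalisation) for E a non-CM genus-one curve over a quadratic extension
K₀ of a totally real field with K₀ neither TR nor CM (E/ℚ(⁴√2), F₀ = ℚ(√2)), their solvable-sandwich
orbit, and «fake» weight-{0,1} ρ₀ not known to come from a curve/abelian surface.  PRINT (potential,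
the one engine that reaches a field neither TR nor CM): Boxer–Calegari–Gee–Pilloni arXiv:1812.09269
§1.1 genus-one theorem «E over a quadratic extension K/F of a totally real F is potentially modular
… -/
@[route_item "route-Langlands-PolarisationCarving"]
def AbelianSurfaceTypeAutomorphy : Prop :=
  ∀ (K : Type) [Field K] [NumberField K] (n : ℕ) (hcpt : Literature.NumberTheory.Automorphic.isCompact_glFiniteIntegralLevel n K), 2 ≤ n → ∀ (ℓ : ℕ) [Fact ℓ.Prime] (ι : PadicAlgCl ℓ ≃+* ℂ) (ρ : Literature.NumberTheory.GaloisRepresentations.FramedGaloisRep K (PadicAlgCl ℓ) n), ρ.toGaloisRep.IsIrreducible → ((∀ᶠ v : IsDedekindDomain.HeightOneSpectrum (NumberField.RingOfIntegers K) in Filter.cofinite, ρ.IsUnramifiedAt v) ∧ ∀ (v : IsDedekindDomain.HeightOneSpectrum (NumberField.RingOfIntegers K)) (hv : ((ℓ : ℕ) : NumberField.RingOfIntegers K) ∈ v.asIdeal), (Literature.NumberTheory.PAdicHodge.fontainePstAdicCompletion v ℓ hv).IsDeRhamFramed (ρ.toLocal v)) → ¬ (∃ η : Literature.NumberTheory.GaloisRepresentations.FramedGaloisRep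 K (PadicAlgCl ℓ) 1, (∃ᶠ v : IsDedekindDomain.HeightOneSpectrum (NumberField.RingOfIntegers K) in Filter.cofinite, ∃ a : PadicAlgCl ℓ, a ≠ 1 ∧ η.HasFrobCharpolyAt v (Polynomial.X - Polynomial.C a)) ∧ ∀ᶠ v : IsDedekindDomain.HeightOneSpectrum (NumberField.RingOfIntegers K) in Filter.cofinite, ∃ (P : Polynomial (PadicAlgCl ℓ)) (a : PadicAlgCl ℓ), ρ.HasFrobCharpolyAt v P ∧ η.HasFrobCharpolyAt v (Polynomial.X - Polynomial.C a) ∧ P.scaleRoots a = P) → (¬ (∃ (L : Type) (_ : Field L) (_ : NumberField L) (_ : Algebra K L), IsGalois K L ∧ IsSolvable (L ≃ₐ[K] L) ∧ ∃ (K₀ : Type) (_ : Field K₀) (_ : NumberField K₀) (_ : Algebra K₀ L), IsGalois K₀ L ∧ IsSolvable (L ≃ₐ[K₀] L) ∧ ∃ (ρ₀ : Literature.NumberTheory.GaloisRepresentations.FramedGaloisRep K₀ (PadicAlgCl ℓ) n) (χ : Literature.NumberTheory.GaloisRepresentations.FramedGaloisRep L (PadicAlgCl ℓ) 1), ((∀ᶠ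 v : IsDedekindDomain.HeightOneSpectrum (NumberField.RingOfIntegers K₀) in Filter.cofinite, ρ₀.IsUnramifiedAt v) ∧ ∀ (v : IsDedekindDomain.HeightOneSpectrum (NumberField.RingOfIntegers K₀)) (hv : ((ℓ : ℕ) : NumberField.RingOfIntegers K₀) ∈ v.asIdeal), (Literature.NumberTheory.PAdicHodge.fontainePstAdicCompletion v ℓ hv).IsDeRhamFramed (ρ₀.toLocal v)) ∧ (NumberField.IsTotallyReal K₀ ∨ NumberField.IsCMField K₀) ∧ ∀ g : Field.absoluteGaloisGroup L, Literature.NumberTheory.GaloisRepresentations.FramedRep.trace (ρ.restrictField L) g = Literature.NumberTheory.GaloisRepresentations.FramedRep.trace χ g * Literature.NumberTheory.GaloisRepresentations.FramedRep.trace (ρ₀.restrictField L) g) ∧ (¬ (∃ (L : Type) (_ : Field L) (_ : NumberField L) (_ : Algebra K L), IsGalois K L ∧ IsSolvable (L ≃ₐ[K] L) ∧ ∃ (K₀ : Type) (_ : Field K₀) (_ : NumberField K₀) (_ : Algebra K₀ L), IsGalois K₀ L ∧ IsSolvable (L ≃ₐ[K₀] L) ∧ ∃ (ρ₀ : Literature.NumberTheory.GaloisRepresentations.FramedGaloisRep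 K₀ (PadicAlgCl ℓ) n) (χ : Literature.NumberTheory.GaloisRepresentations.FramedGaloisRep L (PadicAlgCl ℓ) 1), ((∀ᶠ v : IsDedekindDomain.HeightOneSpectrum (NumberField.RingOfIntegers K₀) in Filter.cofinite, ρ₀.IsUnramifiedAt v) ∧ ∀ (v : IsDedekindDomain.HeightOneSpectrum (NumberField.RingOfIntegers K₀)) (hv : ((ℓ : ℕ) : NumberField.RingOfIntegers K₀) ∈ v.asIdeal), (Literature.NumberTheory.PAdicHodge.fontainePstAdicCompletion v ℓ hv).IsDeRhamFramed (ρ₀.toLocal v)) ∧ (∃ (F₀ : Type) (_ : Field F₀) (_ : NumberField F₀) (_ : Algebra F₀ K₀) (_ : FiniteDimensional F₀ K₀) (hF : Module.finrank F₀ K₀ = 2), NumberField.IsTotallyReal F₀ ∧ (∃ (μ : Literature.NumberTheory.GaloisRepresentations.FramedGaloisRep F₀ (PadicAlgCl ℓ) 1) (A : Matrix (Fin (2 * n)) (Fin (2 * n)) (PadicAlgCl ℓ)), IsUnit A.det ∧ (∀ σ : Field.absoluteGaloisGroup F₀, ((ρ₀.induce F₀ hF) σ).val.transpose * A * ((ρ₀.induce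 F₀ hF) σ).val = Literature.NumberTheory.GaloisRepresentations.FramedRep.trace μ σ • A) ∧ ∀ (φ : F₀ →+* ℝ) (c : Field.absoluteGaloisGroup F₀), Literature.NumberTheory.GaloisRepresentations.IsComplexConjugation φ c → A.transpose = Literature.NumberTheory.GaloisRepresentations.FramedRep.trace μ c • A) ∧ (∀ (v : IsDedekindDomain.HeightOneSpectrum (NumberField.RingOfIntegers F₀)) (hv : ((ℓ : ℕ) : NumberField.RingOfIntegers F₀) ∈ v.asIdeal) (τ : v.adicCompletion F₀ →+* PadicAlgCl ℓ), Continuous τ → ((ρ₀.induce F₀ hF).labelledHodgeTateWeightsAt v (Literature.NumberTheory.PAdicHodge.fontainePstAdicCompletion v ℓ hv).algebra (Literature.NumberTheory.PAdicHodge.fontainePstAdicCompletion v ℓ hv).𝔅 τ).Nodup)) ∧ ∀ g : Field.absoluteGaloisGroup L, Literature.NumberTheory.GaloisRepresentations.FramedRep.trace (ρ.restrictField L) g = Literature.NumberTheory.GaloisRepresentations.FramedRep.trace χ g * Literature.NumberTheory.GaloisRepresentations.FramedRep.trace (ρ₀.restrictField L) g) ∧ (∃ (L : Type) (_ : Field L)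 (_ : NumberField L) (_ : Algebra K L), IsGalois K L ∧ IsSolvable (L ≃ₐ[K] L) ∧ ∃ (K₀ : Type) (_ : Field K₀) (_ : NumberField K₀) (_ : Algebra K₀ L), IsGalois K₀ L ∧ IsSolvable (L ≃ₐ[K₀] L) ∧ ∃ (ρ₀ : Literature.NumberTheory.GaloisRepresentations.FramedGaloisRep K₀ (PadicAlgCl ℓ) n) (χ : Literature.NumberTheory.GaloisRepresentations.FramedGaloisRep L (PadicAlgCl ℓ) 1), ((∀ᶠ v : IsDedekindDomain.HeightOneSpectrum (NumberField.RingOfIntegers K₀) in Filter.cofinite, ρ₀.IsUnramifiedAt v) ∧ ∀ (v : IsDedekindDomain.HeightOneSpectrum (NumberField.RingOfIntegers K₀)) (hv : ((ℓ : ℕ) : NumberField.RingOfIntegers K₀) ∈ v.asIdeal), (Literature.NumberTheory.PAdicHodge.fontainePstAdicCompletion v ℓ hv).IsDeRhamFramed (ρ₀.toLocal v)) ∧ (n = 2 ∧ (∃ (F₀ : Type) (_ : Field F₀) (_ : NumberField F₀) (_ : Algebra F₀ K₀) (_ : FiniteDimensional F₀ K₀) (hF : Module.finrank F₀ K₀ =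 2), NumberField.IsTotallyReal F₀ ∧ (∃ (μ : Literature.NumberTheory.GaloisRepresentations.FramedGaloisRep F₀ (PadicAlgCl ℓ) 1) (A : Matrix (Fin (2 * n)) (Fin (2 * n)) (PadicAlgCl ℓ)), IsUnit A.det ∧ (∀ σ : Field.absoluteGaloisGroup F₀, ((ρ₀.induce F₀ hF) σ).val.transpose * A * ((ρ₀.induce F₀ hF) σ).val = Literature.NumberTheory.GaloisRepresentations.FramedRep.trace μ σ • A) ∧ ∀ (φ : F₀ →+* ℝ) (c : Field.absoluteGaloisGroup F₀), Literature.NumberTheory.GaloisRepresentations.IsComplexConjugation φ c → A.transpose = Literature.NumberTheory.GaloisRepresentations.FramedRep.trace μ c • A)) ∧ ∀ (v : IsDedekindDomain.HeightOneSpectrum (NumberField.RingOfIntegers K₀)) (hv : ((ℓ : ℕ) : NumberField.RingOfIntegers K₀) ∈ v.asIdeal) (τ : v.adicCompletion K₀ →+* PadicAlgCl ℓ), Continuous τ → ρ₀.labelledHodgeTateWeightsAt v (Literature.NumberTheory.PAdicHodge.fontainePstAdicCompletion v ℓ hv).algebra (Literature.NumberTheory.PAdicHodge.fontainePstAdicCompletion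 v ℓ hv).𝔅 τ = {0, 1}) ∧ ∀ g : Field.absoluteGaloisGroup L, Literature.NumberTheory.GaloisRepresentations.FramedRep.trace (ρ.restrictField L) g = Literature.NumberTheory.GaloisRepresentations.FramedRep.trace χ g * Literature.NumberTheory.GaloisRepresentations.FramedRep.trace (ρ₀.restrictField L) g))) → ∃ π : Literature.NumberTheory.Automorphic.CuspidalAutomorphicRepData n K hcpt, π.1.IsLAlgebraic ∧ ∀ᶠ v : IsDedekindDomain.HeightOneSpectrum (NumberField.RingOfIntegers K) in Filter.cofinite, SatakeFrobCompatibleAt ι π.1 ρ v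

-- parent: NonTRCMTypeAutomorphy · child (gen 1)
/--     item stmt-Langlands-33475 · crux · rank 203 · open
    parent: NonTRCMTypeAutomorphy · by planner
    why it might fail: S-implied; as a TARGET it is clause (α) of TaylorWilesNumericalCoincidenceNarrow with the single printed door (index-2 polarisable induction to a TR field, BCGP) typed shut: d ≥ 3 meets Mirković non-appearance, d = 2 non-polarisable meets l₀ > 0; no engine in print reaches one member.
    sources: Literature/Barriers/Langlands/ShimuraVarietyRealizationBarrier.lean, Literature/Barriers/Langlands/TaylorWilesNumericalCoincidence.lean, Literature/Barriers/Langlands/NonRegularWeightBarrier.lean, Literature/Barriers/Langlands/TwistedEndoscopySelfDual.lean, Literature/Barriers/Langlands/SolvableImageBarrier.lean, arXiv:1812.09269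
[crux] [DECLARED RESIDUAL of this split · NEW · WEAKER than S and than NTC · BARRIER head-on
(ShimuraVarietyRealizationBarrier beyond its d = 2 polarisable narrowing ∧
TaylorWilesNumericalCoincidenceNarrow (α)) · IDEA-NEEDED] DNT = weak automorphy of every ρ in NTC's
box that is NEITHER of induced-regular NOR of abelian-surface type: no solvable-Galois sandwich
avatar (K₀, ρ₀) of ρ has a totally real subfield F₀ of index 2 along which Ind_{K₀}^{F₀} ρ₀ is odd
essentially self-dual and either HT-regular or (n = 2) of weight-{0,1} type.  This is clause (α) «K
neither totally real nor CM» of TaylorWilesNumericalCoincidenceNarrow with the ONE printed door to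
mixed-signature fields (index-2 induction into the polarised world over a totally real field: BCGP
§9.3; the barrier file's own invariant d = [K₀ : K₀⁺], `mixedQuadratic_profile` / `oddPairing_iff`:
d ≤ 2 accessible, d ≥ 3 meets Mirković non-appearance) CLOSED OFF by two typed hypotheses.  FIRST
BOXES (named, none excluded unconditionally): (a) d ≥ 3 for every avatar field — E over the cubic
field of x³ − x − 1 or any field with a complex place and no index-2 totally real subfield reachable
in the solvable-sandwich orbit; (b) d = 2 -/
@[route_item "route-Langlands-PolarisationCarving"]
def DeepNonTRCMTypeAutomorphy : Prop :=
  ∀ (K : Type) [Field K] [NumberField K] (n : ℕ) (hcpt : Literature.NumberTheory.Automorphic.isCompact_glFiniteIntegralLevel n K), 2 ≤ n → ∀ (ℓ : ℕ) [Fact ℓ.Prime] (ι : PadicAlgCl ℓ ≃+* ℂ) (ρ : Literature.NumberTheory.GaloisRepresentations.FramedGaloisRep K (PadicAlgCl ℓ) n), ρ.toGaloisRep.IsIrreducible → ((∀ᶠ v : IsDedekindDomain.HeightOneSpectrum (NumberField.RingOfIntegers K) in Filter.cofinite, ρ.IsUnramifiedAt v) ∧ ∀ (v : IsDedekindDomain.HeightOneSpectrum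 (NumberField.RingOfIntegers K)) (hv : ((ℓ : ℕ) : NumberField.RingOfIntegers K) ∈ v.asIdeal), (Literature.NumberTheory.PAdicHodge.fontainePstAdicCompletion v ℓ hv).IsDeRhamFramed (ρ.toLocal v)) → ¬ (∃ η : Literature.NumberTheory.GaloisRepresentations.FramedGaloisRep K (PadicAlgCl ℓ) 1, (∃ᶠ v : IsDedekindDomain.HeightOneSpectrum (NumberField.RingOfIntegers K) in Filter.cofinite, ∃ a : PadicAlgCl ℓ, a ≠ 1 ∧ η.HasFrobCharpolyAt v (Polynomial.X - Polynomial.C a)) ∧ ∀ᶠ v : IsDedekindDomain.HeightOneSpectrum (NumberField.RingOfIntegers K) in Filter.cofinite, ∃ (P : Polynomial (PadicAlgCl ℓ)) (a : PadicAlgCl ℓ), ρ.HasFrobCharpolyAt v P ∧ η.HasFrobCharpolyAt v (Polynomial.X - Polynomial.C a) ∧ P.scaleRoots a = P) → (¬ (∃ (L : Type) (_ : Field L) (_ : NumberField L) (_ : Algebra K L), IsGalois K L ∧ IsSolvable (L ≃ₐ[K] L) ∧ ∃ (K₀ : Type) (_ : Field K₀) (_ : NumberField K₀) (_ : Algebra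 K₀ L), IsGalois K₀ L ∧ IsSolvable (L ≃ₐ[K₀] L) ∧ ∃ (ρ₀ : Literature.NumberTheory.GaloisRepresentations.FramedGaloisRep K₀ (PadicAlgCl ℓ) n) (χ : Literature.NumberTheory.GaloisRepresentations.FramedGaloisRep L (PadicAlgCl ℓ) 1), ((∀ᶠ v : IsDedekindDomain.HeightOneSpectrum (NumberField.RingOfIntegers K₀) in Filter.cofinite, ρ₀.IsUnramifiedAt v) ∧ ∀ (v : IsDedekindDomain.HeightOneSpectrum (NumberField.RingOfIntegers K₀)) (hv : ((ℓ : ℕ) : NumberField.RingOfIntegers K₀) ∈ v.asIdeal), (Literature.NumberTheory.PAdicHodge.fontainePstAdicCompletion v ℓ hv).IsDeRhamFramed (ρ₀.toLocal v)) ∧ (NumberField.IsTotallyReal K₀ ∨ NumberField.IsCMField K₀) ∧ ∀ g : Field.absoluteGaloisGroup L, Literature.NumberTheory.GaloisRepresentations.FramedRep.trace (ρ.restrictField L) g = Literature.NumberTheory.GaloisRepresentations.FramedRep.trace χ g * Literature.NumberTheory.GaloisRepresentations.FramedRep.trace (ρ₀.restrictField L) g) ∧ (¬ (∃ (L : Type)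 (_ : Field L) (_ : NumberField L) (_ : Algebra K L), IsGalois K L ∧ IsSolvable (L ≃ₐ[K] L) ∧ ∃ (K₀ : Type) (_ : Field K₀) (_ : NumberField K₀) (_ : Algebra K₀ L), IsGalois K₀ L ∧ IsSolvable (L ≃ₐ[K₀] L) ∧ ∃ (ρ₀ : Literature.NumberTheory.GaloisRepresentations.FramedGaloisRep K₀ (PadicAlgCl ℓ) n) (χ : Literature.NumberTheory.GaloisRepresentations.FramedGaloisRep L (PadicAlgCl ℓ) 1), ((∀ᶠ v : IsDedekindDomain.HeightOneSpectrum (NumberField.RingOfIntegers K₀) in Filter.cofinite, ρ₀.IsUnramifiedAt v) ∧ ∀ (v : IsDedekindDomain.HeightOneSpectrum (NumberField.RingOfIntegers K₀)) (hv : ((ℓ : ℕ) : NumberField.RingOfIntegers K₀) ∈ v.asIdeal), (Literature.NumberTheory.PAdicHodge.fontainePstAdicCompletion v ℓ hv).IsDeRhamFramed (ρ₀.toLocal v)) ∧ (∃ (F₀ : Type) (_ : Field F₀) (_ : NumberField F₀) (_ : Algebra F₀ K₀) (_ : FiniteDimensional F₀ K₀) (hF : Module.finrank F₀ K₀ = 2),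 NumberField.IsTotallyReal F₀ ∧ (∃ (μ : Literature.NumberTheory.GaloisRepresentations.FramedGaloisRep F₀ (PadicAlgCl ℓ) 1) (A : Matrix (Fin (2 * n)) (Fin (2 * n)) (PadicAlgCl ℓ)), IsUnit A.det ∧ (∀ σ : Field.absoluteGaloisGroup F₀, ((ρ₀.induce F₀ hF) σ).val.transpose * A * ((ρ₀.induce F₀ hF) σ).val = Literature.NumberTheory.GaloisRepresentations.FramedRep.trace μ σ • A) ∧ ∀ (φ : F₀ →+* ℝ) (c : Field.absoluteGaloisGroup F₀), Literature.NumberTheory.GaloisRepresentations.IsComplexConjugation φ c → A.transpose = Literature.NumberTheory.GaloisRepresentations.FramedRep.trace μ c • A) ∧ (∀ (v : IsDedekindDomain.HeightOneSpectrum (NumberField.RingOfIntegers F₀)) (hv : ((ℓ : ℕ) : NumberField.RingOfIntegers F₀) ∈ v.asIdeal) (τ : v.adicCompletion F₀ →+* PadicAlgCl ℓ), Continuous τ → ((ρ₀.induce F₀ hF).labelledHodgeTateWeightsAt v (Literature.NumberTheory.PAdicHodge.fontainePstAdicCompletion v ℓ hv).algebra (Literature.NumberTheory.PAdicHodge.fontainePstAdicCompletion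 v ℓ hv).𝔅 τ).Nodup)) ∧ ∀ g : Field.absoluteGaloisGroup L, Literature.NumberTheory.GaloisRepresentations.FramedRep.trace (ρ.restrictField L) g = Literature.NumberTheory.GaloisRepresentations.FramedRep.trace χ g * Literature.NumberTheory.GaloisRepresentations.FramedRep.trace (ρ₀.restrictField L) g) ∧ ¬ (∃ (L : Type) (_ : Field L) (_ : NumberField L) (_ : Algebra K L), IsGalois K L ∧ IsSolvable (L ≃ₐ[K] L) ∧ ∃ (K₀ : Type) (_ : Field K₀) (_ : NumberField K₀) (_ : Algebra K₀ L), IsGalois K₀ L ∧ IsSolvable (L ≃ₐ[K₀] L) ∧ ∃ (ρ₀ : Literature.NumberTheory.GaloisRepresentations.FramedGaloisRep K₀ (PadicAlgCl ℓ) n) (χ : Literature.NumberTheory.GaloisRepresentations.FramedGaloisRep L (PadicAlgCl ℓ) 1), ((∀ᶠ v : IsDedekindDomain.HeightOneSpectrum (NumberField.RingOfIntegers K₀) in Filter.cofinite, ρ₀.IsUnramifiedAt v) ∧ ∀ (v : IsDedekindDomain.HeightOneSpectrum (NumberField.RingOfIntegers K₀)) (hv : ((ℓ : ℕ) : NumberField.RingOfIntegers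 K₀) ∈ v.asIdeal), (Literature.NumberTheory.PAdicHodge.fontainePstAdicCompletion v ℓ hv).IsDeRhamFramed (ρ₀.toLocal v)) ∧ (n = 2 ∧ (∃ (F₀ : Type) (_ : Field F₀) (_ : NumberField F₀) (_ : Algebra F₀ K₀) (_ : FiniteDimensional F₀ K₀) (hF : Module.finrank F₀ K₀ = 2), NumberField.IsTotallyReal F₀ ∧ (∃ (μ : Literature.NumberTheory.GaloisRepresentations.FramedGaloisRep F₀ (PadicAlgCl ℓ) 1) (A : Matrix (Fin (2 * n)) (Fin (2 * n)) (PadicAlgCl ℓ)), IsUnit A.det ∧ (∀ σ : Field.absoluteGaloisGroup F₀, ((ρ₀.induce F₀ hF) σ).val.transpose * A * ((ρ₀.induce F₀ hF) σ).val = Literature.NumberTheory.GaloisRepresentations.FramedRep.trace μ σ • A) ∧ ∀ (φ : F₀ →+* ℝ) (c : Field.absoluteGaloisGroup F₀), Literature.NumberTheory.GaloisRepresentations.IsComplexConjugation φ c → A.transpose = Literature.NumberTheory.GaloisRepresentations.FramedRep.trace μ c • A)) ∧ ∀ (v : IsDedekindDomain.HeightOneSpectrum (NumberField.RingOfIntegers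 K₀)) (hv : ((ℓ : ℕ) : NumberField.RingOfIntegers K₀) ∈ v.asIdeal) (τ : v.adicCompletion K₀ →+* PadicAlgCl ℓ), Continuous τ → ρ₀.labelledHodgeTateWeightsAt v (Literature.NumberTheory.PAdicHodge.fontainePstAdicCompletion v ℓ hv).algebra (Literature.NumberTheory.PAdicHodge.fontainePstAdicCompletion v ℓ hv).𝔅 τ = {0, 1}) ∧ ∀ g : Field.absoluteGaloisGroup L, Literature.NumberTheory.GaloisRepresentations.FramedRep.trace (ρ.restrictField L) g = Literature.NumberTheory.GaloisRepresentations.FramedRep.trace χ g * Literature.NumberTheory.GaloisRepresentations.FramedRep.trace (ρ₀.restrictField L) g))) → ∃ π : Literature.NumberTheory.Automorphic.CuspidalAutomorphicRepData n K hcpt, π.1.IsLAlgebraic ∧ ∀ᶠ v : IsDedekindDomain.HeightOneSpectrum (NumberField.RingOfIntegers K) in Filter.cofinite, SatakeFrobCompatibleAt ι π.1 ρ v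

-- parent: NonTRCMTypeAutomorphy · glue (gen 1)
/--     item stmt-Langlands-33476 · support · rank 204 · closed · proved by Summit.Langlands.Langlands.Theorems.NonTRCMTypeAutomorphy_of_split_proof (prover)
    parent: NonTRCMTypeAutomorphy · GLUE: children ⟹ parent · by planner
InducedRegularTypeAutomorphy → AbelianSurfaceTypeAutomorphy → DeepNonTRCMTypeAutomorphy →
NonTRCMTypeAutomorphy — two excluded middles (induced-regular sandwich, then abelian-surface
sandwich); lens-6-g11 node kernel ntc_of_cells; self-contained proof = PROOF section of
nodes/lens-6-g11-InducedPolarisationCarving.split_glue.lean →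
Theorems/PolarisationCarvingNonTRCMTypeAutomorphySplit.lean -/
@[route_item "route-Langlands-PolarisationCarving"]
def NonTRCMTypeAutomorphy_of_split : Prop :=
  InducedRegularTypeAutomorphy → AbelianSurfaceTypeAutomorphy → DeepNonTRCMTypeAutomorphy → NonTRCMTypeAutomorphy

-- `NonTRCMTypeAutomorphy_of_split` holds: proved by `Summit.Langlands.Langlands.Theorems.NonTRCMTypeAutomorphy_of_split_proof` (its module imports this route file, so no `_holds` link can be stated here).

/-- item stmt-Langlands-32055 · crux · rank 3 · SPLIT (gen 2) into ConsecutiveWeightAutomorphy, GappedOrdinaryAutomorphy, GappedNonOrdinarySystemAutomorphy, GappedNonOrdinaryLoneAutomorphy, IrregularUnpolarisedAutomorphy + glue UnpolarisedTRCMTypeAutomorphy_of_split2 · direct attempts still welcome (low priority) · by planner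
why it might fail: (B) for GL_n over CM/TR fields minus the polarisable sliver: automorphy (not potential) of regular non-self-dual ρ in rank ≥ 3 and of all irregular ones needs derived patching beyond print (l₀ > 0); one non-automorphic regular ρ over an imaginary quadratic F refutes it.
sources: CalegariGeraghty2017, ACCGHLNSTT2023, arXiv:2301.10509, arXiv:1811.11544, arXiv:1209.5309, Literature.Barriers.Langlands.TaylorWilesNumericalCoincidenceNarrow
earlier split gen 1: ConsecutiveWeightAutomorphy, GappedWeightAutomorphy, IrregularUnpolarisedAutomorphy — retired stmt-Langlands-32658, stmt-Langlands-32659, stmt-Langlands-32660, stmt-Langlands-33397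
retired/moot children: ConsecutiveWeightAutomorphy [retired: ∀ (K : Type) [Field K] [NumberField K] (n : ℕ) (hcpt : Literature.NumberTheory.A]; GappedWeightAutomorphy [retired: ∀ (K : Type) [Field K] [NumberField K] (n : ℕ) (hcpt : Literature.NumberTheory.A]; IrregularUnpolarisedAutomorphy [retired: ∀ (K : Type) [Field K] [NumberField K] (n : ℕ) (hcpt : Literature.NumberTheory.A]; UnpolarisedTRCMTypeAutomorphy_of_split [replaced: ConsecutiveWeightAutomorphy → GappedWeightAutomorphy → IrregularUnpolarisedAutom]; UnpolarisedTRCMTypeAutomorphy_of_split [retired: ConsecutiveWeightAutomorphy → (∀ (K : Type) [Field K] [NumberField K] (n : ℕ) (h]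
[crux] UNP (OF TR/CM TYPE BUT NOT OF POLARISABLE TYPE — clause (β), the positive-defect world; NEW):
the same conclusion for those twist-primitive ρ of rank n ≥ 2 that DO admit a solvable-Galois
sandwich down to a pinned-geometric ρ₀ over a totally real or CM K₀ (up to a character on Γ_L) but
admit NONE in which ρ₀ is totally odd polarisable (K₀ totally real with ᵗρ₀ A ρ₀ = μ·A, ᵗA = μ(c)·A
at every complex conjugation; or K₀ CM with ᵗρ₀(σ) B ρ₀(θ_c σ) = μ|(σ)·B, B symmetric, μ(c) = −1).
Members: non-CM elliptic curves over imaginary quadratic F that are not twists of base changes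
(PROVED when X₀(15)(F) is finite — Caraiani–Newton Thm 1.1; open otherwise), regular
non-conjugate-self-dual ρ over CM fields in rank ≥ 3 (potentially automorphic by ACC+, automorphy
open), non-self-dual rank-3 motives over ℚ (van Geemen–Top's level-128 motive PROVED automorphic,
arXiv:1811.11544; all others open), every irregular non-polarisable ρ. [difficulty: open-problem]
[TAGS: RESIDUAL MODE node lens-6-g8 PolarisationCarving (bus L482; CHILD route of
route-Langlands-TriangularRankLadder refining its declared residual R3p =
HigherRankPrimitiveAutomorphy stmt-Langlands-24804 together with R2 24803 thr -/
@[route_item "route-Langlands-PolarisationCarving", crux]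
def UnpolarisedTRCMTypeAutomorphy : Prop :=
  ∀ (K : Type) [Field K] [NumberField K] (n : ℕ) (hcpt : Literature.NumberTheory.Automorphic.isCompact_glFiniteIntegralLevel n K), 2 ≤ n → ∀ (ℓ : ℕ) [Fact ℓ.Prime] (ι : PadicAlgCl ℓ ≃+* ℂ) (ρ : Literature.NumberTheory.GaloisRepresentations.FramedGaloisRep K (PadicAlgCl ℓ) n), ρ.toGaloisRep.IsIrreducible → ((∀ᶠ v : IsDedekindDomain.HeightOneSpectrum (NumberField.RingOfIntegers K) in Filter.cofinite, ρ.IsUnramifiedAt v) ∧ ∀ (v : IsDedekindDomain.HeightOneSpectrum (NumberField.RingOfIntegers K)) (hv : ((ℓ : ℕ) : NumberField.RingOfIntegers K) ∈ v.asIdeal), (Literature.NumberTheory.PAdicHodge.fontainePstAdicCompletion v ℓ hv).IsDeRhamFramed (ρ.toLocal v)) → ¬ (∃ η : Literature.NumberTheory.GaloisRepresentations.FramedGaloisRep K (PadicAlgCl ℓ) 1, (∃ᶠ v : IsDedekindDomain.HeightOneSpectrum (NumberField.RingOfIntegers K) in Filter.cofinite, ∃ a : PadicAlgCl ℓ, a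 ≠ 1 ∧ η.HasFrobCharpolyAt v (Polynomial.X - Polynomial.C a)) ∧ ∀ᶠ v : IsDedekindDomain.HeightOneSpectrum (NumberField.RingOfIntegers K) in Filter.cofinite, ∃ (P : Polynomial (PadicAlgCl ℓ)) (a : PadicAlgCl ℓ), ρ.HasFrobCharpolyAt v P ∧ η.HasFrobCharpolyAt v (Polynomial.X - Polynomial.C a) ∧ P.scaleRoots a = P) → (¬ (∃ (L : Type) (_ : Field L) (_ : NumberField L) (_ : Algebra K L), IsGalois K L ∧ IsSolvable (L ≃ₐ[K] L) ∧ ∃ (K₀ : Type) (_ : Field K₀) (_ : NumberField K₀) (_ : Algebra K₀ L), IsGalois K₀ L ∧ IsSolvable (L ≃ₐ[K₀] L) ∧ ∃ (ρ₀ : Literature.NumberTheory.GaloisRepresentations.FramedGaloisRep K₀ (PadicAlgCl ℓ) n) (χ : Literature.NumberTheory.GaloisRepresentations.FramedGaloisRep L (PadicAlgCl ℓ) 1), ((∀ᶠ v : IsDedekindDomain.HeightOneSpectrum (NumberField.RingOfIntegers K₀) in Filter.cofinite, ρ₀.IsUnramifiedAt v) ∧ ∀ (v : IsDedekindDomain.HeightOneSpectrum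 (NumberField.RingOfIntegers K₀)) (hv : ((ℓ : ℕ) : NumberField.RingOfIntegers K₀) ∈ v.asIdeal), (Literature.NumberTheory.PAdicHodge.fontainePstAdicCompletion v ℓ hv).IsDeRhamFramed (ρ₀.toLocal v)) ∧ ((NumberField.IsTotallyReal K₀ ∧ ∃ (μ : Literature.NumberTheory.GaloisRepresentations.FramedGaloisRep K₀ (PadicAlgCl ℓ) 1) (A : Matrix (Fin n) (Fin n) (PadicAlgCl ℓ)), IsUnit A.det ∧ (∀ σ : Field.absoluteGaloisGroup K₀, (ρ₀ σ).val.transpose * A * (ρ₀ σ).val = Literature.NumberTheory.GaloisRepresentations.FramedRep.trace μ σ • A) ∧ ∀ (φ : K₀ →+* ℝ) (c : Field.absoluteGaloisGroup K₀), Literature.NumberTheory.GaloisRepresentations.IsComplexConjugation φ c → A.transpose = Literature.NumberTheory.GaloisRepresentations.FramedRep.trace μ c • A) ∨ (NumberField.IsTotallyComplex K₀ ∧ ∃ (F : Type) (_ : Field F) (_ : NumberField F) (_ : Algebra F K₀) (_ : IsGalois F K₀), NumberField.IsTotallyReal F ∧ Module.finrank F K₀ = 2 ∧ ∃ μ : Literature.NumberTheory.GaloisRepresentations.FramedGaloisRep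 F (PadicAlgCl ℓ) 1, ∀ (φ : F →+* ℝ) (c : Field.absoluteGaloisGroup F), Literature.NumberTheory.GaloisRepresentations.IsComplexConjugation φ c → Literature.NumberTheory.GaloisRepresentations.FramedRep.trace μ c = -1 ∧ ∃ B : Matrix (Fin n) (Fin n) (PadicAlgCl ℓ), IsUnit B.det ∧ B.transpose = B ∧ ∀ σ : Field.absoluteGaloisGroup K₀, (ρ₀ σ).val.transpose * B * (ρ₀ (Literature.NumberTheory.GaloisRepresentations.absGaloisOuterConj F K₀ c σ)).val = Literature.NumberTheory.GaloisRepresentations.FramedRep.trace (μ.restrictField K₀) σ • B)) ∧ ∀ g : Field.absoluteGaloisGroup L, Literature.NumberTheory.GaloisRepresentations.FramedRep.trace (ρ.restrictField L) g = Literature.NumberTheory.GaloisRepresentations.FramedRep.trace χ g * Literature.NumberTheory.GaloisRepresentations.FramedRep.trace (ρ₀.restrictField L) g) ∧ (∃ (L : Type) (_ : Field L) (_ : NumberField L) (_ : Algebra K L), IsGalois K L ∧ IsSolvable (L ≃ₐ[K] L) ∧ ∃ (K₀ : Type) (_ : Field K₀) (_ : NumberField K₀) (_ : Algebra K₀ L),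 IsGalois K₀ L ∧ IsSolvable (L ≃ₐ[K₀] L) ∧ ∃ (ρ₀ : Literature.NumberTheory.GaloisRepresentations.FramedGaloisRep K₀ (PadicAlgCl ℓ) n) (χ : Literature.NumberTheory.GaloisRepresentations.FramedGaloisRep L (PadicAlgCl ℓ) 1), ((∀ᶠ v : IsDedekindDomain.HeightOneSpectrum (NumberField.RingOfIntegers K₀) in Filter.cofinite, ρ₀.IsUnramifiedAt v) ∧ ∀ (v : IsDedekindDomain.HeightOneSpectrum (NumberField.RingOfIntegers K₀)) (hv : ((ℓ : ℕ) : NumberField.RingOfIntegers K₀) ∈ v.asIdeal), (Literature.NumberTheory.PAdicHodge.fontainePstAdicCompletion v ℓ hv).IsDeRhamFramed (ρ₀.toLocal v)) ∧ (NumberField.IsTotallyReal K₀ ∨ NumberField.IsCMField K₀) ∧ ∀ g : Field.absoluteGaloisGroup L, Literature.NumberTheory.GaloisRepresentations.FramedRep.trace (ρ.restrictField L) g = Literature.NumberTheory.GaloisRepresentations.FramedRep.trace χ g * Literature.NumberTheory.GaloisRepresentations.FramedRep.trace (ρ₀.restrictField L) g)) → ∃ π : Literature.NumberTheory.Automorphic.CuspidalAutomorphicRepData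 n K hcpt, π.1.IsLAlgebraic ∧ ∀ᶠ v : IsDedekindDomain.HeightOneSpectrum (NumberField.RingOfIntegers K) in Filter.cofinite, SatakeFrobCompatibleAt ι π.1 ρ v

-- parent: UnpolarisedTRCMTypeAutomorphy · child (gen 2)
/--     item stmt-Langlands-33398 · crux · rank 301 · open
    parent: UnpolarisedTRCMTypeAutomorphy · by planner
    why it might fail: S-implied, false only with ¬Langlands; as a TARGET: automorphy (not potential) is open for E over CM fields of degree > 2 and imaginary quadratic F with X₀(15)(F) infinite; rank ≥ 3 non-ordinary consecutive weight lacks a residual-automorphy source; TR K, n ≥ 3 non-self-dual: l₀ > 0.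
    sources: arXiv:2301.10509, arXiv:1910.12986, ACCGHLNSTT2023, Qian2022, arXiv:2309.15880, CalegariGeraghty2017
[crux] [NEW · WEAKER than S and than UNP · INSIDE the technique class of
FamilyWitnessConsecutiveWeights · ATTACKABLE-BY-ENGINE] CW = weak automorphy of every ρ in UNP's box
(irreducible, pinned-geometric, twist-primitive, n ≥ 2, of TR/CM type, not of polarised type) whose
τ-labelled Hodge–Tate weights at every v ∣ ℓ and every continuous label τ are n DISTINCT integers
forming an INTERVAL — the barrier's interval clause verbatim «∀ a b ∈ HT_τ, ∀ c, a ≤ c ≤ b → c ∈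
HT_τ», i.e. «a string of consecutive integers» (Qian 2022 §1), i.e. cohomological weight λ with λ_τ
constant (rank 2: weight-2 type — elliptic curves, abelian varieties of GL₂-type, parallel weight 2
over CM fields; rank n: weight-0 type up to twist). Engines: Caraiani–Newton 2023 Thm 1.1 (every E
over an imaginary quadratic F with X₀(15)(F) finite is modular) / Thm 1.2 (100 % over Galois CM F,
ζ₅ ∉ F), Allen–Khare–Thorne residual modularity, the ten-author theorem (Sym^m E, weight 0), Qian
Thm 1.1/1.4 and A'Campo (rank-n potential automorphy by consecutive-weight Dwork witnesses), BCGP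
abelian-surface methods do NOT enter (those are POL/IW). Open members: E over CM fields of degree >
2 beyond potential modularity; imagin -/
@[route_item "route-Langlands-PolarisationCarving"]
def ConsecutiveWeightAutomorphy : Prop :=
  ∀ (K : Type) [Field K] [NumberField K] (n : ℕ) (hcpt : Literature.NumberTheory.Automorphic.isCompact_glFiniteIntegralLevel n K), 2 ≤ n → ∀ (ℓ : ℕ) [Fact ℓ.Prime] (ι : PadicAlgCl ℓ ≃+* ℂ) (ρ : Literature.NumberTheory.GaloisRepresentations.FramedGaloisRep K (PadicAlgCl ℓ) n), ρ.toGaloisRep.IsIrreducible → ((∀ᶠ v : IsDedekindDomain.HeightOneSpectrum (NumberField.RingOfIntegers K) in Filter.cofinite, ρ.IsUnramifiedAt v) ∧ ∀ (v : IsDedekindDomain.HeightOneSpectrum (NumberField.RingOfIntegers K)) (hv : ((ℓ : ℕ) : NumberField.RingOfIntegers K) ∈ v.asIdeal), (Literature.NumberTheory.PAdicHodge.fontainePstAdicCompletion v ℓ hv).IsDeRhamFramed (ρ.toLocal v)) → ¬ (∃ η : Literature.NumberTheory.GaloisRepresentations.FramedGaloisRep K (PadicAlgCl ℓ) 1, (∃ᶠ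 v : IsDedekindDomain.HeightOneSpectrum (NumberField.RingOfIntegers K) in Filter.cofinite, ∃ a : PadicAlgCl ℓ, a ≠ 1 ∧ η.HasFrobCharpolyAt v (Polynomial.X - Polynomial.C a)) ∧ ∀ᶠ v : IsDedekindDomain.HeightOneSpectrum (NumberField.RingOfIntegers K) in Filter.cofinite, ∃ (P : Polynomial (PadicAlgCl ℓ)) (a : PadicAlgCl ℓ), ρ.HasFrobCharpolyAt v P ∧ η.HasFrobCharpolyAt v (Polynomial.X - Polynomial.C a) ∧ P.scaleRoots a = P) → ((¬ (∃ (L : Type) (_ : Field L) (_ : NumberField L) (_ : Algebra K L), IsGalois K L ∧ IsSolvable (L ≃ₐ[K] L) ∧ ∃ (K₀ : Type) (_ : Field K₀) (_ : NumberField K₀) (_ : Algebra K₀ L), IsGalois K₀ L ∧ IsSolvable (L ≃ₐ[K₀] L) ∧ ∃ (ρ₀ : Literature.NumberTheory.GaloisRepresentations.FramedGaloisRep K₀ (PadicAlgCl ℓ) n) (χ : Literature.NumberTheory.GaloisRepresentations.FramedGaloisRep L (PadicAlgCl ℓ) 1), ((∀ᶠ v : IsDedekindDomain.HeightOneSpectrum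 (NumberField.RingOfIntegers K₀) in Filter.cofinite, ρ₀.IsUnramifiedAt v) ∧ ∀ (v : IsDedekindDomain.HeightOneSpectrum (NumberField.RingOfIntegers K₀)) (hv : ((ℓ : ℕ) : NumberField.RingOfIntegers K₀) ∈ v.asIdeal), (Literature.NumberTheory.PAdicHodge.fontainePstAdicCompletion v ℓ hv).IsDeRhamFramed (ρ₀.toLocal v)) ∧ ((NumberField.IsTotallyReal K₀ ∧ ∃ (μ : Literature.NumberTheory.GaloisRepresentations.FramedGaloisRep K₀ (PadicAlgCl ℓ) 1) (A : Matrix (Fin n) (Fin n) (PadicAlgCl ℓ)), IsUnit A.det ∧ (∀ σ : Field.absoluteGaloisGroup K₀, (ρ₀ σ).val.transpose * A * (ρ₀ σ).val = Literature.NumberTheory.GaloisRepresentations.FramedRep.trace μ σ • A) ∧ ∀ (φ : K₀ →+* ℝ) (c : Field.absoluteGaloisGroup K₀), Literature.NumberTheory.GaloisRepresentations.IsComplexConjugation φ c → A.transpose = Literature.NumberTheory.GaloisRepresentations.FramedRep.trace μ c • A) ∨ (NumberField.IsTotallyComplex K₀ ∧ ∃ (F : Type) (_ : Field F) (_ : NumberField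 F) (_ : Algebra F K₀) (_ : IsGalois F K₀), NumberField.IsTotallyReal F ∧ Module.finrank F K₀ = 2 ∧ ∃ μ : Literature.NumberTheory.GaloisRepresentations.FramedGaloisRep F (PadicAlgCl ℓ) 1, ∀ (φ : F →+* ℝ) (c : Field.absoluteGaloisGroup F), Literature.NumberTheory.GaloisRepresentations.IsComplexConjugation φ c → Literature.NumberTheory.GaloisRepresentations.FramedRep.trace μ c = -1 ∧ ∃ B : Matrix (Fin n) (Fin n) (PadicAlgCl ℓ), IsUnit B.det ∧ B.transpose = B ∧ ∀ σ : Field.absoluteGaloisGroup K₀, (ρ₀ σ).val.transpose * B * (ρ₀ (Literature.NumberTheory.GaloisRepresentations.absGaloisOuterConj F K₀ c σ)).val = Literature.NumberTheory.GaloisRepresentations.FramedRep.trace (μ.restrictField K₀) σ • B)) ∧ ∀ g : Field.absoluteGaloisGroup L, Literature.NumberTheory.GaloisRepresentations.FramedRep.trace (ρ.restrictField L) g = Literature.NumberTheory.GaloisRepresentations.FramedRep.trace χ g * Literature.NumberTheory.GaloisRepresentations.FramedRep.trace (ρ₀.restrictField L) g) ∧ (∃ (L : Type) (_ : Field L) (_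 : NumberField L) (_ : Algebra K L), IsGalois K L ∧ IsSolvable (L ≃ₐ[K] L) ∧ ∃ (K₀ : Type) (_ : Field K₀) (_ : NumberField K₀) (_ : Algebra K₀ L), IsGalois K₀ L ∧ IsSolvable (L ≃ₐ[K₀] L) ∧ ∃ (ρ₀ : Literature.NumberTheory.GaloisRepresentations.FramedGaloisRep K₀ (PadicAlgCl ℓ) n) (χ : Literature.NumberTheory.GaloisRepresentations.FramedGaloisRep L (PadicAlgCl ℓ) 1), ((∀ᶠ v : IsDedekindDomain.HeightOneSpectrum (NumberField.RingOfIntegers K₀) in Filter.cofinite, ρ₀.IsUnramifiedAt v) ∧ ∀ (v : IsDedekindDomain.HeightOneSpectrum (NumberField.RingOfIntegers K₀)) (hv : ((ℓ : ℕ) : NumberField.RingOfIntegers K₀) ∈ v.asIdeal), (Literature.NumberTheory.PAdicHodge.fontainePstAdicCompletion v ℓ hv).IsDeRhamFramed (ρ₀.toLocal v)) ∧ (NumberField.IsTotallyReal K₀ ∨ NumberField.IsCMField K₀) ∧ ∀ g : Field.absoluteGaloisGroup L, Literature.NumberTheory.GaloisRepresentations.FramedRep.trace (ρ.restrictField L)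 g = Literature.NumberTheory.GaloisRepresentations.FramedRep.trace χ g * Literature.NumberTheory.GaloisRepresentations.FramedRep.trace (ρ₀.restrictField L) g)) ∧ (∀ (v : IsDedekindDomain.HeightOneSpectrum (NumberField.RingOfIntegers K)) (hv : ((ℓ : ℕ) : NumberField.RingOfIntegers K) ∈ v.asIdeal) (τ : v.adicCompletion K →+* PadicAlgCl ℓ), Continuous τ → (ρ.labelledHodgeTateWeightsAt v (Literature.NumberTheory.PAdicHodge.fontainePstAdicCompletion v ℓ hv).algebra (Literature.NumberTheory.PAdicHodge.fontainePstAdicCompletion v ℓ hv).𝔅 τ).Nodup ∧ ∀ a ∈ (ρ.labelledHodgeTateWeightsAt v (Literature.NumberTheory.PAdicHodge.fontainePstAdicCompletion v ℓ hv).algebra (Literature.NumberTheory.PAdicHodge.fontainePstAdicCompletion v ℓ hv).𝔅 τ), ∀ b ∈ (ρ.labelledHodgeTateWeightsAt v (Literature.NumberTheory.PAdicHodge.fontainePstAdicCompletion v ℓ hv).algebra (Literature.NumberTheory.PAdicHodge.fontainePstAdicCompletion v ℓ hv).𝔅 τ), ∀ c : ℤ, a ≤ c → c ≤ b → c ∈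 (ρ.labelledHodgeTateWeightsAt v (Literature.NumberTheory.PAdicHodge.fontainePstAdicCompletion v ℓ hv).algebra (Literature.NumberTheory.PAdicHodge.fontainePstAdicCompletion v ℓ hv).𝔅 τ))) → ∃ π : Literature.NumberTheory.Automorphic.CuspidalAutomorphicRepData n K hcpt, π.1.IsLAlgebraic ∧ ∀ᶠ v : IsDedekindDomain.HeightOneSpectrum (NumberField.RingOfIntegers K) in Filter.cofinite, SatakeFrobCompatibleAt ι π.1 ρ v

-- parent: UnpolarisedTRCMTypeAutomorphy · child (gen 2)
/--     item stmt-Langlands-33399 · crux · rank 302 · open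
    parent: UnpolarisedTRCMTypeAutomorphy · by planner
    why it might fail: S-implied, false only with ¬Langlands; as a TARGET: automorphy (not potential) needs residual ordinary automorphy over the CM field (open Serre-type input), Qian/ACC+ need decomposed-generic enormous residual image and p > n; TR K₀, n ≥ 3 only via CM base change + descent.
    sources: Literature/Barriers/Langlands/FamilyWitnessConsecutiveWeights.lean, arXiv:1812.09999, Qian2022, ACCGHLNSTT2023, arXiv:2309.15880, Geraghty2019
[crux] [NEW · WEAKER than S, than UNP and than GW (sub-box of GW 32659) · evasion (i) of
FamilyWitnessConsecutiveWeights («ordinary deformation theory (Hida families) … change the weight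
freely in the ordinary locus») · ATTACKABLE-BY-ENGINE] GWO = weak automorphy of every irreducible,
pinned-geometric, twist-primitive ρ : Γ_K → GL_n(ℚ̄_ℓ), n ≥ 2, of TR/CM type and not of polarised
type, HT-regular at every v ∣ ℓ and continuous label but with a GAP in some labelled Hodge–Tate
weight set (GW's box), that is POTENTIALLY ORDINARY: over some finite solvable Galois L/K, at every
w ∣ ℓ, ρ|Γ_{L_w} is conjugate to an upper-triangular representation with de Rham diagonal characters
of single labelled weights strictly increasing down the diagonal (the lens-1-g5 SlopeLadder clause
of ResidualAvatarLadder.CoreReducibleOrdinaryAutomorphy, VERBATIM). Engines (weight-free in the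
ordinary world): ACC+ Thm 6.1.2 (F CM, p > n, π ι-ordinary with r̄_ι(π) ≅ ρ̄ decomposed generic ⇒ ρ
ordinarily automorphic — NO weight hypothesis on π), Qian 2022 Thm 1.4 (F CM, ρ ordinary of ANY
regular weight, ρ̄ abs. irreducible decomposed generic with enormous image ⇒ ρ|F′ ordinarily
automorphic for a CM Galois F′/F), -/
@[route_item "route-Langlands-PolarisationCarving"]
def GappedOrdinaryAutomorphy : Prop :=
  ∀ (K : Type) [Field K] [NumberField K] (n : ℕ) (hcpt : Literature.NumberTheory.Automorphic.isCompact_glFiniteIntegralLevel n K), 2 ≤ n → ∀ (ℓ : ℕ) [Fact ℓ.Prime] (ι : PadicAlgCl ℓ ≃+* ℂ) (ρ : Literature.NumberTheory.GaloisRepresentations.FramedGaloisRep K (PadicAlgCl ℓ) n), ρ.toGaloisRep.IsIrreducible → ((∀ᶠ v : IsDedekindDomain.HeightOneSpectrum (NumberField.RingOfIntegers K) in Filter.cofinite, ρ.IsUnramifiedAt v) ∧ ∀ (v : IsDedekindDomain.HeightOneSpectrum (NumberField.RingOfIntegers K)) (hv : ((ℓ : ℕ) : NumberField.RingOfIntegers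 K) ∈ v.asIdeal), (Literature.NumberTheory.PAdicHodge.fontainePstAdicCompletion v ℓ hv).IsDeRhamFramed (ρ.toLocal v)) → ¬ (∃ η : Literature.NumberTheory.GaloisRepresentations.FramedGaloisRep K (PadicAlgCl ℓ) 1, (∃ᶠ v : IsDedekindDomain.HeightOneSpectrum (NumberField.RingOfIntegers K) in Filter.cofinite, ∃ a : PadicAlgCl ℓ, a ≠ 1 ∧ η.HasFrobCharpolyAt v (Polynomial.X - Polynomial.C a)) ∧ ∀ᶠ v : IsDedekindDomain.HeightOneSpectrum (NumberField.RingOfIntegers K) in Filter.cofinite, ∃ (P : Polynomial (PadicAlgCl ℓ)) (a : PadicAlgCl ℓ), ρ.HasFrobCharpolyAt v P ∧ η.HasFrobCharpolyAt v (Polynomial.X - Polynomial.C a) ∧ P.scaleRoots a = P) → (((¬ (∃ (L : Type) (_ : Field L) (_ : NumberField L) (_ : Algebra K L), IsGalois K L ∧ IsSolvable (L ≃ₐ[K] L) ∧ ∃ (K₀ : Type) (_ : Field K₀) (_ : NumberField K₀) (_ : Algebra K₀ L), IsGalois K₀ L ∧ IsSolvable (L ≃ₐ[K₀] L) ∧ ∃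 (ρ₀ : Literature.NumberTheory.GaloisRepresentations.FramedGaloisRep K₀ (PadicAlgCl ℓ) n) (χ : Literature.NumberTheory.GaloisRepresentations.FramedGaloisRep L (PadicAlgCl ℓ) 1), ((∀ᶠ v : IsDedekindDomain.HeightOneSpectrum (NumberField.RingOfIntegers K₀) in Filter.cofinite, ρ₀.IsUnramifiedAt v) ∧ ∀ (v : IsDedekindDomain.HeightOneSpectrum (NumberField.RingOfIntegers K₀)) (hv : ((ℓ : ℕ) : NumberField.RingOfIntegers K₀) ∈ v.asIdeal), (Literature.NumberTheory.PAdicHodge.fontainePstAdicCompletion v ℓ hv).IsDeRhamFramed (ρ₀.toLocal v)) ∧ ((NumberField.IsTotallyReal K₀ ∧ ∃ (μ : Literature.NumberTheory.GaloisRepresentations.FramedGaloisRep K₀ (PadicAlgCl ℓ) 1) (A : Matrix (Fin n) (Fin n) (PadicAlgCl ℓ)), IsUnit A.det ∧ (∀ σ : Field.absoluteGaloisGroup K₀, (ρ₀ σ).val.transpose * A * (ρ₀ σ).val = Literature.NumberTheory.GaloisRepresentations.FramedRep.trace μ σ • A) ∧ ∀ (φ : K₀ →+* ℝ) (c : Field.absoluteGaloisGroup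 K₀), Literature.NumberTheory.GaloisRepresentations.IsComplexConjugation φ c → A.transpose = Literature.NumberTheory.GaloisRepresentations.FramedRep.trace μ c • A) ∨ (NumberField.IsTotallyComplex K₀ ∧ ∃ (F : Type) (_ : Field F) (_ : NumberField F) (_ : Algebra F K₀) (_ : IsGalois F K₀), NumberField.IsTotallyReal F ∧ Module.finrank F K₀ = 2 ∧ ∃ μ : Literature.NumberTheory.GaloisRepresentations.FramedGaloisRep F (PadicAlgCl ℓ) 1, ∀ (φ : F →+* ℝ) (c : Field.absoluteGaloisGroup F), Literature.NumberTheory.GaloisRepresentations.IsComplexConjugation φ c → Literature.NumberTheory.GaloisRepresentations.FramedRep.trace μ c = -1 ∧ ∃ B : Matrix (Fin n) (Fin n) (PadicAlgCl ℓ), IsUnit B.det ∧ B.transpose = B ∧ ∀ σ : Field.absoluteGaloisGroup K₀, (ρ₀ σ).val.transpose * B * (ρ₀ (Literature.NumberTheory.GaloisRepresentations.absGaloisOuterConj F K₀ c σ)).val = Literature.NumberTheory.GaloisRepresentations.FramedRep.trace (μ.restrictField K₀) σ • B)) ∧ ∀ g : Field.absoluteGaloisGroup L, Literature.NumberTheory.GaloisRepresentations.FramedRep.trace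 (ρ.restrictField L) g = Literature.NumberTheory.GaloisRepresentations.FramedRep.trace χ g * Literature.NumberTheory.GaloisRepresentations.FramedRep.trace (ρ₀.restrictField L) g) ∧ (∃ (L : Type) (_ : Field L) (_ : NumberField L) (_ : Algebra K L), IsGalois K L ∧ IsSolvable (L ≃ₐ[K] L) ∧ ∃ (K₀ : Type) (_ : Field K₀) (_ : NumberField K₀) (_ : Algebra K₀ L), IsGalois K₀ L ∧ IsSolvable (L ≃ₐ[K₀] L) ∧ ∃ (ρ₀ : Literature.NumberTheory.GaloisRepresentations.FramedGaloisRep K₀ (PadicAlgCl ℓ) n) (χ : Literature.NumberTheory.GaloisRepresentations.FramedGaloisRep L (PadicAlgCl ℓ) 1), ((∀ᶠ v : IsDedekindDomain.HeightOneSpectrum (NumberField.RingOfIntegers K₀) in Filter.cofinite, ρ₀.IsUnramifiedAt v) ∧ ∀ (v : IsDedekindDomain.HeightOneSpectrum (NumberField.RingOfIntegers K₀)) (hv : ((ℓ : ℕ) : NumberField.RingOfIntegers K₀) ∈ v.asIdeal), (Literature.NumberTheory.PAdicHodge.fontainePstAdicCompletion v ℓ hv).IsDeRhamFramed (ρ₀.toLocal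 v)) ∧ (NumberField.IsTotallyReal K₀ ∨ NumberField.IsCMField K₀) ∧ ∀ g : Field.absoluteGaloisGroup L, Literature.NumberTheory.GaloisRepresentations.FramedRep.trace (ρ.restrictField L) g = Literature.NumberTheory.GaloisRepresentations.FramedRep.trace χ g * Literature.NumberTheory.GaloisRepresentations.FramedRep.trace (ρ₀.restrictField L) g)) ∧ ((∀ (v : IsDedekindDomain.HeightOneSpectrum (NumberField.RingOfIntegers K)) (hv : ((ℓ : ℕ) : NumberField.RingOfIntegers K) ∈ v.asIdeal) (τ : v.adicCompletion K →+* PadicAlgCl ℓ), Continuous τ → (ρ.labelledHodgeTateWeightsAt v (Literature.NumberTheory.PAdicHodge.fontainePstAdicCompletion v ℓ hv).algebra (Literature.NumberTheory.PAdicHodge.fontainePstAdicCompletion v ℓ hv).𝔅 τ).Nodup) ∧ ¬ (∀ (v : IsDedekindDomain.HeightOneSpectrum (NumberField.RingOfIntegers K)) (hv : ((ℓ : ℕ) : NumberField.RingOfIntegers K) ∈ v.asIdeal) (τ : v.adicCompletion K →+* PadicAlgCl ℓ), Continuous τ → (ρ.labelledHodgeTateWeightsAt v (Literature.NumberTheory.PAdicHodge.fontainePstAdicCompletion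 v ℓ hv).algebra (Literature.NumberTheory.PAdicHodge.fontainePstAdicCompletion v ℓ hv).𝔅 τ).Nodup ∧ ∀ a ∈ (ρ.labelledHodgeTateWeightsAt v (Literature.NumberTheory.PAdicHodge.fontainePstAdicCompletion v ℓ hv).algebra (Literature.NumberTheory.PAdicHodge.fontainePstAdicCompletion v ℓ hv).𝔅 τ), ∀ b ∈ (ρ.labelledHodgeTateWeightsAt v (Literature.NumberTheory.PAdicHodge.fontainePstAdicCompletion v ℓ hv).algebra (Literature.NumberTheory.PAdicHodge.fontainePstAdicCompletion v ℓ hv).𝔅 τ), ∀ c : ℤ, a ≤ c → c ≤ b → c ∈ (ρ.labelledHodgeTateWeightsAt v (Literature.NumberTheory.PAdicHodge.fontainePstAdicCompletion v ℓ hv).algebra (Literature.NumberTheory.PAdicHodge.fontainePstAdicCompletion v ℓ hv).𝔅 τ)))) ∧ (∃ (L : Type) (_ : Field L) (_ : NumberField L) (_ : Algebra K L), IsGalois K L ∧ IsSolvable (L ≃ₐ[K] L) ∧ ∀ (w : IsDedekindDomain.HeightOneSpectrum (NumberField.RingOfIntegers L)) (hw : ((ℓ : ℕ) : NumberField.RingOfIntegers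 L) ∈ w.asIdeal), letI := (Literature.NumberTheory.PAdicHodge.fontainePstAdicCompletion w ℓ hw).algebra; ∃ (g : GL (Fin n) (PadicAlgCl ℓ)) (ψ : Fin n → Literature.NumberTheory.GaloisRepresentations.FramedGaloisRep (w.adicCompletion L) (PadicAlgCl ℓ) 1) (a : Fin n → ((w.adicCompletion L) →ₐ[ℚ_[ℓ]] PadicAlgCl ℓ) → ℤ), Literature.NumberTheory.GaloisRepresentations.FramedRep.IsUpperTriangular (((ρ.restrictField L).toLocal w).conj g) ∧ (∀ (σ : Field.absoluteGaloisGroup (w.adicCompletion L)) (i : Fin n), Literature.NumberTheory.GaloisRepresentations.FramedRep.diagEntry (((ρ.restrictField L).toLocal w).conj g) i σ = (ψ i).trace σ) ∧ (∀ i : Fin n, (Literature.NumberTheory.PAdicHodge.fontainePstAdicCompletion w ℓ hw).IsDeRhamFramed (ψ i)) ∧ (∀ (i : Fin n) (τ : (w.adicCompletion L) →ₐ[ℚ_[ℓ]] PadicAlgCl ℓ), (Literature.NumberTheory.PAdicHodge.fontainePstAdicCompletion w ℓ hw).𝔅.labelledHodgeTateWeights (ψ i).toGaloisRep τ.toRingHom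 = {a i τ}) ∧ (∀ τ : (w.adicCompletion L) →ₐ[ℚ_[ℓ]] PadicAlgCl ℓ, StrictMono (fun i : Fin n => a i τ)))) → ∃ π : Literature.NumberTheory.Automorphic.CuspidalAutomorphicRepData n K hcpt, π.1.IsLAlgebraic ∧ ∀ᶠ v : IsDedekindDomain.HeightOneSpectrum (NumberField.RingOfIntegers K) in Filter.cofinite, SatakeFrobCompatibleAt ι π.1 ρ v

-- parent: UnpolarisedTRCMTypeAutomorphy · child (gen 2)
/--     item stmt-Langlands-33400 · crux · rank 303 · open
    parent: UnpolarisedTRCMTypeAutomorphy · by planner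
    why it might fail: S-implied, false only with ¬Langlands; as a TARGET print gives only POTENTIAL automorphy, rank 2, parallel gaps {0,m} (BCGNT Thm C); descent F′→K₀ for non-polarisable ρ, non-parallel labelled gaps and rank ≥ 3 systems have no engine; ordinary-prime existence open even for Δ.
    sources: Literature/Barriers/Langlands/FamilyWitnessConsecutiveWeights.lean, arXiv:2309.15880, arXiv:1812.09999, arXiv:2312.01551, Qian2022, HarrisShepherdbarronTaylor2010
[crux] [NEW · WEAKER than S, than UNP and than GW · evasion (ii) of FamilyWitnessConsecutiveWeights
(«potential diagonalizability + tensor-product trick … inside a compatible system») ·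
UNDECIDED-with-test · INSTRUMENTABLE] GNS = weak automorphy of every ρ in GW's box that is NOT
potentially ordinary but OF SYSTEM TYPE: some TR/CM sandwich (L, K₀, ρ₀, χ) of ρ (UNP's own second
clause) has its core avatar ρ₀ : Γ_{K₀} → GL_n(ℚ̄_ℓ) inside a VERY WEAKLY COMPATIBLE SYSTEM over K₀
(Boxer–Calegari–Gee–Newton–Thorne 2023 Def. 6.1.1 = ACC+ §7.1, λ-adic typing after the tree facts
IsWeaklyCompatibleSystemRat / IsWeaklyCompatibleFamily: number field of coefficients E, finite bad
set S, Q_v ∈ E[X] read by ρ₀ and by a semisimple companion ρ′_j for EVERY prime ℓ′ and embedding j :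
E → ℚ̄_ℓ′, companions crystalline with the one fixed labelled weight table off a set of primes of
Dirichlet density 0 — tree HasDirichletDensity). Members: ρ_{π,λ} of RAC π over CM K₀ at
non-ordinary λ (ACC+ Lemma 7.1.10), ℓ-adic realisations of gapped motives; rank 2 over imaginary
quadratic K: the genuine level-one Bianchi classes (7,10), (11,12), (91,6) at their supersingular
primes. Print (potential, partial): BCGN -/
@[route_item "route-Langlands-PolarisationCarving"]
def GappedNonOrdinarySystemAutomorphy : Prop :=
  ∀ (K : Type) [Field K] [NumberField K] (n : ℕ) (hcpt : Literature.NumberTheory.Automorphic.isCompact_glFiniteIntegralLevel n K), 2 ≤ n → ∀ (ℓ : ℕ) [Fact ℓ.Prime] (ι : PadicAlgCl ℓ ≃+* ℂ) (ρ : Literature.NumberTheory.GaloisRepresentations.FramedGaloisRep K (PadicAlgCl ℓ) n), ρ.toGaloisRep.IsIrreducible → ((∀ᶠ v : IsDedekindDomain.HeightOneSpectrum (NumberField.RingOfIntegers K) in Filter.cofinite, ρ.IsUnramifiedAt v) ∧ ∀ (v : IsDedekindDomain.HeightOneSpectrum (NumberField.RingOfIntegers K)) (hv : ((ℓ : ℕ)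 : NumberField.RingOfIntegers K) ∈ v.asIdeal), (Literature.NumberTheory.PAdicHodge.fontainePstAdicCompletion v ℓ hv).IsDeRhamFramed (ρ.toLocal v)) → ¬ (∃ η : Literature.NumberTheory.GaloisRepresentations.FramedGaloisRep K (PadicAlgCl ℓ) 1, (∃ᶠ v : IsDedekindDomain.HeightOneSpectrum (NumberField.RingOfIntegers K) in Filter.cofinite, ∃ a : PadicAlgCl ℓ, a ≠ 1 ∧ η.HasFrobCharpolyAt v (Polynomial.X - Polynomial.C a)) ∧ ∀ᶠ v : IsDedekindDomain.HeightOneSpectrum (NumberField.RingOfIntegers K) in Filter.cofinite, ∃ (P : Polynomial (PadicAlgCl ℓ)) (a : PadicAlgCl ℓ), ρ.HasFrobCharpolyAt v P ∧ η.HasFrobCharpolyAt v (Polynomial.X - Polynomial.C a) ∧ P.scaleRoots a = P) → (((¬ (∃ (L : Type) (_ : Field L) (_ : NumberField L) (_ : Algebra K L), IsGalois K L ∧ IsSolvable (L ≃ₐ[K] L) ∧ ∃ (K₀ : Type) (_ : Field K₀) (_ : NumberField K₀) (_ : Algebra K₀ L), IsGalois K₀ L ∧ IsSolvable (L ≃ₐ[K₀]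 L) ∧ ∃ (ρ₀ : Literature.NumberTheory.GaloisRepresentations.FramedGaloisRep K₀ (PadicAlgCl ℓ) n) (χ : Literature.NumberTheory.GaloisRepresentations.FramedGaloisRep L (PadicAlgCl ℓ) 1), ((∀ᶠ v : IsDedekindDomain.HeightOneSpectrum (NumberField.RingOfIntegers K₀) in Filter.cofinite, ρ₀.IsUnramifiedAt v) ∧ ∀ (v : IsDedekindDomain.HeightOneSpectrum (NumberField.RingOfIntegers K₀)) (hv : ((ℓ : ℕ) : NumberField.RingOfIntegers K₀) ∈ v.asIdeal), (Literature.NumberTheory.PAdicHodge.fontainePstAdicCompletion v ℓ hv).IsDeRhamFramed (ρ₀.toLocal v)) ∧ ((NumberField.IsTotallyReal K₀ ∧ ∃ (μ : Literature.NumberTheory.GaloisRepresentations.FramedGaloisRep K₀ (PadicAlgCl ℓ) 1) (A : Matrix (Fin n) (Fin n) (PadicAlgCl ℓ)), IsUnit A.det ∧ (∀ σ : Field.absoluteGaloisGroup K₀, (ρ₀ σ).val.transpose * A * (ρ₀ σ).val = Literature.NumberTheory.GaloisRepresentations.FramedRep.trace μ σ • A) ∧ ∀ (φ : K₀ →+*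 ℝ) (c : Field.absoluteGaloisGroup K₀), Literature.NumberTheory.GaloisRepresentations.IsComplexConjugation φ c → A.transpose = Literature.NumberTheory.GaloisRepresentations.FramedRep.trace μ c • A) ∨ (NumberField.IsTotallyComplex K₀ ∧ ∃ (F : Type) (_ : Field F) (_ : NumberField F) (_ : Algebra F K₀) (_ : IsGalois F K₀), NumberField.IsTotallyReal F ∧ Module.finrank F K₀ = 2 ∧ ∃ μ : Literature.NumberTheory.GaloisRepresentations.FramedGaloisRep F (PadicAlgCl ℓ) 1, ∀ (φ : F →+* ℝ) (c : Field.absoluteGaloisGroup F), Literature.NumberTheory.GaloisRepresentations.IsComplexConjugation φ c → Literature.NumberTheory.GaloisRepresentations.FramedRep.trace μ c = -1 ∧ ∃ B : Matrix (Fin n) (Fin n) (PadicAlgCl ℓ), IsUnit B.det ∧ B.transpose = B ∧ ∀ σ : Field.absoluteGaloisGroup K₀, (ρ₀ σ).val.transpose * B * (ρ₀ (Literature.NumberTheory.GaloisRepresentations.absGaloisOuterConj F K₀ c σ)).val = Literature.NumberTheory.GaloisRepresentations.FramedRep.trace (μ.restrictField K₀) σ • B)) ∧ ∀ g : Field.absoluteGaloisGroup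 L, Literature.NumberTheory.GaloisRepresentations.FramedRep.trace (ρ.restrictField L) g = Literature.NumberTheory.GaloisRepresentations.FramedRep.trace χ g * Literature.NumberTheory.GaloisRepresentations.FramedRep.trace (ρ₀.restrictField L) g) ∧ (∃ (L : Type) (_ : Field L) (_ : NumberField L) (_ : Algebra K L), IsGalois K L ∧ IsSolvable (L ≃ₐ[K] L) ∧ ∃ (K₀ : Type) (_ : Field K₀) (_ : NumberField K₀) (_ : Algebra K₀ L), IsGalois K₀ L ∧ IsSolvable (L ≃ₐ[K₀] L) ∧ ∃ (ρ₀ : Literature.NumberTheory.GaloisRepresentations.FramedGaloisRep K₀ (PadicAlgCl ℓ) n) (χ : Literature.NumberTheory.GaloisRepresentations.FramedGaloisRep L (PadicAlgCl ℓ) 1), ((∀ᶠ v : IsDedekindDomain.HeightOneSpectrum (NumberField.RingOfIntegers K₀) in Filter.cofinite, ρ₀.IsUnramifiedAt v) ∧ ∀ (v : IsDedekindDomain.HeightOneSpectrum (NumberField.RingOfIntegers K₀)) (hv : ((ℓ : ℕ) : NumberField.RingOfIntegers K₀) ∈ v.asIdeal), (Literature.NumberTheory.PAdicHodge.fontainePstAdicCompletion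 v ℓ hv).IsDeRhamFramed (ρ₀.toLocal v)) ∧ (NumberField.IsTotallyReal K₀ ∨ NumberField.IsCMField K₀) ∧ ∀ g : Field.absoluteGaloisGroup L, Literature.NumberTheory.GaloisRepresentations.FramedRep.trace (ρ.restrictField L) g = Literature.NumberTheory.GaloisRepresentations.FramedRep.trace χ g * Literature.NumberTheory.GaloisRepresentations.FramedRep.trace (ρ₀.restrictField L) g)) ∧ ((∀ (v : IsDedekindDomain.HeightOneSpectrum (NumberField.RingOfIntegers K)) (hv : ((ℓ : ℕ) : NumberField.RingOfIntegers K) ∈ v.asIdeal) (τ : v.adicCompletion K →+* PadicAlgCl ℓ), Continuous τ → (ρ.labelledHodgeTateWeightsAt v (Literature.NumberTheory.PAdicHodge.fontainePstAdicCompletion v ℓ hv).algebra (Literature.NumberTheory.PAdicHodge.fontainePstAdicCompletion v ℓ hv).𝔅 τ).Nodup) ∧ ¬ (∀ (v : IsDedekindDomain.HeightOneSpectrum (NumberField.RingOfIntegers K)) (hv : ((ℓ : ℕ) : NumberField.RingOfIntegers K) ∈ v.asIdeal) (τ : v.adicCompletion K →+* PadicAlgCl ℓ), Continuous τ → (ρ.labelledHodgeTateWeightsAt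 v (Literature.NumberTheory.PAdicHodge.fontainePstAdicCompletion v ℓ hv).algebra (Literature.NumberTheory.PAdicHodge.fontainePstAdicCompletion v ℓ hv).𝔅 τ).Nodup ∧ ∀ a ∈ (ρ.labelledHodgeTateWeightsAt v (Literature.NumberTheory.PAdicHodge.fontainePstAdicCompletion v ℓ hv).algebra (Literature.NumberTheory.PAdicHodge.fontainePstAdicCompletion v ℓ hv).𝔅 τ), ∀ b ∈ (ρ.labelledHodgeTateWeightsAt v (Literature.NumberTheory.PAdicHodge.fontainePstAdicCompletion v ℓ hv).algebra (Literature.NumberTheory.PAdicHodge.fontainePstAdicCompletion v ℓ hv).𝔅 τ), ∀ c : ℤ, a ≤ c → c ≤ b → c ∈ (ρ.labelledHodgeTateWeightsAt v (Literature.NumberTheory.PAdicHodge.fontainePstAdicCompletion v ℓ hv).algebra (Literature.NumberTheory.PAdicHodge.fontainePstAdicCompletion v ℓ hv).𝔅 τ)))) ∧ (¬ (∃ (L : Type) (_ : Field L) (_ : NumberField L) (_ : Algebra K L), IsGalois K L ∧ IsSolvable (L ≃ₐ[K] L) ∧ ∀ (w : IsDedekindDomain.HeightOneSpectrum (NumberField.RingOfIntegers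 L)) (hw : ((ℓ : ℕ) : NumberField.RingOfIntegers L) ∈ w.asIdeal), letI := (Literature.NumberTheory.PAdicHodge.fontainePstAdicCompletion w ℓ hw).algebra; ∃ (g : GL (Fin n) (PadicAlgCl ℓ)) (ψ : Fin n → Literature.NumberTheory.GaloisRepresentations.FramedGaloisRep (w.adicCompletion L) (PadicAlgCl ℓ) 1) (a : Fin n → ((w.adicCompletion L) →ₐ[ℚ_[ℓ]] PadicAlgCl ℓ) → ℤ), Literature.NumberTheory.GaloisRepresentations.FramedRep.IsUpperTriangular (((ρ.restrictField L).toLocal w).conj g) ∧ (∀ (σ : Field.absoluteGaloisGroup (w.adicCompletion L)) (i : Fin n), Literature.NumberTheory.GaloisRepresentations.FramedRep.diagEntry (((ρ.restrictField L).toLocal w).conj g) i σ = (ψ i).trace σ) ∧ (∀ i : Fin n, (Literature.NumberTheory.PAdicHodge.fontainePstAdicCompletion w ℓ hw).IsDeRhamFramed (ψ i)) ∧ (∀ (i : Fin n) (τ : (w.adicCompletion L) →ₐ[ℚ_[ℓ]] PadicAlgCl ℓ), (Literature.NumberTheory.PAdicHodge.fontainePstAdicCompletion w ℓ hw).𝔅.labelledHodgeTateWeights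 (ψ i).toGaloisRep τ.toRingHom = {a i τ}) ∧ (∀ τ : (w.adicCompletion L) →ₐ[ℚ_[ℓ]] PadicAlgCl ℓ, StrictMono (fun i : Fin n => a i τ))) ∧ (∃ (L : Type) (_ : Field L) (_ : NumberField L) (_ : Algebra K L), IsGalois K L ∧ IsSolvable (L ≃ₐ[K] L) ∧ ∃ (K₀ : Type) (_ : Field K₀) (_ : NumberField K₀) (_ : Algebra K₀ L), IsGalois K₀ L ∧ IsSolvable (L ≃ₐ[K₀] L) ∧ ∃ (ρ₀ : Literature.NumberTheory.GaloisRepresentations.FramedGaloisRep K₀ (PadicAlgCl ℓ) n) (χ : Literature.NumberTheory.GaloisRepresentations.FramedGaloisRep L (PadicAlgCl ℓ) 1), ((∀ᶠ v : IsDedekindDomain.HeightOneSpectrum (NumberField.RingOfIntegers K₀) in Filter.cofinite, ρ₀.IsUnramifiedAt v) ∧ ∀ (v : IsDedekindDomain.HeightOneSpectrum (NumberField.RingOfIntegers K₀)) (hv : ((ℓ : ℕ) : NumberField.RingOfIntegers K₀) ∈ v.asIdeal), (Literature.NumberTheory.PAdicHodge.fontainePstAdicCompletion v ℓ hv).IsDeRhamFramed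 (ρ₀.toLocal v)) ∧ (NumberField.IsTotallyReal K₀ ∨ NumberField.IsCMField K₀) ∧ (∃ (E : Type) (_ : Field E) (_ : NumberField E) (e : E →+* PadicAlgCl ℓ) (S : Finset (IsDedekindDomain.HeightOneSpectrum (NumberField.RingOfIntegers K₀))) (Q : IsDedekindDomain.HeightOneSpectrum (NumberField.RingOfIntegers K₀) → Polynomial E) (H : (K₀ →+* E) → Multiset ℤ) (X : Set ℕ), (∀ τ₀ : K₀ →+* PadicAlgCl ℓ, ∃ σ : K₀ →+* E, e.comp σ = τ₀) ∧ (Filter.Tendsto (fun s : ℝ => (∑' p : ℕ, if p.Prime ∧ p ∈ X then (p : ℝ) ^ (-s) else 0) / Real.log (1 / (s - 1))) (nhdsWithin (1 : ℝ) (Set.Ioi 1)) (nhds (0 : ℝ))) ∧ (∀ v : IsDedekindDomain.HeightOneSpectrum (NumberField.RingOfIntegers K₀), v ∉ S → ((ℓ : ℕ) : NumberField.RingOfIntegers K₀) ∉ v.asIdeal → ρ₀.IsUnramifiedAt v ∧ ρ₀.HasFrobCharpolyAt v ((Q v).map e)) ∧ ∀ (ℓ' : ℕ) [Fact ℓ'.Prime]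 (j : E →+* PadicAlgCl ℓ'), ∃ ρ' : Literature.NumberTheory.GaloisRepresentations.FramedGaloisRep K₀ (PadicAlgCl ℓ') n, ρ'.toGaloisRep.IsSemisimple ∧ (∀ v : IsDedekindDomain.HeightOneSpectrum (NumberField.RingOfIntegers K₀), v ∉ S → ((ℓ' : ℕ) : NumberField.RingOfIntegers K₀) ∉ v.asIdeal → ρ'.IsUnramifiedAt v ∧ ρ'.HasFrobCharpolyAt v ((Q v).map j)) ∧ (ℓ' ∉ X → ∀ (v : IsDedekindDomain.HeightOneSpectrum (NumberField.RingOfIntegers K₀)) (hv : ((ℓ' : ℕ) : NumberField.RingOfIntegers K₀) ∈ v.asIdeal), (Literature.NumberTheory.PAdicHodge.fontainePstAdicCompletion v ℓ' hv).IsCrystallineFramed (ρ'.toLocal v) ∧ ∀ (τ : v.adicCompletion K₀ →+* PadicAlgCl ℓ'), Continuous τ → ∀ σ : K₀ →+* E, j.comp σ = τ.comp (algebraMap K₀ (v.adicCompletion K₀)) → ρ'.labelledHodgeTateWeightsAt v (Literature.NumberTheory.PAdicHodge.fontainePstAdicCompletion v ℓ' hv).algebra (Literature.NumberTheory.PAdicHodge.fontainePstAdicCompletion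 v ℓ' hv).𝔅 τ = H σ)) ∧ ∀ g : Field.absoluteGaloisGroup L, Literature.NumberTheory.GaloisRepresentations.FramedRep.trace (ρ.restrictField L) g = Literature.NumberTheory.GaloisRepresentations.FramedRep.trace χ g * Literature.NumberTheory.GaloisRepresentations.FramedRep.trace (ρ₀.restrictField L) g))) → ∃ π : Literature.NumberTheory.Automorphic.CuspidalAutomorphicRepData n K hcpt, π.1.IsLAlgebraic ∧ ∀ᶠ v : IsDedekindDomain.HeightOneSpectrum (NumberField.RingOfIntegers K) in Filter.cofinite, SatakeFrobCompatibleAt ι π.1 ρ v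

-- parent: UnpolarisedTRCMTypeAutomorphy · child (gen 2)
/--     item stmt-Langlands-33401 · crux · rank 304 · open
    parent: UnpolarisedTRCMTypeAutomorphy · by planner
    why it might fail: S-implied, false only with ¬Langlands; as a TARGET it is FamilyWitnessConsecutiveWeights with all printed evasions switched off (gap ∧ ¬ordinary ∧ no compatible system) inside positive defect: no potential-automorphy mechanism in print reaches a single such ρ.
    sources: Literature/Barriers/Langlands/FamilyWitnessConsecutiveWeights.lean, arXiv:2309.15880, arXiv:2312.01551, Qian2022, CalegariGeraghty2017, Literature/Barriers/Langlands/TaylorWilesNumericalCoincidence.lean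
[crux] [DECLARED RESIDUAL of this split · NEW · WEAKER than S, than UNP and than GW · NO printed
evasion of FamilyWitnessConsecutiveWeights applies («None of (i)–(iii) is printed for non-ordinary,
non-polarizable ρ over a CM field») · GHOST (conjecturally empty) · BARRIER head-on · IDEA-NEEDED]
GNL = weak automorphy of every ρ in GW's box that is NEITHER potentially ordinary NOR of system
type: a lone non-ordinary gapped geometric ρ none of whose TR/CM avatars ρ₀ has λ-adic companions.
Conjecturally EMPTY (Fontaine–Mazur + Langlands: an automorphic ρ₀ lies in the system of its π, ACC+
Lemma 7.1.10; Tate / motivic companions), but no member can be excluded unconditionally: «ρ₀ has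
companions» for a single non-polarisable ρ₀ is the open companions crux N0′
CompatibleFamilySplit.GeometricCompanions (stmt-Langlands-18969) restricted to TR/CM fields — this
node ASSUMES nothing of it (SYS is a hypothesis on ρ). No family witness (gap:
not_isFamilyRealizable_of_gap), no Hida family (¬ORD), no tensor trick / prime switch (¬SYS): every
printed potential-automorphy mechanism is absent by the three typed hypotheses. Ideas that would
populate an attack: finite-slope families / eigenvarieties f -/
@[route_item "route-Langlands-PolarisationCarving"]
def GappedNonOrdinaryLoneAutomorphy : Prop :=
  ∀ (K : Type) [Field K] [NumberField K] (n : ℕ) (hcpt : Literature.NumberTheory.Automorphic.isCompact_glFiniteIntegralLevel n K), 2 ≤ n → ∀ (ℓ : ℕ) [Fact ℓ.Prime] (ι : PadicAlgCl ℓ ≃+* ℂ) (ρ : Literature.NumberTheory.GaloisRepresentations.FramedGaloisRep K (PadicAlgCl ℓ) n), ρ.toGaloisRep.IsIrreducible → ((∀ᶠ v : IsDedekindDomain.HeightOneSpectrum (NumberField.RingOfIntegers K) in Filter.cofinite, ρ.IsUnramifiedAt v) ∧ ∀ (v : IsDedekindDomain.HeightOneSpectrum (NumberField.RingOfIntegers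 K)) (hv : ((ℓ : ℕ) : NumberField.RingOfIntegers K) ∈ v.asIdeal), (Literature.NumberTheory.PAdicHodge.fontainePstAdicCompletion v ℓ hv).IsDeRhamFramed (ρ.toLocal v)) → ¬ (∃ η : Literature.NumberTheory.GaloisRepresentations.FramedGaloisRep K (PadicAlgCl ℓ) 1, (∃ᶠ v : IsDedekindDomain.HeightOneSpectrum (NumberField.RingOfIntegers K) in Filter.cofinite, ∃ a : PadicAlgCl ℓ, a ≠ 1 ∧ η.HasFrobCharpolyAt v (Polynomial.X - Polynomial.C a)) ∧ ∀ᶠ v : IsDedekindDomain.HeightOneSpectrum (NumberField.RingOfIntegers K) in Filter.cofinite, ∃ (P : Polynomial (PadicAlgCl ℓ)) (a : PadicAlgCl ℓ), ρ.HasFrobCharpolyAt v P ∧ η.HasFrobCharpolyAt v (Polynomial.X - Polynomial.C a) ∧ P.scaleRoots a = P) → (((¬ (∃ (L : Type) (_ : Field L) (_ : NumberField L) (_ : Algebra K L), IsGalois K L ∧ IsSolvable (L ≃ₐ[K] L) ∧ ∃ (K₀ : Type) (_ : Field K₀) (_ : NumberField K₀) (_ : Algebra K₀ L), IsGalois K₀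 L ∧ IsSolvable (L ≃ₐ[K₀] L) ∧ ∃ (ρ₀ : Literature.NumberTheory.GaloisRepresentations.FramedGaloisRep K₀ (PadicAlgCl ℓ) n) (χ : Literature.NumberTheory.GaloisRepresentations.FramedGaloisRep L (PadicAlgCl ℓ) 1), ((∀ᶠ v : IsDedekindDomain.HeightOneSpectrum (NumberField.RingOfIntegers K₀) in Filter.cofinite, ρ₀.IsUnramifiedAt v) ∧ ∀ (v : IsDedekindDomain.HeightOneSpectrum (NumberField.RingOfIntegers K₀)) (hv : ((ℓ : ℕ) : NumberField.RingOfIntegers K₀) ∈ v.asIdeal), (Literature.NumberTheory.PAdicHodge.fontainePstAdicCompletion v ℓ hv).IsDeRhamFramed (ρ₀.toLocal v)) ∧ ((NumberField.IsTotallyReal K₀ ∧ ∃ (μ : Literature.NumberTheory.GaloisRepresentations.FramedGaloisRep K₀ (PadicAlgCl ℓ) 1) (A : Matrix (Fin n) (Fin n) (PadicAlgCl ℓ)), IsUnit A.det ∧ (∀ σ : Field.absoluteGaloisGroup K₀, (ρ₀ σ).val.transpose * A * (ρ₀ σ).val = Literature.NumberTheory.GaloisRepresentations.FramedRep.trace μ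 σ • A) ∧ ∀ (φ : K₀ →+* ℝ) (c : Field.absoluteGaloisGroup K₀), Literature.NumberTheory.GaloisRepresentations.IsComplexConjugation φ c → A.transpose = Literature.NumberTheory.GaloisRepresentations.FramedRep.trace μ c • A) ∨ (NumberField.IsTotallyComplex K₀ ∧ ∃ (F : Type) (_ : Field F) (_ : NumberField F) (_ : Algebra F K₀) (_ : IsGalois F K₀), NumberField.IsTotallyReal F ∧ Module.finrank F K₀ = 2 ∧ ∃ μ : Literature.NumberTheory.GaloisRepresentations.FramedGaloisRep F (PadicAlgCl ℓ) 1, ∀ (φ : F →+* ℝ) (c : Field.absoluteGaloisGroup F), Literature.NumberTheory.GaloisRepresentations.IsComplexConjugation φ c → Literature.NumberTheory.GaloisRepresentations.FramedRep.trace μ c = -1 ∧ ∃ B : Matrix (Fin n) (Fin n) (PadicAlgCl ℓ), IsUnit B.det ∧ B.transpose = B ∧ ∀ σ : Field.absoluteGaloisGroup K₀, (ρ₀ σ).val.transpose * B * (ρ₀ (Literature.NumberTheory.GaloisRepresentations.absGaloisOuterConj F K₀ c σ)).val = Literature.NumberTheory.GaloisRepresentations.FramedRep.trace (μ.restrictField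 K₀) σ • B)) ∧ ∀ g : Field.absoluteGaloisGroup L, Literature.NumberTheory.GaloisRepresentations.FramedRep.trace (ρ.restrictField L) g = Literature.NumberTheory.GaloisRepresentations.FramedRep.trace χ g * Literature.NumberTheory.GaloisRepresentations.FramedRep.trace (ρ₀.restrictField L) g) ∧ (∃ (L : Type) (_ : Field L) (_ : NumberField L) (_ : Algebra K L), IsGalois K L ∧ IsSolvable (L ≃ₐ[K] L) ∧ ∃ (K₀ : Type) (_ : Field K₀) (_ : NumberField K₀) (_ : Algebra K₀ L), IsGalois K₀ L ∧ IsSolvable (L ≃ₐ[K₀] L) ∧ ∃ (ρ₀ : Literature.NumberTheory.GaloisRepresentations.FramedGaloisRep K₀ (PadicAlgCl ℓ) n) (χ : Literature.NumberTheory.GaloisRepresentations.FramedGaloisRep L (PadicAlgCl ℓ) 1), ((∀ᶠ v : IsDedekindDomain.HeightOneSpectrum (NumberField.RingOfIntegers K₀) in Filter.cofinite, ρ₀.IsUnramifiedAt v) ∧ ∀ (v : IsDedekindDomain.HeightOneSpectrum (NumberField.RingOfIntegers K₀)) (hv : ((ℓ : ℕ) : NumberField.RingOfIntegers K₀) ∈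 v.asIdeal), (Literature.NumberTheory.PAdicHodge.fontainePstAdicCompletion v ℓ hv).IsDeRhamFramed (ρ₀.toLocal v)) ∧ (NumberField.IsTotallyReal K₀ ∨ NumberField.IsCMField K₀) ∧ ∀ g : Field.absoluteGaloisGroup L, Literature.NumberTheory.GaloisRepresentations.FramedRep.trace (ρ.restrictField L) g = Literature.NumberTheory.GaloisRepresentations.FramedRep.trace χ g * Literature.NumberTheory.GaloisRepresentations.FramedRep.trace (ρ₀.restrictField L) g)) ∧ ((∀ (v : IsDedekindDomain.HeightOneSpectrum (NumberField.RingOfIntegers K)) (hv : ((ℓ : ℕ) : NumberField.RingOfIntegers K) ∈ v.asIdeal) (τ : v.adicCompletion K →+* PadicAlgCl ℓ), Continuous τ → (ρ.labelledHodgeTateWeightsAt v (Literature.NumberTheory.PAdicHodge.fontainePstAdicCompletion v ℓ hv).algebra (Literature.NumberTheory.PAdicHodge.fontainePstAdicCompletion v ℓ hv).𝔅 τ).Nodup) ∧ ¬ (∀ (v : IsDedekindDomain.HeightOneSpectrum (NumberField.RingOfIntegers K)) (hv : ((ℓ : ℕ) : NumberField.RingOfIntegers K) ∈ v.asIdeal)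 (τ : v.adicCompletion K →+* PadicAlgCl ℓ), Continuous τ → (ρ.labelledHodgeTateWeightsAt v (Literature.NumberTheory.PAdicHodge.fontainePstAdicCompletion v ℓ hv).algebra (Literature.NumberTheory.PAdicHodge.fontainePstAdicCompletion v ℓ hv).𝔅 τ).Nodup ∧ ∀ a ∈ (ρ.labelledHodgeTateWeightsAt v (Literature.NumberTheory.PAdicHodge.fontainePstAdicCompletion v ℓ hv).algebra (Literature.NumberTheory.PAdicHodge.fontainePstAdicCompletion v ℓ hv).𝔅 τ), ∀ b ∈ (ρ.labelledHodgeTateWeightsAt v (Literature.NumberTheory.PAdicHodge.fontainePstAdicCompletion v ℓ hv).algebra (Literature.NumberTheory.PAdicHodge.fontainePstAdicCompletion v ℓ hv).𝔅 τ), ∀ c : ℤ, a ≤ c → c ≤ b → c ∈ (ρ.labelledHodgeTateWeightsAt v (Literature.NumberTheory.PAdicHodge.fontainePstAdicCompletion v ℓ hv).algebra (Literature.NumberTheory.PAdicHodge.fontainePstAdicCompletion v ℓ hv).𝔅 τ)))) ∧ (¬ (∃ (L : Type) (_ : Field L) (_ : NumberField L) (_ : Algebra K L), IsGalois K L ∧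 IsSolvable (L ≃ₐ[K] L) ∧ ∀ (w : IsDedekindDomain.HeightOneSpectrum (NumberField.RingOfIntegers L)) (hw : ((ℓ : ℕ) : NumberField.RingOfIntegers L) ∈ w.asIdeal), letI := (Literature.NumberTheory.PAdicHodge.fontainePstAdicCompletion w ℓ hw).algebra; ∃ (g : GL (Fin n) (PadicAlgCl ℓ)) (ψ : Fin n → Literature.NumberTheory.GaloisRepresentations.FramedGaloisRep (w.adicCompletion L) (PadicAlgCl ℓ) 1) (a : Fin n → ((w.adicCompletion L) →ₐ[ℚ_[ℓ]] PadicAlgCl ℓ) → ℤ), Literature.NumberTheory.GaloisRepresentations.FramedRep.IsUpperTriangular (((ρ.restrictField L).toLocal w).conj g) ∧ (∀ (σ : Field.absoluteGaloisGroup (w.adicCompletion L)) (i : Fin n), Literature.NumberTheory.GaloisRepresentations.FramedRep.diagEntry (((ρ.restrictField L).toLocal w).conj g) i σ = (ψ i).trace σ) ∧ (∀ i : Fin n, (Literature.NumberTheory.PAdicHodge.fontainePstAdicCompletion w ℓ hw).IsDeRhamFramed (ψ i)) ∧ (∀ (i : Fin n) (τ : (w.adicCompletion L) →ₐ[ℚ_[ℓ]]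 PadicAlgCl ℓ), (Literature.NumberTheory.PAdicHodge.fontainePstAdicCompletion w ℓ hw).𝔅.labelledHodgeTateWeights (ψ i).toGaloisRep τ.toRingHom = {a i τ}) ∧ (∀ τ : (w.adicCompletion L) →ₐ[ℚ_[ℓ]] PadicAlgCl ℓ, StrictMono (fun i : Fin n => a i τ))) ∧ ¬ (∃ (L : Type) (_ : Field L) (_ : NumberField L) (_ : Algebra K L), IsGalois K L ∧ IsSolvable (L ≃ₐ[K] L) ∧ ∃ (K₀ : Type) (_ : Field K₀) (_ : NumberField K₀) (_ : Algebra K₀ L), IsGalois K₀ L ∧ IsSolvable (L ≃ₐ[K₀] L) ∧ ∃ (ρ₀ : Literature.NumberTheory.GaloisRepresentations.FramedGaloisRep K₀ (PadicAlgCl ℓ) n) (χ : Literature.NumberTheory.GaloisRepresentations.FramedGaloisRep L (PadicAlgCl ℓ) 1), ((∀ᶠ v : IsDedekindDomain.HeightOneSpectrum (NumberField.RingOfIntegers K₀) in Filter.cofinite, ρ₀.IsUnramifiedAt v) ∧ ∀ (v : IsDedekindDomain.HeightOneSpectrum (NumberField.RingOfIntegers K₀)) (hv : ((ℓ : ℕ)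 : NumberField.RingOfIntegers K₀) ∈ v.asIdeal), (Literature.NumberTheory.PAdicHodge.fontainePstAdicCompletion v ℓ hv).IsDeRhamFramed (ρ₀.toLocal v)) ∧ (NumberField.IsTotallyReal K₀ ∨ NumberField.IsCMField K₀) ∧ (∃ (E : Type) (_ : Field E) (_ : NumberField E) (e : E →+* PadicAlgCl ℓ) (S : Finset (IsDedekindDomain.HeightOneSpectrum (NumberField.RingOfIntegers K₀))) (Q : IsDedekindDomain.HeightOneSpectrum (NumberField.RingOfIntegers K₀) → Polynomial E) (H : (K₀ →+* E) → Multiset ℤ) (X : Set ℕ), (∀ τ₀ : K₀ →+* PadicAlgCl ℓ, ∃ σ : K₀ →+* E, e.comp σ = τ₀) ∧ (Filter.Tendsto (fun s : ℝ => (∑' p : ℕ, if p.Prime ∧ p ∈ X then (p : ℝ) ^ (-s) else 0) / Real.log (1 / (s - 1))) (nhdsWithin (1 : ℝ) (Set.Ioi 1)) (nhds (0 : ℝ))) ∧ (∀ v : IsDedekindDomain.HeightOneSpectrum (NumberField.RingOfIntegers K₀), v ∉ S → ((ℓ : ℕ) : NumberField.RingOfIntegers K₀) ∉ v.asIdeal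 → ρ₀.IsUnramifiedAt v ∧ ρ₀.HasFrobCharpolyAt v ((Q v).map e)) ∧ ∀ (ℓ' : ℕ) [Fact ℓ'.Prime] (j : E →+* PadicAlgCl ℓ'), ∃ ρ' : Literature.NumberTheory.GaloisRepresentations.FramedGaloisRep K₀ (PadicAlgCl ℓ') n, ρ'.toGaloisRep.IsSemisimple ∧ (∀ v : IsDedekindDomain.HeightOneSpectrum (NumberField.RingOfIntegers K₀), v ∉ S → ((ℓ' : ℕ) : NumberField.RingOfIntegers K₀) ∉ v.asIdeal → ρ'.IsUnramifiedAt v ∧ ρ'.HasFrobCharpolyAt v ((Q v).map j)) ∧ (ℓ' ∉ X → ∀ (v : IsDedekindDomain.HeightOneSpectrum (NumberField.RingOfIntegers K₀)) (hv : ((ℓ' : ℕ) : NumberField.RingOfIntegers K₀) ∈ v.asIdeal), (Literature.NumberTheory.PAdicHodge.fontainePstAdicCompletion v ℓ' hv).IsCrystallineFramed (ρ'.toLocal v) ∧ ∀ (τ : v.adicCompletion K₀ →+* PadicAlgCl ℓ'), Continuous τ → ∀ σ : K₀ →+* E, j.comp σ = τ.comp (algebraMap K₀ (v.adicCompletion K₀))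 → ρ'.labelledHodgeTateWeightsAt v (Literature.NumberTheory.PAdicHodge.fontainePstAdicCompletion v ℓ' hv).algebra (Literature.NumberTheory.PAdicHodge.fontainePstAdicCompletion v ℓ' hv).𝔅 τ = H σ)) ∧ ∀ g : Field.absoluteGaloisGroup L, Literature.NumberTheory.GaloisRepresentations.FramedRep.trace (ρ.restrictField L) g = Literature.NumberTheory.GaloisRepresentations.FramedRep.trace χ g * Literature.NumberTheory.GaloisRepresentations.FramedRep.trace (ρ₀.restrictField L) g))) → ∃ π : Literature.NumberTheory.Automorphic.CuspidalAutomorphicRepData n K hcpt, π.1.IsLAlgebraic ∧ ∀ᶠ v : IsDedekindDomain.HeightOneSpectrum (NumberField.RingOfIntegers K) in Filter.cofinite, SatakeFrobCompatibleAt ι π.1 ρ v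

-- parent: UnpolarisedTRCMTypeAutomorphy · child (gen 2)
/--     item stmt-Langlands-33402 · crux · rank 305 · open
    parent: UnpolarisedTRCMTypeAutomorphy · by planner
    why it might fail: S-implied, false only with ¬Langlands; as a TARGET it is NonRegularWeightBarrier in positive defect: no cohomological realisation of irregular π on GL_n/CM, no irregular-weight lifting beyond conditional Calegari–Geraghty; abelian surfaces over imaginary quadratic F open.
    sources: Literature/Barriers/Langlands/NonRegularWeightBarrier.lean, CalegariGeraghty2017, arXiv:1207.4224, arXiv:1812.09269, arXiv:1306.2070, Literature/Barriers/Langlands/TaylorWilesNumericalCoincidence.lean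
[crux] [DECLARED RESIDUAL of this split · NEW · WEAKER than S and than UNP (sub-box) · BARRIER
NonRegularWeightBarrier head-on inside the positive-defect world · IDEA-NEEDED] IW = weak automorphy
(an L-algebraic cuspidal π on GL_n/K, Satake–Frobenius compatible a.e.) of every irreducible,
pinned-geometric, twist-primitive ρ : Γ_K → GL_n(ℚ̄_ℓ), n ≥ 2, of TR/CM type and NOT of polarised
type (UNP's box, stmt-Langlands-32055) that is NOT HT-regular: at some place v ∣ ℓ and some
continuous label τ : K_v → ℚ̄_ℓ the τ-labelled Hodge–Tate weight multiset (tree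
`FramedGaloisRep.labelledHodgeTateWeightsAt` at Fontaine's pinned datum) has a repetition —
weight-one type, abelian surfaces over imaginary quadratic fields (HT {0,0,1,1}), irregular motives
over CM fields. Print-settled sub-population (crit-1 advisory c3, L516): functorial images
(Rankin–Selberg ⊠, Kim–Shahidi) of settled regular objects, and the finite-image-type members χ ⊗ σ
(σ Artin, HT_τ = {a,…,a}) that are twist-primitive yet automorphic in print — solvable image
(Langlands–Tunnell, Arthur–Clozel), monomial from a non-normal cubic
(Jacquet–Piatetski-Shapiro–Shalika 1981). Open core = the infinite-image irregular population: -/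
@[route_item "route-Langlands-PolarisationCarving"]
def IrregularUnpolarisedAutomorphy : Prop :=
  ∀ (K : Type) [Field K] [NumberField K] (n : ℕ) (hcpt : Literature.NumberTheory.Automorphic.isCompact_glFiniteIntegralLevel n K), 2 ≤ n → ∀ (ℓ : ℕ) [Fact ℓ.Prime] (ι : PadicAlgCl ℓ ≃+* ℂ) (ρ : Literature.NumberTheory.GaloisRepresentations.FramedGaloisRep K (PadicAlgCl ℓ) n), ρ.toGaloisRep.IsIrreducible → ((∀ᶠ v : IsDedekindDomain.HeightOneSpectrum (NumberField.RingOfIntegers K) in Filter.cofinite, ρ.IsUnramifiedAt v) ∧ ∀ (v : IsDedekindDomain.HeightOneSpectrum (NumberField.RingOfIntegers K)) (hv : ((ℓ : ℕ) : NumberField.RingOfIntegers K) ∈ v.asIdeal), (Literature.NumberTheory.PAdicHodge.fontainePstAdicCompletion v ℓ hv).IsDeRhamFramed (ρ.toLocal v)) → ¬ (∃ η : Literature.NumberTheory.GaloisRepresentations.FramedGaloisRep K (PadicAlgCl ℓ) 1, (∃ᶠ v : IsDedekindDomain.HeightOneSpectrum (NumberField.RingOfIntegers K) in Filter.cofinite,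 ∃ a : PadicAlgCl ℓ, a ≠ 1 ∧ η.HasFrobCharpolyAt v (Polynomial.X - Polynomial.C a)) ∧ ∀ᶠ v : IsDedekindDomain.HeightOneSpectrum (NumberField.RingOfIntegers K) in Filter.cofinite, ∃ (P : Polynomial (PadicAlgCl ℓ)) (a : PadicAlgCl ℓ), ρ.HasFrobCharpolyAt v P ∧ η.HasFrobCharpolyAt v (Polynomial.X - Polynomial.C a) ∧ P.scaleRoots a = P) → ((¬ (∃ (L : Type) (_ : Field L) (_ : NumberField L) (_ : Algebra K L), IsGalois K L ∧ IsSolvable (L ≃ₐ[K] L) ∧ ∃ (K₀ : Type) (_ : Field K₀) (_ : NumberField K₀) (_ : Algebra K₀ L), IsGalois K₀ L ∧ IsSolvable (L ≃ₐ[K₀] L) ∧ ∃ (ρ₀ : Literature.NumberTheory.GaloisRepresentations.FramedGaloisRep K₀ (PadicAlgCl ℓ) n) (χ : Literature.NumberTheory.GaloisRepresentations.FramedGaloisRep L (PadicAlgCl ℓ) 1), ((∀ᶠ v : IsDedekindDomain.HeightOneSpectrum (NumberField.RingOfIntegers K₀) in Filter.cofinite, ρ₀.IsUnramifiedAt v)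 ∧ ∀ (v : IsDedekindDomain.HeightOneSpectrum (NumberField.RingOfIntegers K₀)) (hv : ((ℓ : ℕ) : NumberField.RingOfIntegers K₀) ∈ v.asIdeal), (Literature.NumberTheory.PAdicHodge.fontainePstAdicCompletion v ℓ hv).IsDeRhamFramed (ρ₀.toLocal v)) ∧ ((NumberField.IsTotallyReal K₀ ∧ ∃ (μ : Literature.NumberTheory.GaloisRepresentations.FramedGaloisRep K₀ (PadicAlgCl ℓ) 1) (A : Matrix (Fin n) (Fin n) (PadicAlgCl ℓ)), IsUnit A.det ∧ (∀ σ : Field.absoluteGaloisGroup K₀, (ρ₀ σ).val.transpose * A * (ρ₀ σ).val = Literature.NumberTheory.GaloisRepresentations.FramedRep.trace μ σ • A) ∧ ∀ (φ : K₀ →+* ℝ) (c : Field.absoluteGaloisGroup K₀), Literature.NumberTheory.GaloisRepresentations.IsComplexConjugation φ c → A.transpose = Literature.NumberTheory.GaloisRepresentations.FramedRep.trace μ c • A) ∨ (NumberField.IsTotallyComplex K₀ ∧ ∃ (F : Type) (_ : Field F) (_ : NumberField F) (_ : Algebra F K₀) (_ : IsGalois F K₀), NumberField.IsTotallyReal F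 ∧ Module.finrank F K₀ = 2 ∧ ∃ μ : Literature.NumberTheory.GaloisRepresentations.FramedGaloisRep F (PadicAlgCl ℓ) 1, ∀ (φ : F →+* ℝ) (c : Field.absoluteGaloisGroup F), Literature.NumberTheory.GaloisRepresentations.IsComplexConjugation φ c → Literature.NumberTheory.GaloisRepresentations.FramedRep.trace μ c = -1 ∧ ∃ B : Matrix (Fin n) (Fin n) (PadicAlgCl ℓ), IsUnit B.det ∧ B.transpose = B ∧ ∀ σ : Field.absoluteGaloisGroup K₀, (ρ₀ σ).val.transpose * B * (ρ₀ (Literature.NumberTheory.GaloisRepresentations.absGaloisOuterConj F K₀ c σ)).val = Literature.NumberTheory.GaloisRepresentations.FramedRep.trace (μ.restrictField K₀) σ • B)) ∧ ∀ g : Field.absoluteGaloisGroup L, Literature.NumberTheory.GaloisRepresentations.FramedRep.trace (ρ.restrictField L) g = Literature.NumberTheory.GaloisRepresentations.FramedRep.trace χ g * Literature.NumberTheory.GaloisRepresentations.FramedRep.trace (ρ₀.restrictField L) g) ∧ (∃ (L : Type) (_ : Field L) (_ : NumberField L) (_ : Algebra K L), IsGalois K L ∧ IsSolvable (L ≃ₐ[K]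 L) ∧ ∃ (K₀ : Type) (_ : Field K₀) (_ : NumberField K₀) (_ : Algebra K₀ L), IsGalois K₀ L ∧ IsSolvable (L ≃ₐ[K₀] L) ∧ ∃ (ρ₀ : Literature.NumberTheory.GaloisRepresentations.FramedGaloisRep K₀ (PadicAlgCl ℓ) n) (χ : Literature.NumberTheory.GaloisRepresentations.FramedGaloisRep L (PadicAlgCl ℓ) 1), ((∀ᶠ v : IsDedekindDomain.HeightOneSpectrum (NumberField.RingOfIntegers K₀) in Filter.cofinite, ρ₀.IsUnramifiedAt v) ∧ ∀ (v : IsDedekindDomain.HeightOneSpectrum (NumberField.RingOfIntegers K₀)) (hv : ((ℓ : ℕ) : NumberField.RingOfIntegers K₀) ∈ v.asIdeal), (Literature.NumberTheory.PAdicHodge.fontainePstAdicCompletion v ℓ hv).IsDeRhamFramed (ρ₀.toLocal v)) ∧ (NumberField.IsTotallyReal K₀ ∨ NumberField.IsCMField K₀) ∧ ∀ g : Field.absoluteGaloisGroup L, Literature.NumberTheory.GaloisRepresentations.FramedRep.trace (ρ.restrictField L) g = Literature.NumberTheory.GaloisRepresentations.FramedRep.trace χ g * Literature.NumberTheory.GaloisRepresentations.FramedRep.trace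 (ρ₀.restrictField L) g)) ∧ ¬ (∀ (v : IsDedekindDomain.HeightOneSpectrum (NumberField.RingOfIntegers K)) (hv : ((ℓ : ℕ) : NumberField.RingOfIntegers K) ∈ v.asIdeal) (τ : v.adicCompletion K →+* PadicAlgCl ℓ), Continuous τ → (ρ.labelledHodgeTateWeightsAt v (Literature.NumberTheory.PAdicHodge.fontainePstAdicCompletion v ℓ hv).algebra (Literature.NumberTheory.PAdicHodge.fontainePstAdicCompletion v ℓ hv).𝔅 τ).Nodup)) → ∃ π : Literature.NumberTheory.Automorphic.CuspidalAutomorphicRepData n K hcpt, π.1.IsLAlgebraic ∧ ∀ᶠ v : IsDedekindDomain.HeightOneSpectrum (NumberField.RingOfIntegers K) in Filter.cofinite, SatakeFrobCompatibleAt ι π.1 ρ v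

-- parent: UnpolarisedTRCMTypeAutomorphy · glue (gen 2)
/--     item stmt-Langlands-33403 · support · rank 306 · closed · proved by Summit.Langlands.Langlands.Theorems.UnpolarisedTRCMTypeAutomorphy_of_split2_proof (prover)
    parent: UnpolarisedTRCMTypeAutomorphy · GLUE: children ⟹ parent · by planner
ConsecutiveWeightAutomorphy → GappedOrdinaryAutomorphy → GappedNonOrdinarySystemAutomorphy →
GappedNonOrdinaryLoneAutomorphy → IrregularUnpolarisedAutomorphy → UnpolarisedTRCMTypeAutomorphy —
pure logic: excluded middles on the inlined weight-string dial (CONS ⊆ REG), on the SlopeLadder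
clause ORD and on the system clause SYS (lens-6-g10 node kernel; certified as
UnpolarisedTRCMTypeAutomorphy_of_split2_proof in
nodes/lens-6-g10-OrdinaryCompanionCarving.split_glue.lean, mock rc 0 with the route-file import only
→ Theorems/PolarisationCarvingUnpolarisedTRCMTypeAutomorphySplit2.lean) -/
@[route_item "route-Langlands-PolarisationCarving"]
def UnpolarisedTRCMTypeAutomorphy_of_split2 : Prop :=
  ConsecutiveWeightAutomorphy → GappedOrdinaryAutomorphy → GappedNonOrdinarySystemAutomorphy → GappedNonOrdinaryLoneAutomorphy → IrregularUnpolarisedAutomorphy → UnpolarisedTRCMTypeAutomorphy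

-- `UnpolarisedTRCMTypeAutomorphy_of_split2` holds: proved by `Summit.Langlands.Langlands.Theorems.UnpolarisedTRCMTypeAutomorphy_of_split2_proof` (its module imports this route file, so no `_holds` link can be stated here).

/-- item stmt-Langlands-32056 · crux · rank 4 · SPLIT (gen 1) into GappedIrregularPolarisedAutomorphy, GapFreeIrregularPolarisedAutomorphy, RegularPolarisedAutomorphy + glue PolarisedTypeAutomorphy_of_split · direct attempts still welcome (low priority) · by planner
why it might fail: irregular polarisable ρ (partial weight one, abelian surfaces over TR fields, weight-one type in rank ≥ 3) have nothing beyond potential modularity (NonRegularWeightBarrier); regular ones with inadequate residue or small ℓ open; one non-modular abelian surface over a real quadratic field refutes it.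
sources: arXiv:1010.2561, ClozelHarrisTaylor2008, arXiv:1812.09269, PilloniStroh2016, Thorne2012Adequate, Literature.Barriers.Langlands.NonRegularWeightBarrier
[crux] POL (OF TOTALLY-ODD-POLARISABLE TYPE — outside the barrier, the defect-zero patching world;
NEW, the ATTACKABLE cell): the same conclusion for those twist-primitive ρ of rank n ≥ 2 that admit
a solvable-Galois sandwich K₀ ⊆ L ⊇ K, a pinned-geometric ρ₀ over K₀ and a character χ of Γ_L with
tr ρ|L = tr χ · tr ρ₀|L, where EITHER K₀ is totally real and ᵗρ₀(σ) A ρ₀(σ) = μ(σ)·A for an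
invertible A, an ℓ-adic character μ and all σ, with ᵗA = μ(c)·A at every complex conjugation c (GSp
with μ(c_v) = −1 or GO with μ(c_v) = +1: ε_v = 1), OR K₀ is totally complex with a totally real
subfield F of index 2 and a character μ of Γ_F with μ(c) = −1 and a symmetric invertible B with
ᵗρ₀(σ) B ρ₀(θ_c σ) = μ|(σ)·B for every complex conjugation c ∈ Γ_F (r^c ≅ r^∨ ⊗ μ, ε_v = 1).
Contains every odd rank-2 ρ over a totally real field (node theorem: A = J₂, μ = det), every
RAESDC/RAECSDC-type ρ, symplectic ρ of abelian varieties over totally real fields, and their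
solvable base changes and twists; engines: CHT, BLGGT Thm 4.2.1 / 4.5.1, Thorne, 10-author §6
(polarisable case), unitary Shimura varieties; open members: irregular polarisable ρ (weight-one
type in rank ≥ 3, abelian surfaces beyond BCGP's -/
@[route_item "route-Langlands-PolarisationCarving", crux]
def PolarisedTypeAutomorphy : Prop :=
  ∀ (K : Type) [Field K] [NumberField K] (n : ℕ) (hcpt : Literature.NumberTheory.Automorphic.isCompact_glFiniteIntegralLevel n K), 2 ≤ n → ∀ (ℓ : ℕ) [Fact ℓ.Prime] (ι : PadicAlgCl ℓ ≃+* ℂ) (ρ : Literature.NumberTheory.GaloisRepresentations.FramedGaloisRep K (PadicAlgCl ℓ) n), ρ.toGaloisRep.IsIrreducible → ((∀ᶠ v : IsDedekindDomain.HeightOneSpectrum (NumberField.RingOfIntegers K) in Filter.cofinite, ρ.IsUnramifiedAt v) ∧ ∀ (v : IsDedekindDomain.HeightOneSpectrum (NumberField.RingOfIntegers K)) (hv : ((ℓ : ℕ) : NumberField.RingOfIntegers K) ∈ v.asIdeal), (Literature.NumberTheory.PAdicHodge.fontainePstAdicCompletion v ℓ hv).IsDeRhamFramed (ρ.toLocal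 v)) → ¬ (∃ η : Literature.NumberTheory.GaloisRepresentations.FramedGaloisRep K (PadicAlgCl ℓ) 1, (∃ᶠ v : IsDedekindDomain.HeightOneSpectrum (NumberField.RingOfIntegers K) in Filter.cofinite, ∃ a : PadicAlgCl ℓ, a ≠ 1 ∧ η.HasFrobCharpolyAt v (Polynomial.X - Polynomial.C a)) ∧ ∀ᶠ v : IsDedekindDomain.HeightOneSpectrum (NumberField.RingOfIntegers K) in Filter.cofinite, ∃ (P : Polynomial (PadicAlgCl ℓ)) (a : PadicAlgCl ℓ), ρ.HasFrobCharpolyAt v P ∧ η.HasFrobCharpolyAt v (Polynomial.X - Polynomial.C a) ∧ P.scaleRoots a = P) → (∃ (L : Type) (_ : Field L) (_ : NumberField L) (_ : Algebra K L), IsGalois K L ∧ IsSolvable (L ≃ₐ[K] L) ∧ ∃ (K₀ : Type) (_ : Field K₀) (_ : NumberField K₀) (_ : Algebra K₀ L), IsGalois K₀ L ∧ IsSolvable (L ≃ₐ[K₀] L) ∧ ∃ (ρ₀ : Literature.NumberTheory.GaloisRepresentations.FramedGaloisRep K₀ (PadicAlgCl ℓ) n) (χ : Literature.NumberTheory.GaloisRepresentations.FramedGaloisRep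 L (PadicAlgCl ℓ) 1), ((∀ᶠ v : IsDedekindDomain.HeightOneSpectrum (NumberField.RingOfIntegers K₀) in Filter.cofinite, ρ₀.IsUnramifiedAt v) ∧ ∀ (v : IsDedekindDomain.HeightOneSpectrum (NumberField.RingOfIntegers K₀)) (hv : ((ℓ : ℕ) : NumberField.RingOfIntegers K₀) ∈ v.asIdeal), (Literature.NumberTheory.PAdicHodge.fontainePstAdicCompletion v ℓ hv).IsDeRhamFramed (ρ₀.toLocal v)) ∧ ((NumberField.IsTotallyReal K₀ ∧ ∃ (μ : Literature.NumberTheory.GaloisRepresentations.FramedGaloisRep K₀ (PadicAlgCl ℓ) 1) (A : Matrix (Fin n) (Fin n) (PadicAlgCl ℓ)), IsUnit A.det ∧ (∀ σ : Field.absoluteGaloisGroup K₀, (ρ₀ σ).val.transpose * A * (ρ₀ σ).val = Literature.NumberTheory.GaloisRepresentations.FramedRep.trace μ σ • A) ∧ ∀ (φ : K₀ →+* ℝ) (c : Field.absoluteGaloisGroup K₀), Literature.NumberTheory.GaloisRepresentations.IsComplexConjugation φ c → A.transpose = Literature.NumberTheory.GaloisRepresentations.FramedRep.trace μ c • A) ∨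 (NumberField.IsTotallyComplex K₀ ∧ ∃ (F : Type) (_ : Field F) (_ : NumberField F) (_ : Algebra F K₀) (_ : IsGalois F K₀), NumberField.IsTotallyReal F ∧ Module.finrank F K₀ = 2 ∧ ∃ μ : Literature.NumberTheory.GaloisRepresentations.FramedGaloisRep F (PadicAlgCl ℓ) 1, ∀ (φ : F →+* ℝ) (c : Field.absoluteGaloisGroup F), Literature.NumberTheory.GaloisRepresentations.IsComplexConjugation φ c → Literature.NumberTheory.GaloisRepresentations.FramedRep.trace μ c = -1 ∧ ∃ B : Matrix (Fin n) (Fin n) (PadicAlgCl ℓ), IsUnit B.det ∧ B.transpose = B ∧ ∀ σ : Field.absoluteGaloisGroup K₀, (ρ₀ σ).val.transpose * B * (ρ₀ (Literature.NumberTheory.GaloisRepresentations.absGaloisOuterConj F K₀ c σ)).val = Literature.NumberTheory.GaloisRepresentations.FramedRep.trace (μ.restrictField K₀) σ • B)) ∧ ∀ g : Field.absoluteGaloisGroup L, Literature.NumberTheory.GaloisRepresentations.FramedRep.trace (ρ.restrictField L) g = Literature.NumberTheory.GaloisRepresentations.FramedRep.trace χ g * Literature.NumberTheory.GaloisRepresentations.FramedRep.trace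 (ρ₀.restrictField L) g) → ∃ π : Literature.NumberTheory.Automorphic.CuspidalAutomorphicRepData n K hcpt, π.1.IsLAlgebraic ∧ ∀ᶠ v : IsDedekindDomain.HeightOneSpectrum (NumberField.RingOfIntegers K) in Filter.cofinite, SatakeFrobCompatibleAt ι π.1 ρ v

-- parent: PolarisedTypeAutomorphy · child (gen 1)
/--     item stmt-Langlands-33820 · crux · rank 401 · open
    parent: PolarisedTypeAutomorphy · by planner
    why it might fail: S-implied, false only with ¬Langlands; as a TARGET doubly barred: irregular (no finite-level lifting, NonRegularWeightBarrier) and gapped (no family witness by Griffiths transversality, FamilyWitnessConsecutiveWeights): partial weight one has not even potential automorphy in print.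
    sources: Literature/Barriers/Langlands/NonRegularWeightBarrier.lean, Literature/Barriers/Langlands/FamilyWitnessConsecutiveWeights.lean, Jarvis1997, DiamondSasaki2025, arXiv:1010.2561, HarrisShepherdbarronTaylor2010
[crux] [DECLARED RESIDUAL of this split · NEW · WEAKER than S and than POL (sub-box) · BARRIER ×2
certified in Lean: NonRegularWeightBarrier head-on (a repeated labelled weight) AND outside the
technique class of FamilyWitnessConsecutiveWeights (kernel `Cert.gapped_has_gap`: a gap a ≤ c ≤ b, c
∉ HT_τ = the hypotheses of `not_isFamilyRealizable_of_gap`, so not even POTENTIAL automorphy is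
reachable by a family witness) · IDEA-NEEDED] PGP = weak automorphy (an L-algebraic cuspidal π on
GL_n/K, Satake–Frobenius compatible a.e.) of every irreducible, pinned-geometric, twist-primitive ρ
: Γ_K → GL_n(ℚ̄_ℓ), n ≥ 2, of totally-odd-polarisable type (POL's box, stmt-Langlands-32056) that is
NOT HT-regular at some (v, τ) AND NOT gap-free at some (possibly different) (v', τ'). Members:
paritious PARTIAL weight one Hilbert type over totally real K ≠ ℚ (weights (1,3): labels {1,1} |
{0,2} — repetition and gap at different labels; «not even potential automorphy is in print», item
32991), ρ_f ⊗ ρ_g of equal weight k ≥ 3 ({0,k−1,k−1,2k−2}), gapped irregular unitary types over CM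
fields. Print-settled sub-population booked BY NAME (never staffed here): functorial images —
WeightMultiplicitySplit.Wal -/
@[route_item "route-Langlands-PolarisationCarving"]
def GappedIrregularPolarisedAutomorphy : Prop :=
  ∀ (K : Type) [Field K] [NumberField K] (n : ℕ) (hcpt : Literature.NumberTheory.Automorphic.isCompact_glFiniteIntegralLevel n K), 2 ≤ n → ∀ (ℓ : ℕ) [Fact ℓ.Prime] (ι : PadicAlgCl ℓ ≃+* ℂ) (ρ : Literature.NumberTheory.GaloisRepresentations.FramedGaloisRep K (PadicAlgCl ℓ) n), ρ.toGaloisRep.IsIrreducible → ((∀ᶠ v : IsDedekindDomain.HeightOneSpectrum (NumberField.RingOfIntegers K) in Filter.cofinite, ρ.IsUnramifiedAt v) ∧ ∀ (v : IsDedekindDomain.HeightOneSpectrum (NumberField.RingOfIntegers K)) (hv : ((ℓ : ℕ) : NumberField.RingOfIntegers K) ∈ v.asIdeal), (Literature.NumberTheory.PAdicHodge.fontainePstAdicCompletion v ℓ hv).IsDeRhamFramed (ρ.toLocal v)) → ¬ (∃ η : Literature.NumberTheory.GaloisRepresentations.FramedGaloisRep K (PadicAlgCl ℓ) 1, (∃ᶠ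 v : IsDedekindDomain.HeightOneSpectrum (NumberField.RingOfIntegers K) in Filter.cofinite, ∃ a : PadicAlgCl ℓ, a ≠ 1 ∧ η.HasFrobCharpolyAt v (Polynomial.X - Polynomial.C a)) ∧ ∀ᶠ v : IsDedekindDomain.HeightOneSpectrum (NumberField.RingOfIntegers K) in Filter.cofinite, ∃ (P : Polynomial (PadicAlgCl ℓ)) (a : PadicAlgCl ℓ), ρ.HasFrobCharpolyAt v P ∧ η.HasFrobCharpolyAt v (Polynomial.X - Polynomial.C a) ∧ P.scaleRoots a = P) → ((∃ (L : Type) (_ : Field L) (_ : NumberField L) (_ : Algebra K L), IsGalois K L ∧ IsSolvable (L ≃ₐ[K] L) ∧ ∃ (K₀ : Type) (_ : Field K₀) (_ : NumberField K₀) (_ : Algebra K₀ L), IsGalois K₀ L ∧ IsSolvable (L ≃ₐ[K₀] L) ∧ ∃ (ρ₀ : Literature.NumberTheory.GaloisRepresentations.FramedGaloisRep K₀ (PadicAlgCl ℓ) n) (χ : Literature.NumberTheory.GaloisRepresentations.FramedGaloisRep L (PadicAlgCl ℓ) 1), ((∀ᶠ v : IsDedekindDomain.HeightOneSpectrum (NumberField.RingOfIntegers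 K₀) in Filter.cofinite, ρ₀.IsUnramifiedAt v) ∧ ∀ (v : IsDedekindDomain.HeightOneSpectrum (NumberField.RingOfIntegers K₀)) (hv : ((ℓ : ℕ) : NumberField.RingOfIntegers K₀) ∈ v.asIdeal), (Literature.NumberTheory.PAdicHodge.fontainePstAdicCompletion v ℓ hv).IsDeRhamFramed (ρ₀.toLocal v)) ∧ ((NumberField.IsTotallyReal K₀ ∧ ∃ (μ : Literature.NumberTheory.GaloisRepresentations.FramedGaloisRep K₀ (PadicAlgCl ℓ) 1) (A : Matrix (Fin n) (Fin n) (PadicAlgCl ℓ)), IsUnit A.det ∧ (∀ σ : Field.absoluteGaloisGroup K₀, (ρ₀ σ).val.transpose * A * (ρ₀ σ).val = Literature.NumberTheory.GaloisRepresentations.FramedRep.trace μ σ • A) ∧ ∀ (φ : K₀ →+* ℝ) (c : Field.absoluteGaloisGroup K₀), Literature.NumberTheory.GaloisRepresentations.IsComplexConjugation φ c → A.transpose = Literature.NumberTheory.GaloisRepresentations.FramedRep.trace μ c • A) ∨ (NumberField.IsTotallyComplex K₀ ∧ ∃ (F : Type) (_ : Field F) (_ : NumberField F) (_ : Algebra F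 K₀) (_ : IsGalois F K₀), NumberField.IsTotallyReal F ∧ Module.finrank F K₀ = 2 ∧ ∃ μ : Literature.NumberTheory.GaloisRepresentations.FramedGaloisRep F (PadicAlgCl ℓ) 1, ∀ (φ : F →+* ℝ) (c : Field.absoluteGaloisGroup F), Literature.NumberTheory.GaloisRepresentations.IsComplexConjugation φ c → Literature.NumberTheory.GaloisRepresentations.FramedRep.trace μ c = -1 ∧ ∃ B : Matrix (Fin n) (Fin n) (PadicAlgCl ℓ), IsUnit B.det ∧ B.transpose = B ∧ ∀ σ : Field.absoluteGaloisGroup K₀, (ρ₀ σ).val.transpose * B * (ρ₀ (Literature.NumberTheory.GaloisRepresentations.absGaloisOuterConj F K₀ c σ)).val = Literature.NumberTheory.GaloisRepresentations.FramedRep.trace (μ.restrictField K₀) σ • B)) ∧ ∀ g : Field.absoluteGaloisGroup L, Literature.NumberTheory.GaloisRepresentations.FramedRep.trace (ρ.restrictField L) g = Literature.NumberTheory.GaloisRepresentations.FramedRep.trace χ g * Literature.NumberTheory.GaloisRepresentations.FramedRep.trace (ρ₀.restrictField L) g) ∧ (¬ (∀ (v : IsDedekindDomain.HeightOneSpectrum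 (NumberField.RingOfIntegers K)) (hv : ((ℓ : ℕ) : NumberField.RingOfIntegers K) ∈ v.asIdeal) (τ : v.adicCompletion K →+* PadicAlgCl ℓ), Continuous τ → (ρ.labelledHodgeTateWeightsAt v (Literature.NumberTheory.PAdicHodge.fontainePstAdicCompletion v ℓ hv).algebra (Literature.NumberTheory.PAdicHodge.fontainePstAdicCompletion v ℓ hv).𝔅 τ).Nodup) ∧ ¬ (∀ (v : IsDedekindDomain.HeightOneSpectrum (NumberField.RingOfIntegers K)) (hv : ((ℓ : ℕ) : NumberField.RingOfIntegers K) ∈ v.asIdeal) (τ : v.adicCompletion K →+* PadicAlgCl ℓ), Continuous τ → ∀ a ∈ (ρ.labelledHodgeTateWeightsAt v (Literature.NumberTheory.PAdicHodge.fontainePstAdicCompletion v ℓ hv).algebra (Literature.NumberTheory.PAdicHodge.fontainePstAdicCompletion v ℓ hv).𝔅 τ), ∀ b ∈ (ρ.labelledHodgeTateWeightsAt v (Literature.NumberTheory.PAdicHodge.fontainePstAdicCompletion v ℓ hv).algebra (Literature.NumberTheory.PAdicHodge.fontainePstAdicCompletion v ℓ hv).𝔅 τ), ∀ c : ℤ,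 a ≤ c → c ≤ b → c ∈ (ρ.labelledHodgeTateWeightsAt v (Literature.NumberTheory.PAdicHodge.fontainePstAdicCompletion v ℓ hv).algebra (Literature.NumberTheory.PAdicHodge.fontainePstAdicCompletion v ℓ hv).𝔅 τ)))) → ∃ π : Literature.NumberTheory.Automorphic.CuspidalAutomorphicRepData n K hcpt, π.1.IsLAlgebraic ∧ ∀ᶠ v : IsDedekindDomain.HeightOneSpectrum (NumberField.RingOfIntegers K) in Filter.cofinite, SatakeFrobCompatibleAt ι π.1 ρ v

-- parent: PolarisedTypeAutomorphy · child (gen 1)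
/--     item stmt-Langlands-33821 · crux · rank 402 · open
    parent: PolarisedTypeAutomorphy · by planner
    why it might fail: S-implied, false only with ¬Langlands; as a TARGET: off the non-degenerate-limit window (abelian g-folds g ≥ 3 with MT = GSp_{2g}, K3 of Picard rank ≤ 16) no automorphic form contributes to any cohomology — «completely out of reach» (BCGP); on the window only potential modularity.
    sources: arXiv:1812.09269, BoxerCalegariGeePilloni2025, CalegariGeraghty2018, Literature/Barriers/Langlands/NonRegularWeightBarrier.lean, Literature/Barriers/Langlands/FamilyWitnessConsecutiveWeights.lean, Literature/Barriers/Langlands/TaylorWilesNumericalCoincidence.lean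
[crux] [NEW · WEAKER than S and than POL (sub-box) · INSIDE the technique class of
FamilyWitnessConsecutiveWeights (interval weights: a same-weight family witness is not excluded) ·
NonRegularWeightBarrier head-on OFF the non-degenerate-limit window · IDEA-NEEDED off the booked
ENGINE window = ONE new census cell (dark g ≥ 3 / K3 Picard ≤ 16; crit-1 advisory g1)] PGF = weak
automorphy of every ρ in POL's box (irreducible, pinned-geometric, twist-primitive, n ≥ 2,
totally-odd-polarisable type) that is NOT HT-regular at some (v, τ) but GAP-FREE at every (v, τ):
the labelled Hodge–Tate weights form an interval of integers with repetitions — abelian varieties of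
every dimension g ≥ 2 with GSp_{2g}- or unitary-type Tate module ({0^g,1^g}), parallel weight one /
totally odd polarised Artin type ({0ⁿ}), K3 / orthogonal weight-2 type ({0,1^{m−2},2}), ρ_f ⊗ ρ_g of
equal weight 2 ({0,1,1,2}). ENGINE window (booked BY NAME:
HolomorphicLimitSplit.HolomorphicLimitAutomorphy 32003 + children;
WeightMultiplicitySplit.WallWeightReciprocity 24354 + children 33602–33605) = members whose π_∞ is a
non-degenerate limit of discrete series: abelian surfaces / GSp₄ weight (2,2) over totally real
fields (B -/
@[route_item "route-Langlands-PolarisationCarving"]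
def GapFreeIrregularPolarisedAutomorphy : Prop :=
  ∀ (K : Type) [Field K] [NumberField K] (n : ℕ) (hcpt : Literature.NumberTheory.Automorphic.isCompact_glFiniteIntegralLevel n K), 2 ≤ n → ∀ (ℓ : ℕ) [Fact ℓ.Prime] (ι : PadicAlgCl ℓ ≃+* ℂ) (ρ : Literature.NumberTheory.GaloisRepresentations.FramedGaloisRep K (PadicAlgCl ℓ) n), ρ.toGaloisRep.IsIrreducible → ((∀ᶠ v : IsDedekindDomain.HeightOneSpectrum (NumberField.RingOfIntegers K) in Filter.cofinite, ρ.IsUnramifiedAt v) ∧ ∀ (v : IsDedekindDomain.HeightOneSpectrum (NumberField.RingOfIntegers K)) (hv : ((ℓ : ℕ) : NumberField.RingOfIntegers K) ∈ v.asIdeal), (Literature.NumberTheory.PAdicHodge.fontainePstAdicCompletion v ℓ hv).IsDeRhamFramed (ρ.toLocal v)) → ¬ (∃ η : Literature.NumberTheory.GaloisRepresentations.FramedGaloisRep K (PadicAlgCl ℓ) 1, (∃ᶠ v : IsDedekindDomain.HeightOneSpectrum (NumberField.RingOfIntegers K) in Filter.cofinite, ∃ a : PadicAlgCl ℓ, a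 ≠ 1 ∧ η.HasFrobCharpolyAt v (Polynomial.X - Polynomial.C a)) ∧ ∀ᶠ v : IsDedekindDomain.HeightOneSpectrum (NumberField.RingOfIntegers K) in Filter.cofinite, ∃ (P : Polynomial (PadicAlgCl ℓ)) (a : PadicAlgCl ℓ), ρ.HasFrobCharpolyAt v P ∧ η.HasFrobCharpolyAt v (Polynomial.X - Polynomial.C a) ∧ P.scaleRoots a = P) → ((∃ (L : Type) (_ : Field L) (_ : NumberField L) (_ : Algebra K L), IsGalois K L ∧ IsSolvable (L ≃ₐ[K] L) ∧ ∃ (K₀ : Type) (_ : Field K₀) (_ : NumberField K₀) (_ : Algebra K₀ L), IsGalois K₀ L ∧ IsSolvable (L ≃ₐ[K₀] L) ∧ ∃ (ρ₀ : Literature.NumberTheory.GaloisRepresentations.FramedGaloisRep K₀ (PadicAlgCl ℓ) n) (χ : Literature.NumberTheory.GaloisRepresentations.FramedGaloisRep L (PadicAlgCl ℓ) 1), ((∀ᶠ v : IsDedekindDomain.HeightOneSpectrum (NumberField.RingOfIntegers K₀) in Filter.cofinite, ρ₀.IsUnramifiedAt v) ∧ ∀ (v : IsDedekindDomain.HeightOneSpectrum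 (NumberField.RingOfIntegers K₀)) (hv : ((ℓ : ℕ) : NumberField.RingOfIntegers K₀) ∈ v.asIdeal), (Literature.NumberTheory.PAdicHodge.fontainePstAdicCompletion v ℓ hv).IsDeRhamFramed (ρ₀.toLocal v)) ∧ ((NumberField.IsTotallyReal K₀ ∧ ∃ (μ : Literature.NumberTheory.GaloisRepresentations.FramedGaloisRep K₀ (PadicAlgCl ℓ) 1) (A : Matrix (Fin n) (Fin n) (PadicAlgCl ℓ)), IsUnit A.det ∧ (∀ σ : Field.absoluteGaloisGroup K₀, (ρ₀ σ).val.transpose * A * (ρ₀ σ).val = Literature.NumberTheory.GaloisRepresentations.FramedRep.trace μ σ • A) ∧ ∀ (φ : K₀ →+* ℝ) (c : Field.absoluteGaloisGroup K₀), Literature.NumberTheory.GaloisRepresentations.IsComplexConjugation φ c → A.transpose = Literature.NumberTheory.GaloisRepresentations.FramedRep.trace μ c • A) ∨ (NumberField.IsTotallyComplex K₀ ∧ ∃ (F : Type) (_ : Field F) (_ : NumberField F) (_ : Algebra F K₀) (_ : IsGalois F K₀), NumberField.IsTotallyReal F ∧ Module.finrank F K₀ = 2 ∧ ∃ μ : Literature.NumberTheory.GaloisRepresentations.FramedGaloisRep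 F (PadicAlgCl ℓ) 1, ∀ (φ : F →+* ℝ) (c : Field.absoluteGaloisGroup F), Literature.NumberTheory.GaloisRepresentations.IsComplexConjugation φ c → Literature.NumberTheory.GaloisRepresentations.FramedRep.trace μ c = -1 ∧ ∃ B : Matrix (Fin n) (Fin n) (PadicAlgCl ℓ), IsUnit B.det ∧ B.transpose = B ∧ ∀ σ : Field.absoluteGaloisGroup K₀, (ρ₀ σ).val.transpose * B * (ρ₀ (Literature.NumberTheory.GaloisRepresentations.absGaloisOuterConj F K₀ c σ)).val = Literature.NumberTheory.GaloisRepresentations.FramedRep.trace (μ.restrictField K₀) σ • B)) ∧ ∀ g : Field.absoluteGaloisGroup L, Literature.NumberTheory.GaloisRepresentations.FramedRep.trace (ρ.restrictField L) g = Literature.NumberTheory.GaloisRepresentations.FramedRep.trace χ g * Literature.NumberTheory.GaloisRepresentations.FramedRep.trace (ρ₀.restrictField L) g) ∧ (¬ (∀ (v : IsDedekindDomain.HeightOneSpectrum (NumberField.RingOfIntegers K)) (hv : ((ℓ : ℕ) : NumberField.RingOfIntegers K) ∈ v.asIdeal) (τ : v.adicCompletion K →+* PadicAlgCl ℓ), Continuous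 τ → (ρ.labelledHodgeTateWeightsAt v (Literature.NumberTheory.PAdicHodge.fontainePstAdicCompletion v ℓ hv).algebra (Literature.NumberTheory.PAdicHodge.fontainePstAdicCompletion v ℓ hv).𝔅 τ).Nodup) ∧ (∀ (v : IsDedekindDomain.HeightOneSpectrum (NumberField.RingOfIntegers K)) (hv : ((ℓ : ℕ) : NumberField.RingOfIntegers K) ∈ v.asIdeal) (τ : v.adicCompletion K →+* PadicAlgCl ℓ), Continuous τ → ∀ a ∈ (ρ.labelledHodgeTateWeightsAt v (Literature.NumberTheory.PAdicHodge.fontainePstAdicCompletion v ℓ hv).algebra (Literature.NumberTheory.PAdicHodge.fontainePstAdicCompletion v ℓ hv).𝔅 τ), ∀ b ∈ (ρ.labelledHodgeTateWeightsAt v (Literature.NumberTheory.PAdicHodge.fontainePstAdicCompletion v ℓ hv).algebra (Literature.NumberTheory.PAdicHodge.fontainePstAdicCompletion v ℓ hv).𝔅 τ), ∀ c : ℤ, a ≤ c → c ≤ b → c ∈ (ρ.labelledHodgeTateWeightsAt v (Literature.NumberTheory.PAdicHodge.fontainePstAdicCompletion v ℓ hv).algebra (Literature.NumberTheory.PAdicHodge.fontainePstAdicCompletion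 v ℓ hv).𝔅 τ)))) → ∃ π : Literature.NumberTheory.Automorphic.CuspidalAutomorphicRepData n K hcpt, π.1.IsLAlgebraic ∧ ∀ᶠ v : IsDedekindDomain.HeightOneSpectrum (NumberField.RingOfIntegers K) in Filter.cofinite, SatakeFrobCompatibleAt ι π.1 ρ v

-- parent: PolarisedTypeAutomorphy · child (gen 1)
/--     item stmt-Langlands-33822 · crux · rank 403 · open
    parent: PolarisedTypeAutomorphy · by planner
    why it might fail: S-implied, false only with ¬Langlands; as a TARGET only POTENTIAL automorphy is in print in general (BLGGT 4.5.1 needs potential diagonalisability, adequate residual image, ℓ ≥ 2(n+1)); automorphy over K itself needs residual automorphy — open beyond GL₂ over ℚ / small real quadratic fields.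
    sources: arXiv:1010.2561, BarnetlambEtAl2014, arXiv:1310.7088, arXiv:1912.11261, Literature/Barriers/Langlands/PatchingLocalComponentBarrier.lean, Literature/Barriers/Langlands/ResiduallyReducibleBarrier.lean
[crux] [NEW · WEAKER than S and than POL (sub-box) · OUTSIDE NonRegularWeightBarrier by construction
· the family barrier's interval clause EVADED in print for regular polarisable r (BLGGT change of
weight) · ATTACKABLE-BY-ENGINE = census class «open with engine»: POTENTIAL automorphy only (rank ≥
3), AUTOMORPHY over K is the open member (crit-1 advisory g1, CRITIC-LEDGER row 143)] PR = weak
automorphy of every ρ in POL's box (irreducible, pinned-geometric, twist-primitive, n ≥ 2, of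
totally-odd-polarisable type: solvable-Galois sandwich onto a pinned-geometric ρ₀ carrying a totally
odd (conjugate-)self-duality, BLGGT §2.1) that is HT-REGULAR at every place v ∣ ℓ and every
continuous label τ (n distinct labelled Hodge–Tate weights). Engines: BLGGT Thm 4.5.1 / Cor 4.5.2
(potential automorphy of ONE r: regular + potentially diagonalisable + r̄|F(ζ_ℓ) irreducible, ℓ ≥
2(n+1)), Thm 4.2.1 (automorphy lifting with change of weight), Thm 5.4.1 (r lies in a strictly pure
compatible system) [arXiv:1010.2561 pp. 26, 30, 39]; rank 2 over totally real K: Freitas–Le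
Hung–Siksek, Derickx–Najman–Siksek, Box; symmetric powers over ℚ and CM: Newton–Thorne; regular
GSp₄: BCGP-type and Pilloni higher -/
@[route_item "route-Langlands-PolarisationCarving"]
def RegularPolarisedAutomorphy : Prop :=
  ∀ (K : Type) [Field K] [NumberField K] (n : ℕ) (hcpt : Literature.NumberTheory.Automorphic.isCompact_glFiniteIntegralLevel n K), 2 ≤ n → ∀ (ℓ : ℕ) [Fact ℓ.Prime] (ι : PadicAlgCl ℓ ≃+* ℂ) (ρ : Literature.NumberTheory.GaloisRepresentations.FramedGaloisRep K (PadicAlgCl ℓ) n), ρ.toGaloisRep.IsIrreducible → ((∀ᶠ v : IsDedekindDomain.HeightOneSpectrum (NumberField.RingOfIntegers K) in Filter.cofinite, ρ.IsUnramifiedAt v) ∧ ∀ (v : IsDedekindDomain.HeightOneSpectrum (NumberField.RingOfIntegers K)) (hv : ((ℓ : ℕ) : NumberField.RingOfIntegers K) ∈ v.asIdeal), (Literature.NumberTheory.PAdicHodge.fontainePstAdicCompletion v ℓ hv).IsDeRhamFramed (ρ.toLocal v)) → ¬ (∃ η : Literature.NumberTheory.GaloisRepresentations.FramedGaloisRep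 K (PadicAlgCl ℓ) 1, (∃ᶠ v : IsDedekindDomain.HeightOneSpectrum (NumberField.RingOfIntegers K) in Filter.cofinite, ∃ a : PadicAlgCl ℓ, a ≠ 1 ∧ η.HasFrobCharpolyAt v (Polynomial.X - Polynomial.C a)) ∧ ∀ᶠ v : IsDedekindDomain.HeightOneSpectrum (NumberField.RingOfIntegers K) in Filter.cofinite, ∃ (P : Polynomial (PadicAlgCl ℓ)) (a : PadicAlgCl ℓ), ρ.HasFrobCharpolyAt v P ∧ η.HasFrobCharpolyAt v (Polynomial.X - Polynomial.C a) ∧ P.scaleRoots a = P) → ((∃ (L : Type) (_ : Field L) (_ : NumberField L) (_ : Algebra K L), IsGalois K L ∧ IsSolvable (L ≃ₐ[K] L) ∧ ∃ (K₀ : Type) (_ : Field K₀) (_ : NumberField K₀) (_ : Algebra K₀ L), IsGalois K₀ L ∧ IsSolvable (L ≃ₐ[K₀] L) ∧ ∃ (ρ₀ : Literature.NumberTheory.GaloisRepresentations.FramedGaloisRep K₀ (PadicAlgCl ℓ) n) (χ : Literature.NumberTheory.GaloisRepresentations.FramedGaloisRep L (PadicAlgCl ℓ) 1), ((∀ᶠ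 v : IsDedekindDomain.HeightOneSpectrum (NumberField.RingOfIntegers K₀) in Filter.cofinite, ρ₀.IsUnramifiedAt v) ∧ ∀ (v : IsDedekindDomain.HeightOneSpectrum (NumberField.RingOfIntegers K₀)) (hv : ((ℓ : ℕ) : NumberField.RingOfIntegers K₀) ∈ v.asIdeal), (Literature.NumberTheory.PAdicHodge.fontainePstAdicCompletion v ℓ hv).IsDeRhamFramed (ρ₀.toLocal v)) ∧ ((NumberField.IsTotallyReal K₀ ∧ ∃ (μ : Literature.NumberTheory.GaloisRepresentations.FramedGaloisRep K₀ (PadicAlgCl ℓ) 1) (A : Matrix (Fin n) (Fin n) (PadicAlgCl ℓ)), IsUnit A.det ∧ (∀ σ : Field.absoluteGaloisGroup K₀, (ρ₀ σ).val.transpose * A * (ρ₀ σ).val = Literature.NumberTheory.GaloisRepresentations.FramedRep.trace μ σ • A) ∧ ∀ (φ : K₀ →+* ℝ) (c : Field.absoluteGaloisGroup K₀), Literature.NumberTheory.GaloisRepresentations.IsComplexConjugation φ c → A.transpose = Literature.NumberTheory.GaloisRepresentations.FramedRep.trace μ c • A) ∨ (NumberField.IsTotallyComplex K₀ ∧ ∃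 (F : Type) (_ : Field F) (_ : NumberField F) (_ : Algebra F K₀) (_ : IsGalois F K₀), NumberField.IsTotallyReal F ∧ Module.finrank F K₀ = 2 ∧ ∃ μ : Literature.NumberTheory.GaloisRepresentations.FramedGaloisRep F (PadicAlgCl ℓ) 1, ∀ (φ : F →+* ℝ) (c : Field.absoluteGaloisGroup F), Literature.NumberTheory.GaloisRepresentations.IsComplexConjugation φ c → Literature.NumberTheory.GaloisRepresentations.FramedRep.trace μ c = -1 ∧ ∃ B : Matrix (Fin n) (Fin n) (PadicAlgCl ℓ), IsUnit B.det ∧ B.transpose = B ∧ ∀ σ : Field.absoluteGaloisGroup K₀, (ρ₀ σ).val.transpose * B * (ρ₀ (Literature.NumberTheory.GaloisRepresentations.absGaloisOuterConj F K₀ c σ)).val = Literature.NumberTheory.GaloisRepresentations.FramedRep.trace (μ.restrictField K₀) σ • B)) ∧ ∀ g : Field.absoluteGaloisGroup L, Literature.NumberTheory.GaloisRepresentations.FramedRep.trace (ρ.restrictField L) g = Literature.NumberTheory.GaloisRepresentations.FramedRep.trace χ g * Literature.NumberTheory.GaloisRepresentations.FramedRep.trace (ρ₀.restrictField L) g) ∧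 (∀ (v : IsDedekindDomain.HeightOneSpectrum (NumberField.RingOfIntegers K)) (hv : ((ℓ : ℕ) : NumberField.RingOfIntegers K) ∈ v.asIdeal) (τ : v.adicCompletion K →+* PadicAlgCl ℓ), Continuous τ → (ρ.labelledHodgeTateWeightsAt v (Literature.NumberTheory.PAdicHodge.fontainePstAdicCompletion v ℓ hv).algebra (Literature.NumberTheory.PAdicHodge.fontainePstAdicCompletion v ℓ hv).𝔅 τ).Nodup)) → ∃ π : Literature.NumberTheory.Automorphic.CuspidalAutomorphicRepData n K hcpt, π.1.IsLAlgebraic ∧ ∀ᶠ v : IsDedekindDomain.HeightOneSpectrum (NumberField.RingOfIntegers K) in Filter.cofinite, SatakeFrobCompatibleAt ι π.1 ρ v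

-- parent: PolarisedTypeAutomorphy · glue (gen 1)
/--     item stmt-Langlands-33823 · support · rank 404 · closed · proved by Summit.Langlands.Langlands.Theorems.PolarisedTypeAutomorphy_of_split_proof (prover)
    parent: PolarisedTypeAutomorphy · GLUE: children ⟹ parent · by planner
RegularPolarisedAutomorphy → GapFreeIrregularPolarisedAutomorphy →
GappedIrregularPolarisedAutomorphy → PolarisedTypeAutomorphy — pure logic: two excluded middles on
the inlined dials (REG «HT-regular everywhere», then GF «gap-free everywhere» inside ¬REG) -/
@[route_item "route-Langlands-PolarisationCarving"]
def PolarisedTypeAutomorphy_of_split : Prop :=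
  GappedIrregularPolarisedAutomorphy → GapFreeIrregularPolarisedAutomorphy → RegularPolarisedAutomorphy → PolarisedTypeAutomorphy

-- `PolarisedTypeAutomorphy_of_split` holds: proved by `Summit.Langlands.Langlands.Theorems.PolarisedTypeAutomorphy_of_split_proof` (its module imports this route file, so no `_holds` link can be stated here).

/-- item stmt-Langlands-25718 · crux · rank 5 · open · by planner
why it might fail: non-cohomological π (Maass forms, limits of discrete series beyond weight one) and π over mixed-signature K: no construction of any ℓ-adic avatar is known; every known one passes through Shimura varieties (NonRegularWeightBarrier, ShimuraVarietyRealizationBarrier).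
sources: BuzzardGeeLMS2014, HarrisLanTaylorThorneRMS2016, Scholze2015, arXiv:2607.11763
[crux] W_geo — every L-algebraic cuspidal π on GL_n over any number field has, for every ℓ and ι,
SOME ℓ-adic ρ unramified almost everywhere, de Rham above ℓ for Fontaine's pinned datum, and
Satake–Frobenius compatible with (π, ι) almost everywhere (no irreducibility asked). Verbatim the
registered stub_weakExistence of crux stmt-Langlands-14328 (line Sketch); implied by Langlands
(landed weakExistence_of_langlands). TAGS (decomp-langlands crit-1 CLEARED 2026-08-30T02:39:41Z
(HOME/STATUS.md L85; HOME/CRITIC-LEDGER.md row 20); census HOME/census/COSTUME-CENSUS-v2.md sha256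
92d1557a2c5727820a56011751c388b645a7fc2e57306ba099f059e21d7ae085): WEAKER (kernel
`Cert.geometricAvatarExistence_of_langlands`; W_geo < W⁺ strictly: on RA ∧ K ⊂ TR ∪ CM existence is
PRINT-closed by HLTT 2016 / Scholze 2015 + AHTW 2026 Thm 1.2.1 while irreducibility (W⁺) is OPEN
there — a genuine weakening; exactness `Cert.aColumn_iff_geometricAvatarExistence`: W⁺ ∧ DR ⟺ W_geo
mod the B-ladder + JS, the node's ONE EQUIV; bc7 CLEAN,
nodes/lens-1-g2-TriangularRankLadder.bc7.txt) · OPEN · DEDUP PARENT: verbatim the registered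
`stub_weakExistence` of crux stmt-Langlands-14328's line Sketch (cite; implied by Langlands v -/
@[route_item "route-Langlands-PolarisationCarving", crux]
def GeometricAvatarExistence : Prop :=
  ∀ (K : Type) [Field K] [NumberField K] (n : ℕ) (hcpt : Literature.NumberTheory.Automorphic.isCompact_glFiniteIntegralLevel n K), 0 < n → ∀ (π : Literature.NumberTheory.Automorphic.CuspidalAutomorphicRepData n K hcpt), π.1.IsLAlgebraic → ∀ (ℓ : ℕ) [Fact ℓ.Prime] (ι : PadicAlgCl ℓ ≃+* ℂ), ∃ ρ : Literature.NumberTheory.GaloisRepresentations.FramedGaloisRep K (PadicAlgCl ℓ) n, ((∀ᶠ v : IsDedekindDomain.HeightOneSpectrum (NumberField.RingOfIntegers K) in Filter.cofinite, ρ.IsUnramifiedAt v) ∧ ∀ (v : IsDedekindDomain.HeightOneSpectrum (NumberField.RingOfIntegers K)) (hv : ((ℓ : ℕ) : NumberField.RingOfIntegers K) ∈ v.asIdeal), (Literature.NumberTheory.PAdicHodge.fontainePstAdicCompletion v ℓ hv).IsDeRhamFramed (ρ.toLocal v)) ∧ ∀ᶠ v : IsDedekindDomain.HeightOneSpectrum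 (NumberField.RingOfIntegers K) in Filter.cofinite, SatakeFrobCompatibleAt ι π.1 ρ v

/-- item stmt-Langlands-25719 · crux · rank 6 · open · by planner
why it might fail: for avatars built by congruences (torsion classes, non-polarizable RA π over CM fields) compatibility at v ∣ ℓ is known only up to semisimplification / monodromy (MonodromyNotClosedUnderPadicLimits); the framed statement needs Fontaine's C_WD for the compatible system.
sources: Caraiani2014, BLGGT2014, arXiv:2607.11763
[crux] Cross-prime transfer of local–global compatibility at v ∣ ℓ (clause (ii) of sibling item
stmt-Langlands-17534, writer frame piece verbatim): for an irreducible ℓ-adic avatar ρ of an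
L-algebraic cuspidal π and a place v above ℓ, local–global compatibility at v for Rec follows from
that of any irreducible ℓ'-adic avatar ρ' of π with ℓ' not below v. TAGS (decomp-langlands crit-1
CLEARED 2026-08-30T02:39:41Z (HOME/STATUS.md L85; HOME/CRITIC-LEDGER.md row 20); census
HOME/census/COSTUME-CENSUS-v2.md sha256
92d1557a2c5727820a56011751c388b645a7fc2e57306ba099f059e21d7ae085): = clause (ii) of P
(stmt-Langlands-17534) VERBATIM = the writer frame piece P(ii) (kernel
`Cert.crossPrimeClass_of_padicMemberCompatibility`: P ⇒ CrossPrimeClass; CrossPrimeClass < P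
strictly: clause (i) de Rham membership is now DERIVED) · WEAKER · OPEN · leaf ATTACKABLE sector
polarizable (Caraiani 2012/2014 ℓ = p local–global compatibility, BLGGT) · BARRIER
`Literature.Barriers.Langlands.MonodromyNotClosedUnderPadicLimits` (the slot where lens-6's LGCAbove
carving — RootDecomp1's GenericFibre 25107 / RecPreservesGenericity 25108 / GenericWDUnique 2374 —
plugs in). [difficulty: open-problem] -/
@[route_item "route-Langlands-PolarisationCarving", crux]
def CrossPrimeClass : Prop :=
  ∀ (K : Type) [Field K] [NumberField K] (n : ℕ) (hcpt : Literature.NumberTheory.Automorphic.isCompact_glFiniteIntegralLevel n K), 0 < n → ∀ (π : Literature.NumberTheory.Automorphic.CuspidalAutomorphicRepData n K hcpt), π.1.IsLAlgebraic → ∀ (ℓ : ℕ) [Fact ℓ.Prime] (ι : PadicAlgCl ℓ ≃+* ℂ) (ρ : Literature.NumberTheory.GaloisRepresentations.FramedGaloisRep K (PadicAlgCl ℓ) n), ρ.toGaloisRep.IsIrreducible → (∀ᶠ v : IsDedekindDomain.HeightOneSpectrum (NumberField.RingOfIntegers K) in cofinite, SatakeFrobCompatibleAt ι π.1 ρ v)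 → ∀ (v : IsDedekindDomain.HeightOneSpectrum (NumberField.RingOfIntegers K)) (hv : ((ℓ : ℕ) : NumberField.RingOfIntegers K) ∈ v.asIdeal), ∀ (Rec : ReciprocityData K) (ℓ' : ℕ) [Fact ℓ'.Prime] (ι' : PadicAlgCl ℓ' ≃+* ℂ) (ρ' : Literature.NumberTheory.GaloisRepresentations.FramedGaloisRep K (PadicAlgCl ℓ') n), ((ℓ' : ℕ) : NumberField.RingOfIntegers K) ∉ v.asIdeal → ρ'.toGaloisRep.IsIrreducible → (∀ᶠ w : IsDedekindDomain.HeightOneSpectrum (NumberField.RingOfIntegers K) in cofinite, SatakeFrobCompatibleAt ι' π.1 ρ' w) → LocalGlobalCompatibleAt Rec ι' π.1 ρ' v → LocalGlobalCompatibleAt Rec ι π.1 ρ v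

/-- item stmt-Langlands-18084 · crux · rank 7 · open · by planner
why it might fail: full (monodromy included) local–global compatibility at ramified v ∤ ℓ is known only for Shimura-type / polarizable π (Caraiani 2012) and up to monodromy in general (Varma); a torsion-class avatar with wrong monodromy refutes it.
sources: Caraiani2012, Varma2014, HarrisLanTaylorThorneRMS2016
[crux] L∤R — Taylor 2004 Conj. 7 at the places v ∤ ℓ, in the `∀ Rec` form (rev 4, lockstep re-type
after the summit re-type p141787 `∀ F, Nonempty (ReciprocityData F) ∧ ∀ 𝓡 …`): for every number
field K and EVERY reciprocity datum Rec (Henniart-normalised local Langlands data with THE canonical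
Artin pins — the summit's `∀ 𝓡`), every n ≥ 1 and hcpt, every L-algebraic cuspidal π of GL_n(𝔸_K),
every (ℓ, ι) and every IRREDUCIBLE ρ : Γ_K → GL_n(ℚ̄_ℓ) that is pinned-geometric (unramified a.e.,
de Rham above ℓ for Fontaine's pinned datum) and Satake–Frobenius compatible with (π, ι) a.e.:
`LocalGlobalCompatibleAt Rec ι π ρ v` at every finite v ∤ ℓ (Grothendieck–Deligne Weil–Deligne
representation, Frobenius-semisimplified, ↔ rec_v(π_v)). = item L∤ (stmt-Langlands-17417, ∃-Rec
form; verbatim the registered stub `stub_pairCompatibilityAway` of line `Sketch` of crux 14328) with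
Rec moved from `∃ Rec,` to a universal binder after K and nothing else changed; the ∃-form is
implied back by L∤R ∧ CanonicalReciprocityData (`compatibilityAwayFromL_existsForm`).
Kernel-certified consequence of the re-typed summit (`compatibilityAwayFromLR_of_langlands`, planner
bc/SubsOfLanglandsR.lean: direction (A -/
@[route_item "route-Langlands-PolarisationCarving", crux]
def CompatibilityAwayFromLR : Prop :=
  ∀ (K : Type) [Field K] [NumberField K] (Rec : ReciprocityData K) (n : ℕ) (hcpt : Literature.NumberTheory.Automorphic.isCompact_glFiniteIntegralLevel n K), 0 < n → ∀ (π : Literature.NumberTheory.Automorphic.CuspidalAutomorphicRepData n K hcpt), π.1.IsLAlgebraic → ∀ (ℓ : ℕ) [Fact ℓ.Prime] (ι : PadicAlgCl ℓ ≃+* ℂ) (ρ : Literature.NumberTheory.GaloisRepresentations.FramedGaloisRep K (PadicAlgCl ℓ) n), ρ.toGaloisRep.IsIrreducible → ((∀ᶠ v : IsDedekindDomain.HeightOneSpectrum (NumberField.RingOfIntegers K) in cofinite, ρ.IsUnramifiedAt v) ∧ ∀ (v : IsDedekindDomain.HeightOneSpectrum (NumberField.RingOfIntegers K)) (hv : ((ℓ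 : ℕ) : NumberField.RingOfIntegers K) ∈ v.asIdeal), (Literature.NumberTheory.PAdicHodge.fontainePstAdicCompletion v ℓ hv).IsDeRhamFramed (ρ.toLocal v)) → (∀ᶠ v : IsDedekindDomain.HeightOneSpectrum (NumberField.RingOfIntegers K) in cofinite, SatakeFrobCompatibleAt ι π.1 ρ v) → ∀ v : IsDedekindDomain.HeightOneSpectrum (NumberField.RingOfIntegers K), ((ℓ : ℕ) : NumberField.RingOfIntegers K) ∉ v.asIdeal → LocalGlobalCompatibleAt Rec ι π.1 ρ v

/-- item stmt-Langlands-17930 · support · rank 9 · open · by planner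
sources: HarrisTaylor2001, Fontaine1994
[support] THE SUMMIT'S NON-VACUITY CONJUNCT, verbatim (statement revision p141787, 2026-08-17:
`Langlands := ∀ F, Nonempty (ReciprocityData F) ∧ ∀ 𝓡 n, 0 < n → ∀ hcpt, GLC n F 𝓡 hcpt`, with
`ReciprocityData` pinned to THE local Artin maps by `llc_isCanonical` / `llc_eps_isCanonical`),
filed by route-repair 5a1bd9af as the explicit INPUT of this route's `∃ RD`-shaped slices
(LiftB2Unram, LiftB2UnramSmallF, LiftB2UnramLargeF, LiftB2UnramSplitP): for every number field F and
every finite place v, a local Langlands datum for GL_n(F_v) (Harris–Taylor 2001 Thm A; Henniart 2000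
Thm 1.2) normalised against THE local Artin map `canonicalArtin (F_v)`, whose ε-system (Deligne 1973
Thm 4.1) is normalised against the canonical Artin map of every finite E/F_v. IN PRINT,
textbook-grade input (Harris–Taylor's Thm A is stated relative to Art_K of local class field
theory); in the TREE not yet derivable — `LocalLanglandsDatum.nonempty` (cite-only) yields a datum
with SOME lawful Artin normalisation, and canonicity needs `IsLocalArtinMap.unique` + the
finite-level reciprocity law for that datum's Artin maps, or canonical variants of
`localLanglands_gl` / `nonempty_localEpsilonSystem` (needs-fact for -/
@[route_item "route-Langlands-PolarisationCarving", crux]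
def CanonicalReciprocityData : Prop :=
  ∀ (F : Type) [Field F] [NumberField F], Nonempty (Summit.Langlands.ReciprocityData F)

/-- item stmt-Langlands-24805 · support · rank 9 · open · by planner
sources: Weil1956, SerreAbelianLadic1968
[support] Grade 1 of the ladder: every (irreducible) pinned-geometric ℓ-adic character of Γ_K is
weakly automorphic (an L-algebraic Hecke character matching a.e.). Verbatim the registered
stub_rankOne (Cruxes/SectorComplement/Lines/birth_WeakGeometricAutomorphy.lean); print: class field
theory + Weil 1956 + Serre 1968 III.2.3 + abelian Fontaine–Mazur. TAGS: WEAKER · PRINT ·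
ATTACKABLE[closed-mod-print; = the registered `stub_rankOne` verbatim — one proof closes both].
[difficulty: provable-now] -/
@[route_item "route-Langlands-PolarisationCarving", crux]
def RankOneAutomorphy : Prop :=
  ∀ (K : Type) [Field K] [NumberField K] (hcpt : Literature.NumberTheory.Automorphic.isCompact_glFiniteIntegralLevel 1 K) (ℓ : ℕ) [Fact ℓ.Prime] (ι : PadicAlgCl ℓ ≃+* ℂ) (ρ : Literature.NumberTheory.GaloisRepresentations.FramedGaloisRep K (PadicAlgCl ℓ) 1), ρ.toGaloisRep.IsIrreducible → ((∀ᶠ v : IsDedekindDomain.HeightOneSpectrum (NumberField.RingOfIntegers K) in cofinite, ρ.IsUnramifiedAt v) ∧ ∀ (v : IsDedekindDomain.HeightOneSpectrum (NumberField.RingOfIntegers K)) (hv : ((ℓ : ℕ) : NumberField.RingOfIntegers K) ∈ v.asIdeal), (Literature.NumberTheory.PAdicHodge.fontainePstAdicCompletion v ℓ hv).IsDeRhamFramed (ρ.toLocal v)) → ∃ π : Literature.NumberTheory.Automorphic.CuspidalAutomorphicRepData 1 K hcpt, π.1.IsLAlgebraic ∧ ∀ᶠ v : IsDedekindDomain.HeightOneSpectrum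 (NumberField.RingOfIntegers K) in cofinite, SatakeFrobCompatibleAt ι π.1 ρ v

/-- item stmt-Langlands-24806 · support · rank 9 · open · by planner
sources: ArthurClozelAMS120, Henniart2012
[support] The inductive step of the ladder, isolated: for an irreducible pinned-geometric ρ of rank
n ≥ 2 WITH a self-twist, weak automorphy at all ranks m < n (over all number fields) implies weak
automorphy of ρ — Clifford (ρ ≅ Ind_E σ, E/K cyclic of prime degree) + cyclic automorphic induction
in Satake form (Arthur–Clozel Ch. 3 Thm 6.2, Lemma 6.4; Henniart 2012 at ∞); tree facts
automorphicInduction_cyclic_cuspidal(_unramified),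
Henniart2012_infinityType_of_automorphicInduction,
ArthurClozel1989_automorphicInduction_of_selfTwist,
FramedGaloisRep.nonempty_equiv_of_hasFrobCharpolyAt_eventually. TAGS: WEAKER · PRINT (given all
lower grades) · ATTACKABLE[closed-mod-print: theorem
`FramedGaloisRep.nonempty_equiv_of_hasFrobCharpolyAt_eventually` (Chebotarev–Brauer–Nesbitt),
Clifford, the AI Prop-facts and Henniart's archimedean theorems named above]. [difficulty: M] -/
@[route_item "route-Langlands-PolarisationCarving", crux]
def CyclicInductionTransport : Prop :=
  ∀ (K : Type) [Field K] [NumberField K] (n : ℕ) (hcpt : Literature.NumberTheory.Automorphic.isCompact_glFiniteIntegralLevel n K), 2 ≤ n → ∀ (ℓ : ℕ) [Fact ℓ.Prime] (ι : PadicAlgCl ℓ ≃+* ℂ) (ρ : Literature.NumberTheory.GaloisRepresentations.FramedGaloisRep K (PadicAlgCl ℓ) n), ρ.toGaloisRep.IsIrreducible → ((∀ᶠ v : IsDedekindDomain.HeightOneSpectrum (NumberField.RingOfIntegers K) in Filter.cofinite, ρ.IsUnramifiedAt v) ∧ ∀ (v : IsDedekindDomain.HeightOneSpectrum (NumberField.RingOfIntegers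 K)) (hv : ((ℓ : ℕ) : NumberField.RingOfIntegers K) ∈ v.asIdeal), (Literature.NumberTheory.PAdicHodge.fontainePstAdicCompletion v ℓ hv).IsDeRhamFramed (ρ.toLocal v)) → (∃ η : Literature.NumberTheory.GaloisRepresentations.FramedGaloisRep K (PadicAlgCl ℓ) 1, (∃ᶠ v : IsDedekindDomain.HeightOneSpectrum (NumberField.RingOfIntegers K) in Filter.cofinite, ∃ a : PadicAlgCl ℓ, a ≠ 1 ∧ η.HasFrobCharpolyAt v (Polynomial.X - Polynomial.C a)) ∧ ∀ᶠ v : IsDedekindDomain.HeightOneSpectrum (NumberField.RingOfIntegers K) in Filter.cofinite, ∃ (P : Polynomial (PadicAlgCl ℓ)) (a : PadicAlgCl ℓ), ρ.HasFrobCharpolyAt v P ∧ η.HasFrobCharpolyAt v (Polynomial.X - Polynomial.C a) ∧ P.scaleRoots a = P) → (∀ m : ℕ, m < n → ∀ (E : Type) [Field E] [NumberField E] (hE : Literature.NumberTheory.Automorphic.isCompact_glFiniteIntegralLevel m E), 0 < m → ∀ (ℓ' : ℕ) [Fact ℓ'.Prime] (ι' : PadicAlgCl ℓ' ≃+* ℂ)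 (σ : Literature.NumberTheory.GaloisRepresentations.FramedGaloisRep E (PadicAlgCl ℓ') m), σ.toGaloisRep.IsIrreducible → ((∀ᶠ v : IsDedekindDomain.HeightOneSpectrum (NumberField.RingOfIntegers E) in Filter.cofinite, σ.IsUnramifiedAt v) ∧ ∀ (v : IsDedekindDomain.HeightOneSpectrum (NumberField.RingOfIntegers E)) (hv : ((ℓ' : ℕ) : NumberField.RingOfIntegers E) ∈ v.asIdeal), (Literature.NumberTheory.PAdicHodge.fontainePstAdicCompletion v ℓ' hv).IsDeRhamFramed (σ.toLocal v)) → ∃ π : Literature.NumberTheory.Automorphic.CuspidalAutomorphicRepData m E hE, π.1.IsLAlgebraic ∧ ∀ᶠ v : IsDedekindDomain.HeightOneSpectrum (NumberField.RingOfIntegers E) in Filter.cofinite, SatakeFrobCompatibleAt ι' π.1 σ v) → ∃ π : Literature.NumberTheory.Automorphic.CuspidalAutomorphicRepData n K hcpt, π.1.IsLAlgebraic ∧ ∀ᶠ v : IsDedekindDomain.HeightOneSpectrum (NumberField.RingOfIntegers K) in Filter.cofinite, SatakeFrobCompatibleAt ι π.1 ρ v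

/-- item stmt-Langlands-25720 · support · rank 9 · open · by planner
sources: ArthurClozelAMS120, JacquetShalikaAJM1981II
[support] Arthur–Clozel Ch. 3 (2.2) for Borel–Jacquet data: finite non-zero boundary values of the
partial Rankin–Selberg L-function on Re s = 1 off the polar set — the Literature named fact itself
(no _holds yet; = stmt-Langlands-13622 unfolded). TAGS (decomp-langlands crit-1 CLEARED
2026-08-30T02:39:41Z (HOME/STATUS.md L85; HOME/CRITIC-LEDGER.md row 20)): PRINT support = ALIAS of
the Literature named fact
`Literature.NumberTheory.Automorphic.JacquetShalika1981_partialPairL_boundary_repData`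
(PairLFunctionPolesRepData.lean :158, reduced there to L² leaves by the `_of_L2` theorems; =
stmt-Langlands-13622 unfolded) · ATTACKABLE (Literature proof item) · no catalogued barrier.
[difficulty: L] -/
@[route_item "route-Langlands-PolarisationCarving", crux]
def PairLBoundary : Prop :=
  Literature.NumberTheory.Automorphic.JacquetShalika1981_partialPairL_boundary_repData

/-- item stmt-Langlands-25721 · support · rank 9 · open · by planner
sources: ArthurClozelAMS120, JacquetShalikaAJM1981II
[support] Arthur–Clozel Ch. 3 (2.3): the simple pole of the partial Rankin–Selberg L-function of a
cuspidal pair on the polar set — the Literature named fact itself (no _holds yet). TAGS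
(decomp-langlands crit-1 CLEARED 2026-08-30T02:39:41Z (HOME/STATUS.md L85; HOME/CRITIC-LEDGER.md row
20)): PRINT support = ALIAS of the Literature named fact
`Literature.NumberTheory.Automorphic.JacquetShalika1981_partialPairL_pole_repData`
(PairLFunctionPolesRepData.lean :182) · ATTACKABLE · no catalogued barrier. [difficulty: L] -/
@[route_item "route-Langlands-PolarisationCarving", crux]
def PairLPole : Prop :=
  Literature.NumberTheory.Automorphic.JacquetShalika1981_partialPairL_pole_repData

/-- item stmt-Langlands-32057 · assembly · rank 1 · closed · proved by Summit.Langlands.Langlands.Theorems.polarisationCarving_assembly_proof (prover) · by planner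
sources: ArthurClozelAMS120
[assembly] PolarisedTypeAutomorphy → UnpolarisedTRCMTypeAutomorphy → NonTRCMTypeAutomorphy →
RankOneAutomorphy → CyclicInductionTransport → GeometricAvatarExistence → PairLBoundary → PairLPole
→ CrossPrimeClass → CompatibilityAwayFromLR → CanonicalReciprocityData → Langlands [TAGS: RESIDUAL
MODE node lens-6-g8 PolarisationCarving (bus L482; CHILD route of
route-Langlands-TriangularRankLadder refining its declared residual R3p =
HigherRankPrimitiveAutomorphy stmt-Langlands-24804 together with R2 24803 through the ONE EQUIV R2 ∧
R3p ⟺ PrimitiveAutomorphy), crit-1 g3 CLEARED 2026-08-30T10:11:44Z STATUS L488 (CRITIC-LEDGER row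
104); census of record HOME/census/COSTUME-CENSUS-v12; filed by writer-1-g3 (cell route-writer); NTC
= NonTRCMTypeAutomorphy DECLARED RESIDUAL (not of TR/CM type — Shimura-realization shadow), UNP =
UnpolarisedTRCMTypeAutomorphy OPEN positive-defect world (attackable up to potential in the regular
CM part), POL = PolarisedTypeAutomorphy ATTACKABLE-BY-ENGINE (outside
TaylorWilesNumericalCoincidenceNarrow by definition).] -/
@[route_item "route-Langlands-PolarisationCarving"]
def Assembly : Prop :=
  PolarisedTypeAutomorphy → UnpolarisedTRCMTypeAutomorphy → NonTRCMTypeAutomorphy → RankOneAutomorphy → CyclicInductionTransport → GeometricAvatarExistence → PairLBoundary → PairLPole → CrossPrimeClass → CompatibilityAwayFromLR → CanonicalReciprocityData → _root_.Langlands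

-- `Assembly` holds: proved by `Summit.Langlands.Langlands.Theorems.polarisationCarving_assembly_proof` (its module imports this route file, so no `_holds` link can be stated here).

/-! D-0027 §2.1 — DECIDING THEOREM (planner-authored via `route open/edit --closes-file`; by planner-decomp-langlands-writer-1-g3-0 2026-08-30T10:12:10Z):
its hypotheses are this route's items and its conclusion the sub-problem Statement (glue_lint), and it elaborates with this file. -/

@[closes "route-Langlands-PolarisationCarving"] theorem closes (hPOL : PolarisedTypeAutomorphy) (hUNP : UnpolarisedTRCMTypeAutomorphy) (hNTC : NonTRCMTypeAutomorphy)
    (h1 : RankOneAutomorphy) (hT : CyclicInductionTransport) (hG : GeometricAvatarExistence) (h22 : PairLBoundary) (h23 : PairLPole)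
    (hX : CrossPrimeClass) (hA : CompatibilityAwayFromLR) (hR : CanonicalReciprocityData) : _root_.Langlands := by
  -- the whole twist-primitive box, every rank n ≥ 2, from the three polarisation cells (two excluded middles; no transport, no EQUIV)
  have hP : ∀ (K : Type) [Field K] [NumberField K] (n : ℕ) (hcpt : Literature.NumberTheory.Automorphic.isCompact_glFiniteIntegralLevel n K), 2 ≤ n → ∀ (ℓ : ℕ) [Fact ℓ.Prime] (ι : PadicAlgCl ℓ ≃+* ℂ) (ρ : Literature.NumberTheory.GaloisRepresentations.FramedGaloisRep K (PadicAlgCl ℓ) n), ρ.toGaloisRep.IsIrreducible → ((∀ᶠ v : IsDedekindDomain.HeightOneSpectrum (NumberField.RingOfIntegers K) in Filter.cofinite, ρ.IsUnramifiedAt v) ∧ ∀ (v : IsDedekindDomain.HeightOneSpectrum (NumberField.RingOfIntegers K)) (hv : ((ℓ : ℕ) : NumberField.RingOfIntegers K) ∈ v.asIdeal), (Literature.NumberTheory.PAdicHodge.fontainePstAdicCompletion v ℓ hv).IsDeRhamFramed (ρ.toLocal v)) → ¬ (∃ η : Literature.NumberTheory.GaloisRepresentations.FramedGaloisRep K (PadicAlgCl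 ℓ) 1, (∃ᶠ v : IsDedekindDomain.HeightOneSpectrum (NumberField.RingOfIntegers K) in Filter.cofinite, ∃ a : PadicAlgCl ℓ, a ≠ 1 ∧ η.HasFrobCharpolyAt v (Polynomial.X - Polynomial.C a)) ∧ ∀ᶠ v : IsDedekindDomain.HeightOneSpectrum (NumberField.RingOfIntegers K) in Filter.cofinite, ∃ (P : Polynomial (PadicAlgCl ℓ)) (a : PadicAlgCl ℓ), ρ.HasFrobCharpolyAt v P ∧ η.HasFrobCharpolyAt v (Polynomial.X - Polynomial.C a) ∧ P.scaleRoots a = P) → ∃ π : Literature.NumberTheory.Automorphic.CuspidalAutomorphicRepData n K hcpt, π.1.IsLAlgebraic ∧ ∀ᶠ v : IsDedekindDomain.HeightOneSpectrum (NumberField.RingOfIntegers K) in Filter.cofinite, SatakeFrobCompatibleAt ι π.1 ρ v := by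
    intro K _ _ n hcpt hn ℓ _ ι ρ hirr hgeo htw
    by_contra hno
    exact hno (hNTC K n hcpt hn ℓ ι ρ hirr hgeo htw fun hs =>
      hno (hUNP K n hcpt hn ℓ ι ρ hirr hgeo htw ⟨fun hp => hno (hPOL K n hcpt hn ℓ ι ρ hirr hgeo htw hp), hs⟩))
  refine _root_.Summit.Langlands.Langlands.Theses.TriangularRankLadder.closes h1 ?_ ?_ hT hG h22 h23 hX hA hR
  · intro K _ _ hcpt ℓ _ ι ρ hirr hgeo htw
    exact hP K 2 hcpt le_rfl ℓ ι ρ hirr hgeo htw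
  · intro K _ _ n hcpt hn ℓ _ ι ρ hirr hgeo htw
    exact hP K n hcpt (by omega) ℓ ι ρ hirr hgeo htw

end Summit.Langlands.Langlands.Theses.PolarisationCarving
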